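import Summits.MatrixMultiplication.MatrixMultiplication.Theses.ThinBlockAlpha
import Literature.Computability.AlgebraicComplexity.GroupTheoreticMatMulThmBProofs
import Summits.MatrixMultiplication.MatrixMultiplication.Theses.GroupTheoreticSTPP
import Literature.Computability.AlgebraicComplexity.LocalStrongUSP
import Summits.MatrixMultiplication.MatrixMultiplication.Theorems.ThinBlockAlphaUSPToBounded

set_option linter.dupNamespace false  -- `Summit.<S>.<S>.…` is the mandated namespace (lakefile does the same)

/-!
# Disproof of `ThinPackings` (crux stmt-MatrixMultiplication-10595, route ThinBlockAlpha) — findings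

WORK FILE of the standing disprover (cdisprove), cycles 1–3.  Prose only in docstrings;
everything else is kernel-checked (rc 0, no `sorry`).  NEW IN CYCLE 3 (§9, §4): the DIAGONAL
`η = a` IS NOT A BARRIER — kernel designs (CKSU Thm 33 on three small local strong USPs, rescaled
by `thinSlice_of_design`) make the slices `η > 9a/11`, `η > 2a/3 (a ≤ 1/3)`, `η > 5a/12 (a ≤ 1/4)`
TRUE; the true region is star-shaped and log-convex (frontier `η*` convex, `η*(0) = 0`,
`ThinPackings ↔ η*(1) = 0`); an explicit infinite skew-USP family gives `η*(a) = o(a)`: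
`not_thinPackingsDiagonalBarrier`, `not_thinPackingsLinearBarrier`.  §4 now holds the necessary
conditions on the lead's hardest stub `stub_multiRadiusFrames` (`(7/5)^D ≤ N^η`).
HEADLINE (cycle 2, §7):
`¬ ThinPackings ↔ ¬ X_C` — the crux is the abelian-STPP `ω = 2` target `CThesis` (stmt-0593,
route GroupTheoreticSTPP) in costume: only the lower bound `N^a ≤ M` is imposed, so square
blocks qualify, and the symmetrised cube of a thin family is square.  A refutation of the crux
is therefore EXACTLY the unbounded-exponent abelian-STPP barrier (open in print), and nothing
weaker.  Index:

* §1 Packing lemmas from `IsSTPP` (two long legs; "two legs + one short leg"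
  `Σ|Aₖ||Cₖ| + Σ|Bⱼ||Cⱼ| − |C_{i₀}| ≤ |H|`); thin profile: `L·N² + (L·M·N − N) ≤ |H|`.
* §2 Load-bearing analysis: dropping `2 ≤ N`, dropping `N^a ≤ M`, or `a = 0` ⇒ trivially TRUE.
* §3 Quantitative necessities (`N^{a−η} ≤ L`, `M ≤ N(N^η − 1) + 1`, single-block tightness) and
  refuted strengthenings: `η = 0`; `L = 1` (iff `η < a`); bounded `N`; bounded exponent.
  LANDED: Negative/ThinPackingsPacking.lean (p73238), ThinPackingsStrengtheningsFalse.lean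
  (p74493), ThinPackingsReduction.lean (p74051).
* §6 (cycle 2) Difference cores: `(Σ|Bᵢ||Cᵢ|)·|P| ≤ |H|` for `P − P ⊆ ⋂ (Aᵢ − Aᵢ)` and the two
  rotations; NO LEG OF A WITNESS FAMILY IS A FAMILY OF TRANSLATES (`η < a`), each leg meets
  `≥ M·N^{−η}` translation classes, middle sets share difference-cores of size `≤ N^η` only.
  LANDED: Negative/ThinPackingsDifferenceCores.lean (p76083).
* §7 (cycle 2) THE COSTUME THEOREM `¬ ThinPackings ↔ ¬ SquareNearTight ↔ ¬ CThesis`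
  (BCCGNSU §3.2 forwards; tree `AddSimultaneousTPP.pi/prod/rotate/comp`, `wordType`).
  LANDING: Negative/ThinPackingsIffCThesis.lean (p76748).
* §7b (cycle 2) The "genuinely thin" repair `N^a ≤ M ≤ N^{a+η}` is STILL `X_C` in costume
  (`¬ GenuinelyThin ↔ ¬ CThesis`: power up + product with a split block `⟨m,1,m⟩`).
  LANDING: Negative/ThinPackingsGenuinelyThin.lean (p78054).
* §8 (cycle 2) Regimes: TRUE region `a < η` (split block, tight against `no_single_thin_block`);
  host-size cap `|H|^{δ_ℓ} ≤ N^{(2−2a)/3+η}` and `(2+a)δ_ℓ ≤ (2−2a)/3 + η` at exponent `ℓ`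
  (strong Thm B).  LANDING: Negative/ThinPackingsRegimes.lean (p78028).
* §9 (cycle 3) THE TRUE WEDGE: `ThinSlice`, `thinSlice_of_design` (rescaling), `thinSlice_of_usp`
  (CKSU Thm 33 designs), `U₂/U₄/U₉`, wedges `9a < 11η`, `2a < 3η (a ≤ 1/3)`, `5a < 12η (a ≤ 1/4)`,
  `not_thinPackingsDiagonalBarrier`; the infinite family `lrow n`, `thinSlice_small_shape`
  (`η*(a) = o(a)`), `not_thinPackingsLinearBarrier`.  LANDING: Negative/ThinPackingsTrueWedge.lean.
* §4 Targets (cycle 3): the registered hardest stub `stub_multiRadiusFrames` — necessary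
  conditions `L·N² ≤ (4b+1)^D`, `(6b+1)^D ≤ (4b+1)^D·N^η`, `b ≥ 1`, `(7/5)^D ≤ N^η`
  (no stub is false by a `_false_without_` theorem; no stuck stubs registered).
  LANDING: Negative/MultiRadiusFramesNecessary.lean.
* §5 Why the crux resists; what a kill needs; attacks tried (cycles 1–3) and why each stops.
-/

namespace Summit.MatrixMultiplication.MatrixMultiplication.Cruxes.ThinPackings.Disproof

open Literature.Computability.AlgebraicComplexity Finset
open Summit.MatrixMultiplication.MatrixMultiplication.Theses.ThinBlockAlpha (ThinPackings)

/-! ## §1 Packing lemmas -/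

section Packing

variable {H : Type*} [AddCommGroup H] {L : ℕ} {A B C : Fin L → Finset H}

/-- `(k, s, u') ↦ s − u'` is injective on `⨆ₖ Aₖ × Cₖ` (all `Bₖ` nonempty): the two long legs
pack.  [folklore; BCCGNSU 2017 §2 packing bound, rotated] -/
theorem injOn_sub_AC (hS : IsSTPP A B C) (hB : ∀ i, (B i).Nonempty) :
    Set.InjOn (fun x : (Σ _ : Fin L, H × H) => x.2.1 - x.2.2)
      ↑(univ.sigma fun k => A k ×ˢ C k) := by
  classical
  rintro ⟨k, s, u'⟩ hx ⟨k₂, s₂, u₂⟩ hy he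
  simp only [coe_sigma, Set.mem_sigma_iff, coe_univ, Set.mem_univ, true_and, coe_product,
    Set.mem_prod, mem_coe] at hx hy
  change s - u' = s₂ - u₂ at he
  obtain ⟨b, hb⟩ := hB k₂
  have h0 : (s₂ - s) + (b - b) + (u' - u₂) = 0 := by
    have : (s₂ - s) + (b - b) + (u' - u₂) = (s₂ - u₂) - (s - u') := by abel
    rw [this, he, sub_self]
  obtain ⟨-, h2, h3, -, h5⟩ := hS k₂ k₂ k s hx.1 s₂ hy.1 b hb b hb u₂ hy.2 u' hx.2 h0
  subst h2 h3 h5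
  rfl

/-- `(j, t', u) ↦ t' − u` is injective on `⨆ⱼ Bⱼ × Cⱼ` (all `Aⱼ` nonempty). [folklore] -/
theorem injOn_sub_BC (hS : IsSTPP A B C) (hA : ∀ i, (A i).Nonempty) :
    Set.InjOn (fun x : (Σ _ : Fin L, H × H) => x.2.1 - x.2.2)
      ↑(univ.sigma fun j => B j ×ˢ C j) := by
  classical
  rintro ⟨j, t', u⟩ hx ⟨j₂, t₂, u₂⟩ hy he
  simp only [coe_sigma, Set.mem_sigma_iff, coe_univ, Set.mem_univ, true_and, coe_product,
    Set.mem_prod, mem_coe] at hx hy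
  change t' - u = t₂ - u₂ at he
  obtain ⟨a, ha⟩ := hA j₂
  have h0 : (a - a) + (t' - t₂) + (u₂ - u) = 0 := by
    have : (a - a) + (t' - t₂) + (u₂ - u) = (t' - u) - (t₂ - u₂) := by abel
    rw [this, he, sub_self]
  obtain ⟨h1, -, -, h4, h5⟩ := hS j₂ j j₂ a ha a ha t₂ hy.1 t' hx.1 u hx.2 u₂ hy.2 h0
  subst h1 h4 h5
  rfl

variable [Fintype H]

/-- Two long legs pack: `Σₖ |Aₖ| |Cₖ| ≤ |H|`. [folklore; BCCGNSU 2017 §2] -/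
theorem sum_card_A_mul_card_C_le (hS : IsSTPP A B C) (hB : ∀ i, (B i).Nonempty) :
    ∑ k, (A k).card * (C k).card ≤ Fintype.card H := by
  classical
  calc ∑ k, (A k).card * (C k).card = (univ.sigma fun k => A k ×ˢ C k).card := by
        rw [card_sigma]; simp only [card_product]
    _ = ((univ.sigma fun k => A k ×ˢ C k).image
          fun x : (Σ _ : Fin L, H × H) => x.2.1 - x.2.2).card :=
        (card_image_of_injOn (injOn_sub_AC hS hB)).symm
    _ ≤ Fintype.card H := card_le_univ _

/-- **Two legs plus a short leg.**  For an STPP family with all `Aᵢ`, `Bᵢ` nonempty and any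
index `i₀`: `Σₖ |Aₖ||Cₖ| + (Σⱼ |Bⱼ||Cⱼ| − |C_{i₀}|) ≤ |H|`.
Proof: fix `a ∈ A_{i₀}`, `b ∈ B_{i₀}`; the elements `a − b + t' − u` (`t' ∈ Bⱼ`, `u ∈ Cⱼ`,
`(j, t') ≠ (i₀, b)`) are pairwise distinct and none of them is of the form `s − u'`
(`s ∈ Aₖ`, `u' ∈ Cₖ`), by the STPP instance `(i₀, j, k)`. [new, elementary] -/
theorem packing_three (hS : IsSTPP A B C) (hA : ∀ i, (A i).Nonempty) (hB : ∀ i, (B i).Nonempty)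
    (i₀ : Fin L) :
    ∑ k, (A k).card * (C k).card + (∑ j, (B j).card * (C j).card - (C i₀).card) ≤
      Fintype.card H := by
  classical
  obtain ⟨a, ha⟩ := hA i₀
  obtain ⟨b, hb⟩ := hB i₀
  set DAC : Finset (Σ _ : Fin L, H × H) := univ.sigma fun k => A k ×ˢ C k with hDAC
  set DBC : Finset (Σ _ : Fin L, H × H) := univ.sigma fun j => B j ×ˢ C j with hDBC
  set f : (Σ _ : Fin L, H × H) → H := fun x => x.2.1 - x.2.2 with hf
  set p : (Σ _ : Fin L, H × H) → Prop := fun y => y.1 = i₀ ∧ y.2.1 = b with hp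
  set D' := DBC.filter fun y => ¬ p y with hD'
  set g : (Σ _ : Fin L, H × H) → H := fun y => (a - b) + (y.2.1 - y.2.2) with hg
  set Z := DAC.image f with hZ
  set W := D'.image g with hW
  have hZcard : Z.card = ∑ k, (A k).card * (C k).card := by
    rw [hZ, card_image_of_injOn (injOn_sub_AC hS hB), card_sigma]
    simp only [card_product]
  have hWcard : W.card = D'.card := by
    rw [hW]
    refine card_image_of_injOn fun x hx y hy hxy => ?_
    have hx' : x ∈ (DBC : Set _) := by
      simp only [mem_coe] at hx ⊢; exact (mem_filter.1 hx).1
    have hy' : y ∈ (DBC : Set _) := by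
      simp only [mem_coe] at hy ⊢; exact (mem_filter.1 hy).1
    exact injOn_sub_BC hS hA hx' hy' (add_left_cancel hxy)
  have hDBCcard : DBC.card = ∑ j, (B j).card * (C j).card := by
    rw [hDBC, card_sigma]; simp only [card_product]
  -- the removed fibre `{(i₀, b)} × C i₀` has at most |C i₀| elements
  have hfib : (DBC.filter p).card ≤ (C i₀).card := by
    calc (DBC.filter p).card
        ≤ ((C i₀).image fun u => (⟨i₀, (b, u)⟩ : Σ _ : Fin L, H × H)).card := by
          refine card_le_card fun y hy => ?_
          obtain ⟨j, t', u⟩ := y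
          simp only [hDBC, hp, mem_filter, mem_sigma, mem_univ, true_and, mem_product] at hy
          obtain ⟨⟨-, hc⟩, rfl, rfl⟩ := hy
          exact mem_image.2 ⟨u, hc, rfl⟩
      _ ≤ (C i₀).card := card_image_le
  have hD'card : ∑ j, (B j).card * (C j).card - (C i₀).card ≤ D'.card := by
    have hsplit := Finset.card_filter_add_card_filter_not (s := DBC) p
    rw [hD']
    omega
  -- Z and W are disjoint: an equality `s − u' = (a − b) + (t' − u)` is an STPP instance (i₀, j, k)
  have hdisj : Disjoint Z W := by
    rw [disjoint_left]
    intro h hZ' hW'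
    rw [hZ, mem_image] at hZ'
    rw [hW, mem_image] at hW'
    obtain ⟨⟨k, s, u'⟩, hx, hxe⟩ := hZ'
    obtain ⟨⟨j, t', u⟩, hy, hye⟩ := hW'
    simp only [hDAC, mem_sigma, mem_univ, true_and, mem_product] at hx
    simp only [hD', hDBC, hp, mem_filter, mem_sigma, mem_univ, true_and, mem_product] at hy
    obtain ⟨⟨ht', hu⟩, hne⟩ := hy
    change s - u' = h at hxe
    change (a - b) + (t' - u) = h at hye
    have h0 : (a - s) + (t' - b) + (u' - u) = 0 := by
      have : (a - s) + (t' - b) + (u' - u) = ((a - b) + (t' - u)) - (s - u') := by abel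
      rw [this, hye, hxe, sub_self]
    obtain ⟨h1, -, -, h4, -⟩ := hS i₀ j k s hx.1 a ha b hb t' ht' u hu u' hx.2 h0
    exact hne ⟨h1.symm, h4.symm⟩
  calc ∑ k, (A k).card * (C k).card + (∑ j, (B j).card * (C j).card - (C i₀).card)
      ≤ Z.card + W.card := by rw [hZcard, hWcard]; exact Nat.add_le_add_left hD'card _
    _ = (Z ∪ W).card := (card_union_of_disjoint hdisj).symm
    _ ≤ Fintype.card H := card_le_univ _

/-- Thin profile `⟨N, M, N⟩`, `L ≥ 1`, `M ≥ 1`: `L·N² + (L·M·N − N) ≤ |H|`. [new, elementary] -/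
theorem thin_packing_bound (hS : IsSTPP A B C) {N M : ℕ}
    (hc : ∀ i, (A i).card = N ∧ (B i).card = M ∧ (C i).card = N) (hN : 1 ≤ N) (hM : 1 ≤ M)
    (hL : 1 ≤ L) : L * (N * N) + (L * (M * N) - N) ≤ Fintype.card H := by
  have hA : ∀ i, (A i).Nonempty := fun i => card_pos.1 (by rw [(hc i).1]; exact hN)
  have hB : ∀ i, (B i).Nonempty := fun i => card_pos.1 (by rw [(hc i).2.1]; exact hM)
  have h := packing_three hS hA hB ⟨0, hL⟩
  have h1 : ∑ k, (A k).card * (C k).card = L * (N * N) := by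
    rw [Finset.sum_congr rfl fun k _ => by rw [(hc k).1, (hc k).2.2], sum_const, card_univ,
      Fintype.card_fin, smul_eq_mul]
  have h2 : ∑ j, (B j).card * (C j).card = L * (M * N) := by
    rw [Finset.sum_congr rfl fun j _ => by rw [(hc j).2.1, (hc j).2.2], sum_const, card_univ,
      Fintype.card_fin, smul_eq_mul]
  rw [h1, h2, (hc _).2.2] at h
  exact h

/-- In particular the two-leg packing is never exact once `M ≥ 2`: `L·N² < |H|`. [new] -/
theorem thin_packing_strict (hS : IsSTPP A B C) {N M : ℕ}
    (hc : ∀ i, (A i).card = N ∧ (B i).card = M ∧ (C i).card = N) (hN : 1 ≤ N) (hM : 2 ≤ M)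
    (hL : 1 ≤ L) : L * (N * N) < Fintype.card H := by
  have h := thin_packing_bound hS hc hN (by omega) hL
  have h2 : 1 * (2 * N) ≤ L * (M * N) := Nat.mul_le_mul hL (Nat.mul_le_mul_right N hM)
  omega

/-- Single-block volume bound (Cohn–Umans 2003 Lemma 3.1, via the tree): `N·M·N ≤ |H|`.
[cite: CohnUmans2003, Lemma 3.1] -/
theorem thin_volume_bound (hS : IsSTPP A B C) {N M : ℕ}
    (hc : ∀ i, (A i).card = N ∧ (B i).card = M ∧ (C i).card = N) (i : Fin L) :
    N * M * N ≤ Fintype.card H := by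
  have h := ((isSTPP_iff_addSimultaneousTPP A B C).1 hS).card_mul_card_mul_card_le i
  rw [(hc i).1, (hc i).2.1, (hc i).2.2] at h
  exact h

end Packing


/-! ## §2 Load-bearing analysis: weakenings that become (trivially) TRUE

For an existential crux the analogue of "any proof must use hypothesis H" is "dropping conjunct
K makes the statement trivial".  Three one-line models locate the content of `ThinPackings`:
it sits entirely in `2 ≤ N` + `N^a ≤ M` with `a > 0` (+ `η` small), cf. §3. -/

section Weakenings

/-- W1 — the crux WITHOUT `2 ≤ N`. -/
def ThinPackingsWithoutNge2 : Prop :=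
  ∀ a : ℝ, 0 ≤ a → a < 1 → ∀ η : ℝ, 0 < η → ∃ (H : Type) (_ : AddCommGroup H) (_ : Fintype H)
    (L N M : ℕ) (A B C : Fin L → Finset H), IsSTPP A B C ∧
    (∀ i, (A i).card = N ∧ (B i).card = M ∧ (C i).card = N) ∧ (N : ℝ) ^ a ≤ M ∧
    (Fintype.card H : ℝ) ≤ L * (N : ℝ) ^ (2 + η)

/-- W1 holds trivially: the one-point group with `L = N = M = 1`.  So `2 ≤ N` is load-bearing
(it is what excludes the trivial group / the `1 × 1` blocks). [small model] -/
theorem thinPackingsWithoutNge2_trivial : ThinPackingsWithoutNge2 := by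
  intro a _ _ η _
  refine ⟨Unit, inferInstance, inferInstance, 1, 1, 1, fun _ => {()}, fun _ => {()}, fun _ => {()},
    ?_, fun i => ?_, ?_, ?_⟩
  · intro i j k s _ s' _ t _ t' _ u _ u' _ _
    exact ⟨Subsingleton.elim _ _, Subsingleton.elim _ _, rfl, rfl, rfl⟩
  · simp
  · simp
  · simp

/-- W2 — the crux WITHOUT the short-leg bound `N^a ≤ M`. -/
def ThinPackingsWithoutMBound : Prop :=
  ∀ a : ℝ, 0 ≤ a → a < 1 → ∀ η : ℝ, 0 < η → ∃ (H : Type) (_ : AddCommGroup H) (_ : Fintype H)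
    (L N M : ℕ) (A B C : Fin L → Finset H), IsSTPP A B C ∧
    (∀ i, (A i).card = N ∧ (B i).card = M ∧ (C i).card = N) ∧ 2 ≤ N ∧
    (Fintype.card H : ℝ) ≤ L * (N : ℝ) ^ (2 + η)

/-- W2 holds trivially with EMPTY middle sets (`M = 0` makes `IsSTPP` vacuous): `H = ℤ/2`,
`A = C = H`, `B = ∅`, `|H| = 2 ≤ 2^{2+η}`.  So `N^a ≤ M` is load-bearing twice over: it forces
`M ≥ 1` (non-vacuity of the STPP, `one_le_M`) and, for `a > 0`, `M ≥ 2` (`two_le_M`), which is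
where every refutation of §3 starts. [small model] -/
theorem thinPackingsWithoutMBound_trivial : ThinPackingsWithoutMBound := by
  intro a _ _ η hη
  refine ⟨ZMod 2, inferInstance, inferInstance, 1, 2, 0, fun _ => Finset.univ, fun _ => ∅,
    fun _ => Finset.univ, ?_, fun i => ?_, le_rfl, ?_⟩
  · intro i j k s _ s' _ t ht
    simp at ht
  · simp
  · have h : (2 : ℝ) ^ (1 : ℝ) ≤ (2 : ℝ) ^ (2 + η) :=
      Real.rpow_le_rpow_of_exponent_le (by norm_num) (by linarith)
    simpa using h

/-- W3 — the `a = 0` slice holds, even with EXACT packing (`η = 0`): one block `⟨2, 1, 2⟩` in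
`(ℤ/2)²`, `A = ℤ/2 × 0`, `B = {0}`, `C = 0 × ℤ/2`, `|H| = 4 = 1·2²` (a coset tiling; the planner's
"KSS-tight coset designs", which certify only the trivial `ω(1,a,1) ≤ 2 + a`).  Together with
`no_exact_thin_packing` (§3): exact two-leg packing happens iff `a = 0`. [small model] -/
theorem thinPackingsAtZero_exact :
    ∃ (H : Type) (_ : AddCommGroup H) (_ : Fintype H) (L N M : ℕ) (A B C : Fin L → Finset H),
      IsSTPP A B C ∧ (∀ i, (A i).card = N ∧ (B i).card = M ∧ (C i).card = N) ∧ 2 ≤ N ∧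
      (N : ℝ) ^ (0 : ℝ) ≤ M ∧ (Fintype.card H : ℝ) ≤ L * (N : ℝ) ^ 2 := by
  refine ⟨ZMod 2 × ZMod 2, inferInstance, inferInstance, 1, 2, 1, fun _ => {(0, 0), (1, 0)},
    fun _ => {(0, 0)}, fun _ => {(0, 0), (0, 1)}, ?_, fun i => ?_, le_rfl, ?_, ?_⟩
  · unfold IsSTPP
    set_option synthInstance.maxSize 1024 in
    set_option synthInstance.maxHeartbeats 200000 in
    decide
  · dsimp only
    decide
  · simp
  · norm_num [Fintype.card_prod, ZMod.card]

/-- The `a = 0` slice of the crux itself (all `η > 0`). [small model] -/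
theorem thinPackings_at_zero (η : ℝ) (hη : 0 < η) :
    ∃ (H : Type) (_ : AddCommGroup H) (_ : Fintype H) (L N M : ℕ) (A B C : Fin L → Finset H),
      IsSTPP A B C ∧ (∀ i, (A i).card = N ∧ (B i).card = M ∧ (C i).card = N) ∧ 2 ≤ N ∧
      (N : ℝ) ^ (0 : ℝ) ≤ M ∧ (Fintype.card H : ℝ) ≤ L * (N : ℝ) ^ (2 + η) := by
  obtain ⟨H, i1, i2, L, N, M, A, B, C, hS, hc, hN, hM, hH⟩ := thinPackingsAtZero_exact
  refine ⟨H, i1, i2, L, N, M, A, B, C, hS, hc, hN, hM, hH.trans ?_⟩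
  have hN1 : (1 : ℝ) ≤ N := by exact_mod_cast (by omega : 1 ≤ N)
  have h2 : (N : ℝ) ^ 2 ≤ (N : ℝ) ^ (2 + η) := by
    rw [← Real.rpow_two]
    exact Real.rpow_le_rpow_of_exponent_le hN1 (by linarith)
  exact mul_le_mul_of_nonneg_left h2 (Nat.cast_nonneg L)

end Weakenings

/-! ## §3a Quantitative necessary conditions on any witness of the crux matrix

Hypotheses below are exactly the conjuncts of `ThinPackings` after the existential is opened:
`IsSTPP A B C`, the card profile `⟨N, M, N⟩`, `2 ≤ N`, `N^a ≤ M`, `|H| ≤ L·N^{2+η}`. -/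

section Quantitative

variable {H : Type} [AddCommGroup H] [Fintype H] {L N M : ℕ} {A B C : Fin L → Finset H}
  {a η : ℝ}

/-- `N^a ≤ M` with `N ≥ 2`, `a ≥ 0` forces `M ≥ 1` (so the STPP predicate is not vacuous). -/
theorem one_le_M (hN : 2 ≤ N) (ha : 0 ≤ a) (hM : (N : ℝ) ^ a ≤ M) : 1 ≤ M := by
  have h1 : (1 : ℝ) ≤ (N : ℝ) ^ a := Real.one_le_rpow (by exact_mod_cast (by omega : 1 ≤ N)) ha
  exact_mod_cast h1.trans hM

/-- `N^a ≤ M` with `N ≥ 2`, `a > 0` forces `M ≥ 2`. -/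
theorem two_le_M (hN : 2 ≤ N) (ha : 0 < a) (hM : (N : ℝ) ^ a ≤ M) : 2 ≤ M := by
  have h1 : (1 : ℝ) < (N : ℝ) ^ a := Real.one_lt_rpow (by exact_mod_cast (by omega : 1 < N)) ha
  have h2 : (1 : ℝ) < M := h1.trans_le hM
  have h3 : 1 < M := by exact_mod_cast h2
  omega

/-- The size bound forces `L ≥ 1` (`|H| ≥ 1`). -/
theorem one_le_L (hH : (Fintype.card H : ℝ) ≤ L * (N : ℝ) ^ (2 + η)) : 1 ≤ L := by
  by_contra h0
  have hL : L = 0 := by omega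
  rw [hL, Nat.cast_zero, zero_mul] at hH
  have : (0 : ℝ) < Fintype.card H := by exact_mod_cast Fintype.card_pos
  linarith

/-- **Many blocks are needed**: `N^{a-η} ≤ L` (single-block volume `N²M ≤ |H|`).  In particular a
single TPP triple (`L = 1`) can only serve `a ≤ η`. [new, elementary] -/
theorem rpow_sub_le_L (hS : IsSTPP A B C)
    (hc : ∀ i, (A i).card = N ∧ (B i).card = M ∧ (C i).card = N) (hN : 2 ≤ N)
    (hM : (N : ℝ) ^ a ≤ M) (hH : (Fintype.card H : ℝ) ≤ L * (N : ℝ) ^ (2 + η)) :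
    (N : ℝ) ^ (a - η) ≤ L := by
  have hL := one_le_L hH
  have hvol := thin_volume_bound hS hc ⟨0, hL⟩
  have hNpos : (0 : ℝ) < N := by exact_mod_cast (by omega : 0 < N)
  have hvol' : ((N * M * N : ℕ) : ℝ) ≤ Fintype.card H := by exact_mod_cast hvol
  have h1 : (N : ℝ) ^ (2 : ℝ) * (N : ℝ) ^ a ≤ (N : ℝ) ^ (2 : ℝ) * (L * (N : ℝ) ^ η) := by
    calc (N : ℝ) ^ (2 : ℝ) * (N : ℝ) ^ a = (N : ℝ) * N * (N : ℝ) ^ a := by rw [Real.rpow_two]; ring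
      _ ≤ (N : ℝ) * N * M := by gcongr
      _ = ((N * M * N : ℕ) : ℝ) := by push_cast; ring
      _ ≤ Fintype.card H := hvol'
      _ ≤ L * (N : ℝ) ^ (2 + η) := hH
      _ = (N : ℝ) ^ (2 : ℝ) * (L * (N : ℝ) ^ η) := by rw [Real.rpow_add hNpos]; ring
  have h2 : (N : ℝ) ^ a ≤ L * (N : ℝ) ^ η := le_of_mul_le_mul_left h1 (by positivity)
  calc (N : ℝ) ^ (a - η) = (N : ℝ) ^ a / (N : ℝ) ^ η := Real.rpow_sub hNpos a η
    _ ≤ L := by rw [div_le_iff₀ (by positivity)]; exact h2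

/-- **The short leg is squeezed**: `M ≤ N·(N^η − 1) + 1` (from `L·N² + L·M·N − N ≤ |H|`).
So as `η → 0` with `N` bounded nothing survives, and in general `N^η ≥ 1 + (M-1)/N`.
[new, elementary] -/
theorem M_le (hS : IsSTPP A B C)
    (hc : ∀ i, (A i).card = N ∧ (B i).card = M ∧ (C i).card = N) (hN : 2 ≤ N) (ha : 0 ≤ a)
    (hM : (N : ℝ) ^ a ≤ M) (hH : (Fintype.card H : ℝ) ≤ L * (N : ℝ) ^ (2 + η)) :
    (M : ℝ) ≤ N * ((N : ℝ) ^ η - 1) + 1 := by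
  have hL := one_le_L hH
  have hM1 := one_le_M hN ha hM
  have hpk := thin_packing_bound hS hc (by omega) hM1 hL
  have hsub : N ≤ L * (M * N) := by
    calc N = 1 * (1 * N) := by ring
      _ ≤ L * (M * N) := Nat.mul_le_mul hL (Nat.mul_le_mul_right N hM1)
  have hpk' : L * (N * N) + L * (M * N) ≤ Fintype.card H + N := by omega
  have hR : (L : ℝ) * (N * N) + L * (M * N) ≤ Fintype.card H + N := by exact_mod_cast hpk'
  have hLpos : (0 : ℝ) < L := by exact_mod_cast (by omega : 0 < L)
  have hL1 : (1 : ℝ) ≤ L := by exact_mod_cast hL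
  have hNpos : (0 : ℝ) < N := by exact_mod_cast (by omega : 0 < N)
  have key : (L : ℝ) * N * (N + M) ≤ L * N * (N * (N : ℝ) ^ η + 1) := by
    calc (L : ℝ) * N * (N + M) = L * (N * N) + L * (M * N) := by ring
      _ ≤ Fintype.card H + N := hR
      _ ≤ L * (N : ℝ) ^ (2 + η) + N := by linarith
      _ = L * N * (N * (N : ℝ) ^ η) + N := by rw [Real.rpow_add hNpos, Real.rpow_two]; ring
      _ ≤ L * N * (N * (N : ℝ) ^ η) + L * N := by
          have : (N : ℝ) ≤ L * N := le_mul_of_one_le_left hNpos.le hL1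
          linarith
      _ = L * N * (N * (N : ℝ) ^ η + 1) := by ring
  have h3 : (N : ℝ) + M ≤ N * (N : ℝ) ^ η + 1 := le_of_mul_le_mul_left key (mul_pos hLpos hNpos)
  linarith

/-- TIGHTNESS of the single-block volume bound `N·M·N ≤ |H|` (`thin_volume_bound`), hence of
`rpow_sub_le_L` at `L = 1` and of the threshold `η < a` in `no_single_thin_block`: for all
`N, M ≥ 1` the block `A = ℤ/N × 0 × 0`, `B = 0 × 0 × ℤ/M`, `C = 0 × ℤ/N × 0` is an STPP (= TPP)
triple `⟨N, M, N⟩` in `H = (ℤ/N)² × ℤ/M` with `|H| = N²M` exactly; with `M = N^a` this is a crux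
witness at slack `η = a` (and only there, by `no_single_thin_block`).  [small model, tightness] -/
theorem single_block_volume_tight (N M : ℕ) [NeZero N] [NeZero M] :
    ∃ (A B C : Fin 1 → Finset (ZMod N × ZMod N × ZMod M)), IsSTPP A B C ∧
      (∀ i, (A i).card = N ∧ (B i).card = M ∧ (C i).card = N) ∧
      Fintype.card (ZMod N × ZMod N × ZMod M) = N * M * N := by
  refine ⟨fun _ => univ.image fun x : ZMod N => ((x, 0, 0) : ZMod N × ZMod N × ZMod M),
    fun _ => univ.image fun z : ZMod M => ((0, 0, z) : ZMod N × ZMod N × ZMod M),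
    fun _ => univ.image fun y : ZMod N => ((0, y, 0) : ZMod N × ZMod N × ZMod M), ?_,
    fun i => ?_, ?_⟩
  · intro i j k s hs s' hs' t ht t' ht' u hu u' hu' h0
    simp only [mem_image, mem_univ, true_and] at hs hs' ht ht' hu hu'
    obtain ⟨x, rfl⟩ := hs; obtain ⟨x', rfl⟩ := hs'
    obtain ⟨z, rfl⟩ := ht; obtain ⟨z', rfl⟩ := ht'
    obtain ⟨y, rfl⟩ := hu; obtain ⟨y', rfl⟩ := hu'
    simp only [Prod.mk_sub_mk, Prod.mk_add_mk, sub_zero, add_zero, zero_add, Prod.mk_eq_zero,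
      sub_eq_zero] at h0
    obtain ⟨h1, h2, h3⟩ := h0
    exact ⟨Subsingleton.elim _ _, Subsingleton.elim _ _, by rw [h1], by rw [h3], by rw [h2]⟩
  · refine ⟨?_, ?_, ?_⟩ <;>
      rw [card_image_of_injective _ (by intro a b h; simpa using h), card_univ, ZMod.card]
  · simp only [Fintype.card_prod, ZMod.card]; ring

end Quantitative

/-! ## §3b Refuted natural strengthenings of the crux -/

section Strengthenings

/-- Strengthening S1 — EXACT two-leg packing (`η = 0`, i.e. `|H| ≤ L·N²`). -/
def ThinPackingsExact : Prop :=
  ∀ a : ℝ, 0 ≤ a → a < 1 → ∃ (H : Type) (_ : AddCommGroup H) (_ : Fintype H) (L N M : ℕ)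
    (A B C : Fin L → Finset H), IsSTPP A B C ∧
    (∀ i, (A i).card = N ∧ (B i).card = M ∧ (C i).card = N) ∧ 2 ≤ N ∧ (N : ℝ) ^ a ≤ M ∧
    (Fintype.card H : ℝ) ≤ L * (N : ℝ) ^ 2

/-- For every `a > 0` there is NO exactly packed thin family: `M ≥ 2` and then `L·N² < |H|`
(`thin_packing_strict`).  So the slack `η > 0` in the crux is load-bearing, and `η = 0` is
attained only at `a = 0` (see `thinPackingsAtZero_exact` in §2). [new, elementary] -/
theorem no_exact_thin_packing {a : ℝ} (ha : 0 < a) :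
    ¬ ∃ (H : Type) (_ : AddCommGroup H) (_ : Fintype H) (L N M : ℕ) (A B C : Fin L → Finset H),
      IsSTPP A B C ∧ (∀ i, (A i).card = N ∧ (B i).card = M ∧ (C i).card = N) ∧ 2 ≤ N ∧
      (N : ℝ) ^ a ≤ M ∧ (Fintype.card H : ℝ) ≤ L * (N : ℝ) ^ 2 := by
  rintro ⟨H, _, _, L, N, M, A, B, C, hS, hc, hN, hM, hH⟩
  have hM2 := two_le_M hN ha hM
  have hL : 1 ≤ L := by
    by_contra h0
    have hL0 : L = 0 := by omega
    rw [hL0, Nat.cast_zero, zero_mul] at hH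
    have : (0 : ℝ) < Fintype.card H := by exact_mod_cast Fintype.card_pos
    linarith
  have hlt := thin_packing_strict hS hc (by omega) hM2 hL
  have hlt' : ((L * (N * N) : ℕ) : ℝ) < Fintype.card H := by exact_mod_cast hlt
  push_cast at hlt'
  nlinarith [hH, hlt']

theorem not_thinPackingsExact : ¬ ThinPackingsExact := fun h =>
  no_exact_thin_packing one_half_pos (h (1 / 2) (by norm_num) (by norm_num))

/-- Strengthening S2 — a SINGLE thin TPP triple (`L = 1`). -/
def ThinPackingsSingleBlock : Prop :=
  ∀ a : ℝ, 0 ≤ a → a < 1 → ∀ η : ℝ, 0 < η → ∃ (H : Type) (_ : AddCommGroup H) (_ : Fintype H)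
    (N M : ℕ) (A B C : Fin 1 → Finset H), IsSTPP A B C ∧
    (∀ i, (A i).card = N ∧ (B i).card = M ∧ (C i).card = N) ∧ 2 ≤ N ∧ (N : ℝ) ^ a ≤ M ∧
    (Fintype.card H : ℝ) ≤ (N : ℝ) ^ (2 + η)

/-- A single thin triple in an abelian group needs `a ≤ η` (Cohn–Umans: `N²M ≤ |H|`), so S2 fails
at every `(a, η)` with `η < a`. [new, elementary; cf. CohnUmans2003 Lemma 3.1] -/
theorem no_single_thin_block {a η : ℝ} (hηa : η < a) :
    ¬ ∃ (H : Type) (_ : AddCommGroup H) (_ : Fintype H) (N M : ℕ) (A B C : Fin 1 → Finset H),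
      IsSTPP A B C ∧ (∀ i, (A i).card = N ∧ (B i).card = M ∧ (C i).card = N) ∧ 2 ≤ N ∧
      (N : ℝ) ^ a ≤ M ∧ (Fintype.card H : ℝ) ≤ (N : ℝ) ^ (2 + η) := by
  rintro ⟨H, _, _, N, M, A, B, C, hS, hc, hN, hM, hH⟩
  have hH' : (Fintype.card H : ℝ) ≤ ((1 : ℕ) : ℝ) * (N : ℝ) ^ (2 + η) := by simpa using hH
  have h := rpow_sub_le_L hS hc hN hM hH'
  have h1 : (1 : ℝ) < (N : ℝ) ^ (a - η) :=
    Real.one_lt_rpow (by exact_mod_cast (by omega : 1 < N)) (by linarith)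
  simp at h
  linarith

theorem not_thinPackingsSingleBlock : ¬ ThinPackingsSingleBlock := fun h =>
  no_single_thin_block (by norm_num : (1 / 4 : ℝ) < 1 / 2)
    (h (1 / 2) (by norm_num) (by norm_num) (1 / 4) (by norm_num))

/-- Strengthening S3 — witnesses with BOUNDED long legs `N ≤ N₀` (only `L`, `H` grow). -/
def ThinPackingsBoundedN : Prop :=
  ∃ N₀ : ℕ, ∀ a : ℝ, 0 ≤ a → a < 1 → ∀ η : ℝ, 0 < η → ∃ (H : Type) (_ : AddCommGroup H)
    (_ : Fintype H) (L N M : ℕ) (A B C : Fin L → Finset H), IsSTPP A B C ∧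
    (∀ i, (A i).card = N ∧ (B i).card = M ∧ (C i).card = N) ∧ 2 ≤ N ∧ N ≤ N₀ ∧
    (N : ℝ) ^ a ≤ M ∧ (Fintype.card H : ℝ) ≤ L * (N : ℝ) ^ (2 + η)

/-- S3 is false: by `M_le` and Bernoulli, `M ≤ η·N·(N−1) + 1 < 2` once `η < 1/N₀²`, whereas
`a > 0` forces `M ≥ 2`.  Hence in any witness sequence for the crux `N → ∞` as `η → 0`
(quantitatively `N^η ≥ 1 + (M−1)/N`). [new, elementary] -/
theorem not_thinPackingsBoundedN : ¬ ThinPackingsBoundedN := by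
  rintro ⟨N₀, h⟩
  set η : ℝ := 1 / (2 * (N₀ : ℝ) ^ 2 + 2) with hη
  have hden : (0 : ℝ) < 2 * (N₀ : ℝ) ^ 2 + 2 := by positivity
  have hη0 : 0 < η := by rw [hη]; positivity
  have hη1 : η ≤ 1 := by
    rw [hη, div_le_one hden]; nlinarith [sq_nonneg (N₀ : ℝ)]
  obtain ⟨H, _, _, L, N, M, A, B, C, hS, hc, hN, hNN₀, hM, hH⟩ :=
    h (1 / 2) (by norm_num) (by norm_num) η hη0
  have hM2 := two_le_M hN one_half_pos hM
  have hMle := M_le hS hc hN (by norm_num) hM hH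
  have hN1 : (1 : ℝ) ≤ N := by exact_mod_cast (by omega : 1 ≤ N)
  have hNN₀' : (N : ℝ) ≤ N₀ := by exact_mod_cast hNN₀
  -- Bernoulli: N^η = (1 + (N-1))^η ≤ 1 + η (N - 1)
  have hB : (N : ℝ) ^ η ≤ 1 + η * (N - 1) := by
    have := rpow_one_add_le_one_add_mul_self (s := (N : ℝ) - 1) (by linarith) hη0.le hη1
    simpa using this
  have h1 : (M : ℝ) ≤ η * (N₀ : ℝ) ^ 2 + 1 := by
    calc (M : ℝ) ≤ N * ((N : ℝ) ^ η - 1) + 1 := hMle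
      _ ≤ N * (η * (N - 1)) + 1 := by gcongr; linarith
      _ = η * (N * (N - 1)) + 1 := by ring
      _ ≤ η * (N₀ : ℝ) ^ 2 + 1 := by
          have hNN : (N : ℝ) * (N - 1) ≤ (N₀ : ℝ) ^ 2 := by
            rw [sq]; exact mul_le_mul hNN₀' (by linarith) (by linarith) (by positivity)
          linarith [mul_le_mul_of_nonneg_left hNN hη0.le]
  have h2 : η * (N₀ : ℝ) ^ 2 < 1 := by
    rw [hη, div_mul_eq_mul_div, one_mul, div_lt_one hden]; nlinarith [sq_nonneg (N₀ : ℝ)]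
  have hM2' : (2 : ℝ) ≤ M := by exact_mod_cast hM2
  linarith

/-- Strengthening S4 — witnesses in abelian groups of BOUNDED EXPONENT (the route's own rungs 3–5
produce only such witnesses, for each fixed `a`). -/
def ThinPackingsBoundedExponent : Prop :=
  ∃ ℓ : ℕ, ∀ a : ℝ, 0 ≤ a → a < 1 → ∀ η : ℝ, 0 < η → ∃ (H : Type) (_ : AddCommGroup H)
    (_ : Fintype H) (L N M : ℕ) (A B C : Fin L → Finset H), AddMonoid.exponent H ≤ ℓ ∧
    IsSTPP A B C ∧ (∀ i, (A i).card = N ∧ (B i).card = M ∧ (C i).card = N) ∧ 2 ≤ N ∧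
    (N : ℝ) ^ a ≤ M ∧ (Fintype.card H : ℝ) ≤ L * (N : ℝ) ^ (2 + η)

/-- S4 is false: BCCGNSU Thm B (tree theorem `…2017_B_holds`, some `ε_ℓ > 0`) gives
`L·(N²M)^{(2+ε)/3} ≤ |H| ≤ L·N^{2+η}`, impossible at `a = 1 − ε'/4`, `η = ε'/8`
(`ε' = min ε 1`).  So for `a` close to `1` the crux needs exponent `→ ∞` — the regime with no
catalogued barrier and no known tight design.
[cite: BlasiakChurchCohnGrochowNaslundSawinUmans2017, Thm. B] -/
theorem not_thinPackingsBoundedExponent : ¬ ThinPackingsBoundedExponent := by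
  rintro ⟨ℓ, h⟩
  obtain ⟨ε, hε, hB⟩ := BlasiakChurchCohnGrochowNaslundSawinUmans2017_B_holds ℓ
  set ε' : ℝ := min ε 1 with hε'
  have hε'0 : 0 < ε' := lt_min hε one_pos
  have hε'1 : ε' ≤ 1 := min_le_right _ _
  have hε'ε : ε' ≤ ε := min_le_left _ _
  obtain ⟨H, _, _, L, N, M, A, B, C, hexp, hS, hc, hN, hM, hH⟩ :=
    h (1 - ε' / 4) (by linarith) (by linarith) (ε' / 8) (by positivity)
  have hL := one_le_L hH
  have hLpos : (0 : ℝ) < L := by exact_mod_cast (by omega : 0 < L)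
  have hN1 : (1 : ℝ) < N := by exact_mod_cast (by omega : 1 < N)
  have hNpos : (0 : ℝ) < N := by linarith
  -- Thm B on the witness
  have hTB := hB H hexp L A B C hS
  have hsum : ∑ i : Fin L, (((A i).card * (B i).card * (C i).card : ℕ) : ℝ) ^ ((2 + ε) / 3) =
      L * (((N * M * N : ℕ) : ℝ) ^ ((2 + ε) / 3)) := by
    rw [Finset.sum_congr rfl fun i _ => by rw [(hc i).1, (hc i).2.1, (hc i).2.2], sum_const,
      card_univ, Fintype.card_fin, nsmul_eq_mul]
  rw [hsum] at hTB
  -- volume ≥ N^{2+a}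
  have hvol : (N : ℝ) ^ (2 + (1 - ε' / 4)) ≤ ((N * M * N : ℕ) : ℝ) := by
    rw [Real.rpow_add hNpos, Real.rpow_two]
    push_cast
    calc (N : ℝ) ^ 2 * (N : ℝ) ^ (1 - ε' / 4) ≤ (N : ℝ) ^ 2 * (M : ℝ) := by gcongr
      _ = (N : ℝ) * M * N := by ring
  have hexp_pos : (0 : ℝ) < (2 + ε) / 3 := by positivity
  have h1 : (N : ℝ) ^ ((2 + (1 - ε' / 4)) * ((2 + ε) / 3)) ≤ (N : ℝ) ^ (2 + ε' / 8) := by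
    calc (N : ℝ) ^ ((2 + (1 - ε' / 4)) * ((2 + ε) / 3))
        = ((N : ℝ) ^ (2 + (1 - ε' / 4))) ^ ((2 + ε) / 3) := Real.rpow_mul hNpos.le _ _
      _ ≤ (((N * M * N : ℕ) : ℝ)) ^ ((2 + ε) / 3) :=
          Real.rpow_le_rpow (by positivity) hvol hexp_pos.le
      _ ≤ (N : ℝ) ^ (2 + ε' / 8) := by
          have h2 : (L : ℝ) * ((N * M * N : ℕ) : ℝ) ^ ((2 + ε) / 3) ≤ L * (N : ℝ) ^ (2 + ε' / 8) :=
            hTB.trans hH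
          exact le_of_mul_le_mul_left h2 hLpos
  have h3 : (2 + (1 - ε' / 4)) * ((2 + ε) / 3) ≤ 2 + ε' / 8 := (Real.rpow_le_rpow_left_iff hN1).1 h1
  nlinarith [mul_nonneg hε'0.le hε'0.le, hε'ε, hε'1]

end Strengthenings


/-! ## §6 Difference cores: no leg of a witness family is a family of translates (cycle 2)

For a set `P` with `P − P ⊆ Aᵢ − Aᵢ` for every `i` ("A-difference core") the map
`(i, t, u, p) ↦ t − u + p` is injective on `⨆ᵢ Bᵢ × Cᵢ × P` (STPP clause `k = i ≠ j`), so
`(Σᵢ |Bᵢ||Cᵢ|)·|P| ≤ |H|`; likewise for C-cores (clause `j = k ≠ i`) and B-cores (clause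
`i = j ≠ k`, `R = {pt}` being the two-leg packing).  Consequences for the crux matrix:
`M·|P| ≤ N^{1+η}` (A- and C-cores), `|R| ≤ N^η` (B-cores); if ONE leg has nested difference
sets (translates `xᵢ + P` of one set, a common middle set, …) then `a ≤ η`; and each leg meets
at least `M·N^{−η} ≥ N^{a−η}` translation classes.  This is the theorem form of the ideators'
"translate menus / common-B / coset templates give slack ≥ M" (Ideator3NegativeNotes B2–B3,
ideator-2 barrier notes).  LANDING: Negative/ThinPackingsDifferenceCores.lean (p76083). -/

section DifferenceCores

section Cores

variable {H : Type*} [AddCommGroup H] {L : ℕ} {A B C : Fin L → Finset H}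

/-- A-difference core: `(i, t, u, p) ↦ t − u + p` is injective on `⨆_{i ∈ S} (Bᵢ × Cᵢ) × P`
whenever `P − P ⊆ Aᵢ − Aᵢ` for all `i ∈ S` (STPP clause `k = i ≠ j`). [new, elementary] -/
theorem injOn_BC_core (hS : IsSTPP A B C) (S : Finset (Fin L)) (P : Finset H)
    (hP : ∀ i ∈ S, ∀ p ∈ P, ∀ p' ∈ P, ∃ s ∈ A i, ∃ s' ∈ A i, p - p' = s' - s) :
    Set.InjOn (fun x : (Σ _ : Fin L, (H × H) × H) => x.2.1.1 - x.2.1.2 + x.2.2)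
      ↑(S.sigma fun i => (B i ×ˢ C i) ×ˢ P) := by
  rintro ⟨i, ⟨t, u⟩, p⟩ hx ⟨j, ⟨t', u'⟩, p'⟩ hy he
  rw [mem_coe, mem_sigma, mem_product, mem_product] at hx hy
  change t - u + p = t' - u' + p' at he
  obtain ⟨s, hs, s', hs', hpp⟩ := hP i hx.1 p' hy.2.2 p hx.2.2
  have h0 : (s' - s) + (t' - t) + (u - u') = 0 := by
    have : (s' - s) + (t' - t) + (u - u') = (t' - u' + p') - (t - u + p) := by rw [← hpp]; abel
    rw [this, he, sub_self]
  obtain ⟨hij, -, -, htt, huu⟩ :=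
    hS i j i s hs s' hs' t hx.2.1.1 t' hy.2.1.1 u' hy.2.1.2 u hx.2.1.2 h0
  subst hij htt huu
  have hp : p = p' := add_left_cancel he
  subst hp
  rfl

/-- C-difference core: `(i, s', t, q) ↦ s' − t + q` is injective on `⨆_{i ∈ S} (Aᵢ × Bᵢ) × Q`
whenever `Q − Q ⊆ Cᵢ − Cᵢ` for all `i ∈ S` (STPP clause `j = k ≠ i`). [new, elementary] -/
theorem injOn_AB_core (hS : IsSTPP A B C) (S : Finset (Fin L)) (Q : Finset H)
    (hQ : ∀ i ∈ S, ∀ q ∈ Q, ∀ q' ∈ Q, ∃ u ∈ C i, ∃ u' ∈ C i, q - q' = u' - u) :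
    Set.InjOn (fun x : (Σ _ : Fin L, (H × H) × H) => x.2.1.1 - x.2.1.2 + x.2.2)
      ↑(S.sigma fun i => (A i ×ˢ B i) ×ˢ Q) := by
  rintro ⟨i, ⟨s', t⟩, q⟩ hx ⟨k, ⟨s, t'⟩, q'⟩ hy he
  rw [mem_coe, mem_sigma, mem_product, mem_product] at hx hy
  change s' - t + q = s - t' + q' at he
  obtain ⟨u, hu, u', hu', hqq⟩ := hQ k hy.1 q hx.2.2 q' hy.2.2
  have h0 : (s' - s) + (t' - t) + (u' - u) = 0 := by
    have : (s' - s) + (t' - t) + (u' - u) = (s' - t + q) - (s - t' + q') := by rw [← hqq]; abel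
    rw [this, he, sub_self]
  obtain ⟨hik, -, hss, htt, huu⟩ :=
    hS i k k s hy.2.1.1 s' hx.2.1.1 t hx.2.1.2 t' hy.2.1.2 u hu u' hu' h0
  subst hik hss htt
  have hq : q = q' := by
    have h1 : u' - u = 0 := by rw [huu, sub_self]
    have h2 : q - q' = 0 := hqq.trans h1
    exact sub_eq_zero.1 h2
  subst hq
  rfl

/-- B-difference core: `(i, s', u, r) ↦ s' − u + r` is injective on `⨆_{i ∈ S} (Aᵢ × Cᵢ) × R`
whenever `R − R ⊆ Bᵢ − Bᵢ` for all `i ∈ S` (STPP clause `i = j ≠ k`); `R = {r}` is the two-leg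
packing bound `injOn_sub_AC`. [new, elementary] -/
theorem injOn_AC_core (hS : IsSTPP A B C) (S : Finset (Fin L)) (R : Finset H)
    (hR : ∀ i ∈ S, ∀ r ∈ R, ∀ r' ∈ R, ∃ t ∈ B i, ∃ t' ∈ B i, r - r' = t' - t) :
    Set.InjOn (fun x : (Σ _ : Fin L, (H × H) × H) => x.2.1.1 - x.2.1.2 + x.2.2)
      ↑(S.sigma fun i => (A i ×ˢ C i) ×ˢ R) := by
  rintro ⟨i, ⟨s', u⟩, r⟩ hx ⟨k, ⟨s, u'⟩, r'⟩ hy he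
  rw [mem_coe, mem_sigma, mem_product, mem_product] at hx hy
  change s' - u + r = s - u' + r' at he
  obtain ⟨t, ht, t', ht', hrr⟩ := hR i hx.1 r hx.2.2 r' hy.2.2
  have h0 : (s' - s) + (t' - t) + (u' - u) = 0 := by
    have : (s' - s) + (t' - t) + (u' - u) = (s' - u + r) - (s - u' + r') := by rw [← hrr]; abel
    rw [this, he, sub_self]
  obtain ⟨-, hik, hss, htt, huu⟩ :=
    hS i i k s hy.2.1.1 s' hx.2.1.1 t ht t' ht' u hx.2.1.2 u' hy.2.1.2 h0
  subst hik hss huu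
  have hr : r = r' := by
    have h1 : t' - t = 0 := by rw [htt, sub_self]
    exact sub_eq_zero.1 (hrr.trans h1)
  subst hr
  rfl

variable [Fintype H]

/-- `(Σ_{i∈S} |Bᵢ||Cᵢ|)·|P| ≤ |H|` for an A-difference core `P` on `S`. [new, elementary] -/
theorem sum_card_BC_mul_core_le (hS : IsSTPP A B C) (S : Finset (Fin L)) (P : Finset H)
    (hP : ∀ i ∈ S, ∀ p ∈ P, ∀ p' ∈ P, ∃ s ∈ A i, ∃ s' ∈ A i, p - p' = s' - s) :
    (∑ i ∈ S, (B i).card * (C i).card) * P.card ≤ Fintype.card H := by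
  classical
  calc (∑ i ∈ S, (B i).card * (C i).card) * P.card
        = (S.sigma fun i => (B i ×ˢ C i) ×ˢ P).card := by
          rw [card_sigma, sum_mul]; simp only [card_product]
    _ = ((S.sigma fun i => (B i ×ˢ C i) ×ˢ P).image
          fun x : (Σ _ : Fin L, (H × H) × H) => x.2.1.1 - x.2.1.2 + x.2.2).card :=
          (card_image_of_injOn (injOn_BC_core hS S P hP)).symm
    _ ≤ Fintype.card H := card_le_univ _

/-- `(Σ_{i∈S} |Aᵢ||Bᵢ|)·|Q| ≤ |H|` for a C-difference core `Q` on `S`. [new, elementary] -/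
theorem sum_card_AB_mul_core_le (hS : IsSTPP A B C) (S : Finset (Fin L)) (Q : Finset H)
    (hQ : ∀ i ∈ S, ∀ q ∈ Q, ∀ q' ∈ Q, ∃ u ∈ C i, ∃ u' ∈ C i, q - q' = u' - u) :
    (∑ i ∈ S, (A i).card * (B i).card) * Q.card ≤ Fintype.card H := by
  classical
  calc (∑ i ∈ S, (A i).card * (B i).card) * Q.card
        = (S.sigma fun i => (A i ×ˢ B i) ×ˢ Q).card := by
          rw [card_sigma, sum_mul]; simp only [card_product]
    _ = ((S.sigma fun i => (A i ×ˢ B i) ×ˢ Q).image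
          fun x : (Σ _ : Fin L, (H × H) × H) => x.2.1.1 - x.2.1.2 + x.2.2).card :=
          (card_image_of_injOn (injOn_AB_core hS S Q hQ)).symm
    _ ≤ Fintype.card H := card_le_univ _

/-- `(Σ_{i∈S} |Aᵢ||Cᵢ|)·|R| ≤ |H|` for a B-difference core `R` on `S`. [new, elementary] -/
theorem sum_card_AC_mul_core_le (hS : IsSTPP A B C) (S : Finset (Fin L)) (R : Finset H)
    (hR : ∀ i ∈ S, ∀ r ∈ R, ∀ r' ∈ R, ∃ t ∈ B i, ∃ t' ∈ B i, r - r' = t' - t) :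
    (∑ i ∈ S, (A i).card * (C i).card) * R.card ≤ Fintype.card H := by
  classical
  calc (∑ i ∈ S, (A i).card * (C i).card) * R.card
        = (S.sigma fun i => (A i ×ˢ C i) ×ˢ R).card := by
          rw [card_sigma, sum_mul]; simp only [card_product]
    _ = ((S.sigma fun i => (A i ×ˢ C i) ×ˢ R).image
          fun x : (Σ _ : Fin L, (H × H) × H) => x.2.1.1 - x.2.1.2 + x.2.2).card :=
          (card_image_of_injOn (injOn_AC_core hS S R hR)).symm
    _ ≤ Fintype.card H := card_le_univ _

end Cores

/-! ## Consequences for the crux matrix `⟨N, M, N⟩`, `2 ≤ N`, `N^a ≤ M`, `|H| ≤ L·N^{2+η}` -/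

section Thin

variable {H : Type} [AddCommGroup H] [Fintype H] {L N M : ℕ} {A B C : Fin L → Finset H}
  {a η : ℝ}

omit [Fintype H] in
/-- `Σ_{i∈S} f i · g i = |S|·(x·y)` for constant profiles. [folklore] -/
theorem sum_profile (S : Finset (Fin L)) {f g : Fin L → ℕ} {x y : ℕ}
    (hf : ∀ i, f i = x) (hg : ∀ i, g i = y) : ∑ i ∈ S, f i * g i = S.card * (x * y) := by
  rw [Finset.sum_congr rfl fun i _ => by rw [hf i, hg i], sum_const, smul_eq_mul]

/-- A-cores are short: `M·|P| ≤ N^{1+η}` for every `P` with `P − P ⊆ ⋂ᵢ (Aᵢ − Aᵢ)`.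
[new, elementary] -/
theorem thin_core_A (hS : IsSTPP A B C)
    (hc : ∀ i, (A i).card = N ∧ (B i).card = M ∧ (C i).card = N) (hN : 2 ≤ N)
    (hH : (Fintype.card H : ℝ) ≤ L * (N : ℝ) ^ (2 + η)) (P : Finset H)
    (hP : ∀ i, ∀ p ∈ P, ∀ p' ∈ P, ∃ s ∈ A i, ∃ s' ∈ A i, p - p' = s' - s) :
    (M : ℝ) * P.card ≤ (N : ℝ) ^ (1 + η) := by
  have hL := one_le_L hH
  have h := sum_card_BC_mul_core_le hS univ P fun i _ => hP i
  rw [sum_profile univ (fun i => (hc i).2.1) (fun i => (hc i).2.2), card_univ, Fintype.card_fin]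
    at h
  have hR : (L : ℝ) * (M * N) * P.card ≤ L * (N : ℝ) ^ (2 + η) := by
    refine le_trans ?_ hH; exact_mod_cast h
  have hLpos : (0 : ℝ) < L := by exact_mod_cast (by omega : 0 < L)
  have hNpos : (0 : ℝ) < N := by exact_mod_cast (by omega : 0 < N)
  have h2 : (M : ℝ) * N * P.card ≤ (N : ℝ) ^ (2 + η) := by
    have := le_of_mul_le_mul_left (by linarith [hR] : (L : ℝ) * (M * N * P.card) ≤ L * N ^ (2 + η))
      hLpos
    linarith
  have h3 : (N : ℝ) ^ (2 + η) = N * (N : ℝ) ^ (1 + η) := by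
    rw [show (2 : ℝ) + η = 1 + (1 + η) by ring, Real.rpow_add hNpos, Real.rpow_one]
  rw [h3] at h2
  have h4 : (N : ℝ) * (M * P.card) ≤ N * (N : ℝ) ^ (1 + η) := by linarith
  exact le_of_mul_le_mul_left h4 hNpos

/-- C-cores are short: `M·|Q| ≤ N^{1+η}` for every `Q` with `Q − Q ⊆ ⋂ᵢ (Cᵢ − Cᵢ)`.
[new, elementary] -/
theorem thin_core_C (hS : IsSTPP A B C)
    (hc : ∀ i, (A i).card = N ∧ (B i).card = M ∧ (C i).card = N) (hN : 2 ≤ N)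
    (hH : (Fintype.card H : ℝ) ≤ L * (N : ℝ) ^ (2 + η)) (Q : Finset H)
    (hQ : ∀ i, ∀ q ∈ Q, ∀ q' ∈ Q, ∃ u ∈ C i, ∃ u' ∈ C i, q - q' = u' - u) :
    (M : ℝ) * Q.card ≤ (N : ℝ) ^ (1 + η) := by
  have hL := one_le_L hH
  have h := sum_card_AB_mul_core_le hS univ Q fun i _ => hQ i
  rw [sum_profile univ (fun i => (hc i).1) (fun i => (hc i).2.1), card_univ, Fintype.card_fin]
    at h
  have hR : (L : ℝ) * (N * M) * Q.card ≤ L * (N : ℝ) ^ (2 + η) := by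
    refine le_trans ?_ hH; exact_mod_cast h
  have hLpos : (0 : ℝ) < L := by exact_mod_cast (by omega : 0 < L)
  have hNpos : (0 : ℝ) < N := by exact_mod_cast (by omega : 0 < N)
  have h2 : (N : ℝ) * M * Q.card ≤ (N : ℝ) ^ (2 + η) := by
    have := le_of_mul_le_mul_left (by linarith [hR] : (L : ℝ) * (N * M * Q.card) ≤ L * N ^ (2 + η))
      hLpos
    linarith
  have h3 : (N : ℝ) ^ (2 + η) = N * (N : ℝ) ^ (1 + η) := by
    rw [show (2 : ℝ) + η = 1 + (1 + η) by ring, Real.rpow_add hNpos, Real.rpow_one]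
  rw [h3] at h2
  have h4 : (N : ℝ) * (M * Q.card) ≤ N * (N : ℝ) ^ (1 + η) := by linarith
  exact le_of_mul_le_mul_left h4 hNpos

/-- B-cores are tiny: `|R| ≤ N^η` for every `R` with `R − R ⊆ ⋂ᵢ (Bᵢ − Bᵢ)`; so the middle
sets of a thin near-tight family share (up to translation) almost nothing. [new, elementary] -/
theorem thin_core_B (hS : IsSTPP A B C)
    (hc : ∀ i, (A i).card = N ∧ (B i).card = M ∧ (C i).card = N) (hN : 2 ≤ N)
    (hH : (Fintype.card H : ℝ) ≤ L * (N : ℝ) ^ (2 + η)) (R : Finset H)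
    (hR : ∀ i, ∀ r ∈ R, ∀ r' ∈ R, ∃ t ∈ B i, ∃ t' ∈ B i, r - r' = t' - t) :
    (R.card : ℝ) ≤ (N : ℝ) ^ η := by
  have hL := one_le_L hH
  have h := sum_card_AC_mul_core_le hS univ R fun i _ => hR i
  rw [sum_profile univ (fun i => (hc i).1) (fun i => (hc i).2.2), card_univ, Fintype.card_fin]
    at h
  have hR' : (L : ℝ) * (N * N) * R.card ≤ L * (N : ℝ) ^ (2 + η) := by
    refine le_trans ?_ hH; exact_mod_cast h
  have hLpos : (0 : ℝ) < L := by exact_mod_cast (by omega : 0 < L)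
  have hNpos : (0 : ℝ) < N := by exact_mod_cast (by omega : 0 < N)
  have h2 : (N : ℝ) * N * R.card ≤ (N : ℝ) ^ (2 + η) := by
    have := le_of_mul_le_mul_left (by linarith [hR'] : (L : ℝ) * (N * N * R.card) ≤ L * N ^ (2 + η))
      hLpos
    linarith
  have h3 : (N : ℝ) ^ (2 + η) = N * N * (N : ℝ) ^ η := by
    rw [Real.rpow_add hNpos, Real.rpow_two]; ring
  rw [h3] at h2
  have hNN : (0 : ℝ) < N * N := mul_pos hNpos hNpos
  have h4 : (N : ℝ) * N * R.card ≤ N * N * (N : ℝ) ^ η := h2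
  exact le_of_mul_le_mul_left h4 hNN

/-- **No leg of translates, A.**  If the A-differences are nested, `A_{i₀} − A_{i₀} ⊆ Aᵢ − Aᵢ`
for all `i` (e.g. all `Aᵢ` translates of one set), a thin near-tight family needs `a ≤ η` — the
trivial exponent of the split/coset designs.  [new, elementary] -/
theorem no_thin_nested_A (hηa : η < a) :
    ¬ ∃ (H : Type) (_ : AddCommGroup H) (_ : Fintype H) (L N M : ℕ) (A B C : Fin L → Finset H)
      (i₀ : Fin L), IsSTPP A B C ∧ (∀ i, (A i).card = N ∧ (B i).card = M ∧ (C i).card = N) ∧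
      2 ≤ N ∧ (N : ℝ) ^ a ≤ M ∧ (Fintype.card H : ℝ) ≤ L * (N : ℝ) ^ (2 + η) ∧
      (∀ i, ∀ p ∈ A i₀, ∀ p' ∈ A i₀, ∃ s ∈ A i, ∃ s' ∈ A i, p - p' = s' - s) := by
  rintro ⟨H, _, _, L, N, M, A, B, C, i₀, hS, hc, hN, hM, hH, hT⟩
  have h := thin_core_A hS hc hN hH (A i₀) hT
  rw [(hc i₀).1] at h
  have hN1 : (1 : ℝ) < N := by exact_mod_cast (by omega : 1 < N)
  have hNpos : (0 : ℝ) < N := by linarith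
  have h2 : (M : ℝ) ≤ (N : ℝ) ^ η := by
    rw [Real.rpow_add hNpos, Real.rpow_one, mul_comm] at h
    exact le_of_mul_le_mul_left h hNpos
  have h3 : (N : ℝ) ^ a ≤ (N : ℝ) ^ η := hM.trans h2
  have h4 : a ≤ η := (Real.rpow_le_rpow_left_iff hN1).1 h3
  linarith

/-- **No leg of translates, C** (nested C-differences `C_{i₀} − C_{i₀} ⊆ Cᵢ − Cᵢ`).
[new, elementary] -/
theorem no_thin_nested_C (hηa : η < a) :
    ¬ ∃ (H : Type) (_ : AddCommGroup H) (_ : Fintype H) (L N M : ℕ) (A B C : Fin L → Finset H)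
      (i₀ : Fin L), IsSTPP A B C ∧ (∀ i, (A i).card = N ∧ (B i).card = M ∧ (C i).card = N) ∧
      2 ≤ N ∧ (N : ℝ) ^ a ≤ M ∧ (Fintype.card H : ℝ) ≤ L * (N : ℝ) ^ (2 + η) ∧
      (∀ i, ∀ q ∈ C i₀, ∀ q' ∈ C i₀, ∃ u ∈ C i, ∃ u' ∈ C i, q - q' = u' - u) := by
  rintro ⟨H, _, _, L, N, M, A, B, C, i₀, hS, hc, hN, hM, hH, hT⟩
  have h := thin_core_C hS hc hN hH (C i₀) hT
  rw [(hc i₀).2.2] at h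
  have hN1 : (1 : ℝ) < N := by exact_mod_cast (by omega : 1 < N)
  have hNpos : (0 : ℝ) < N := by linarith
  have h2 : (M : ℝ) ≤ (N : ℝ) ^ η := by
    rw [Real.rpow_add hNpos, Real.rpow_one, mul_comm] at h
    exact le_of_mul_le_mul_left h hNpos
  have h4 : a ≤ η := (Real.rpow_le_rpow_left_iff hN1).1 (hM.trans h2)
  linarith

/-- **No leg of translates, B** (nested middle differences `B_{i₀} − B_{i₀} ⊆ Bᵢ − Bᵢ`, e.g. a
COMMON middle set, or middles that are translates of one set). [new, elementary] -/
theorem no_thin_nested_B (hηa : η < a) :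
    ¬ ∃ (H : Type) (_ : AddCommGroup H) (_ : Fintype H) (L N M : ℕ) (A B C : Fin L → Finset H)
      (i₀ : Fin L), IsSTPP A B C ∧ (∀ i, (A i).card = N ∧ (B i).card = M ∧ (C i).card = N) ∧
      2 ≤ N ∧ (N : ℝ) ^ a ≤ M ∧ (Fintype.card H : ℝ) ≤ L * (N : ℝ) ^ (2 + η) ∧
      (∀ i, ∀ r ∈ B i₀, ∀ r' ∈ B i₀, ∃ t ∈ B i, ∃ t' ∈ B i, r - r' = t' - t) := by
  rintro ⟨H, _, _, L, N, M, A, B, C, i₀, hS, hc, hN, hM, hH, hT⟩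
  have h := thin_core_B hS hc hN hH (B i₀) hT
  rw [(hc i₀).2.1] at h
  have hN1 : (1 : ℝ) < N := by exact_mod_cast (by omega : 1 < N)
  have h4 : a ≤ η := (Real.rpow_le_rpow_left_iff hN1).1 (hM.trans h)
  linarith

/-- **Translation classes.**  If the blocks fall into `K` classes such that within a class the
A-differences are nested (e.g. the `Aᵢ` of a class are translates of each other), then
`M ≤ K·N^η`: a thin near-tight family meets at least `M·N^{−η} ≥ N^{a−η}` classes in each leg
(pigeonhole + `sum_card_BC_mul_core_le` on the largest class). [new, elementary] -/
theorem thin_classes_A (hS : IsSTPP A B C)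
    (hc : ∀ i, (A i).card = N ∧ (B i).card = M ∧ (C i).card = N) (hN : 2 ≤ N)
    (hH : (Fintype.card H : ℝ) ≤ L * (N : ℝ) ^ (2 + η)) {K : ℕ} (cls : Fin L → Fin K)
    (hcls : ∀ i j, cls i = cls j → ∀ p ∈ A j, ∀ p' ∈ A j, ∃ s ∈ A i, ∃ s' ∈ A i,
      p - p' = s' - s) :
    (M : ℝ) ≤ K * (N : ℝ) ^ η := by
  classical
  have hL := one_le_L hH
  set fib : Fin K → Finset (Fin L) := fun c => univ.filter fun i => cls i = c with hfib
  -- pigeonhole: some class has `L ≤ K · |fibre|`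
  have hKpos : 0 < K := Fin.pos (cls ⟨0, hL⟩)
  have hsum : ∑ c : Fin K, (fib c).card = L := by
    rw [hfib, ← Finset.card_eq_sum_card_fiberwise (f := cls) (s := univ) (t := univ)
      fun i _ => mem_univ _, card_univ, Fintype.card_fin]
  obtain ⟨c, -, hcL⟩ : ∃ c ∈ (univ : Finset (Fin K)), L ≤ K * (fib c).card := by
    refine Finset.exists_le_of_sum_le (univ_nonempty_iff.2 ⟨⟨0, hKpos⟩⟩) ?_
    rw [sum_const, card_univ, Fintype.card_fin, smul_eq_mul, ← Finset.mul_sum, hsum]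
  have hSpos : 0 < (fib c).card := by
    by_contra h0; push Not at h0
    have : (fib c).card = 0 := by omega
    rw [this, mul_zero] at hcL; omega
  obtain ⟨j₀, hj₀⟩ := card_pos.1 hSpos
  have hj₀c : cls j₀ = c := (mem_filter.1 hj₀).2
  have h := sum_card_BC_mul_core_le hS (fib c) (A j₀) fun i hi p hp p' hp' =>
    hcls i j₀ ((mem_filter.1 hi).2.trans hj₀c.symm) p hp p' hp'
  rw [sum_profile (fib c) (fun i => (hc i).2.1) (fun i => (hc i).2.2), (hc j₀).1] at h
  -- `|fib| · M · N · N ≤ |H| ≤ L N^{2+η} ≤ K |fib| N^{2+η}`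
  have hNpos : (0 : ℝ) < N := by exact_mod_cast (by omega : 0 < N)
  have hF : (0 : ℝ) < (fib c).card := by exact_mod_cast hSpos
  have h1 : ((fib c).card : ℝ) * (M * N) * N ≤ L * (N : ℝ) ^ (2 + η) := by
    refine le_trans ?_ hH; exact_mod_cast h
  have hcL' : (L : ℝ) ≤ K * (fib c).card := by exact_mod_cast hcL
  have h2 : ((fib c).card : ℝ) * (M * N) * N ≤ K * (fib c).card * (N : ℝ) ^ (2 + η) := by
    refine h1.trans ?_
    exact mul_le_mul_of_nonneg_right hcL' (by positivity)
  rw [Real.rpow_add hNpos, Real.rpow_two] at h2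
  have h3 : ((fib c).card * (N * N) : ℝ) * M ≤ ((fib c).card * (N * N)) * (K * (N : ℝ) ^ η) := by
    linarith
  exact le_of_mul_le_mul_left h3 (by positivity)

end Thin

end DifferenceCores

/-! ## §7 The costume theorem: `¬ ThinPackings ↔ ¬ X_C` (cycle 2)

The crux imposes only the LOWER bound `N^a ≤ M`, so SQUARE blocks `M = N` qualify for every
`a ≤ 1`; conversely the `S₃`-symmetrised cube of a thin family (blocks `Aᵢ × Bⱼ × C_k`, … in
`H³`; `L³` blocks of side `N²M ≥ N^{2+a}`) is a square family of slack
`(2 − 2a + 3η)/(2 + a) → 0`.  Hence `ThinPackings ↔ SquareNearTight ↔ CThesis` (stmt-0593, the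
rank-0 target of route GroupTheoreticSTPP), the last step being BCCGNSU 2017 §3.2 run FORWARDS
(tensor power, words grouped by type, symmetrised uniform square sub-family of the best type).
So the thin shape and the whole `(a, η)` bookkeeping are a COSTUME over "abelian STPP packings
certify `ω = 2`": refuting the crux = proving the unbounded-exponent abelian-STPP barrier
(= `¬ X_C`; cf. `CAbelianObstructionNeg`, stmt-0596, its uniform-ε strengthening), and every
`X_C` construction of any shapes is already a crux witness (with `M = N`).  Only `η` matters:
the TRUE region of the matrix is `{a < η}` (§8) `∪ {η ≥ ε₀}` where `ε₀` is the best slack of a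
square near-tight abelian STPP family anyone can build.  All statements in negative form
(refuter's lane).  LANDED: Negative/ThinPackingsIffCThesis.lean (p76748). -/

section Costume

open Literature.Computability.AlgebraicComplexity.Combinatorics (wordType prod_eq_prod_pow_wordType
  le_of_pow_le_poly_mul_pow)
open Literature.Combinatorics.Additive (AddSimultaneousTPP)
open Summit.MatrixMultiplication.MatrixMultiplication.Theses.GroupTheoreticSTPP (CThesis
  CAbelianObstructionNeg)

/-! ### Square near-tight packings give thin packings (`M = N` is allowed by `N^a ≤ M`) -/

/-- `¬ ThinPackings ⟹` no square near-tight abelian STPP packings: a square family of side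
`n ≥ 2` with `|H| ≤ L·n^{2+η}` is a crux witness at EVERY `a ≤ 1` (take `M = N = n`;
`n^a ≤ n`).  [new, elementary] -/
theorem not_square_of_not_thinPackings (h : ¬ ThinPackings) :
    ¬ ∀ ε : ℝ, 0 < ε → ∃ (H : Type) (_ : AddCommGroup H) (_ : Fintype H) (L n : ℕ)
      (A B C : Fin L → Finset H), IsSTPP A B C ∧
      (∀ i, (A i).card = n ∧ (B i).card = n ∧ (C i).card = n) ∧ 2 ≤ n ∧
      (Fintype.card H : ℝ) ≤ L * (n : ℝ) ^ (2 + ε) := by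
  intro hsq
  apply h
  intro a _ ha1 η hη
  obtain ⟨H, i1, i2, L, n, A, B, C, hS, hc, hn, hH⟩ := hsq η hη
  refine ⟨H, i1, i2, L, n, n, A, B, C, hS, hc, hn, ?_, hH⟩
  have hn1 : (1 : ℝ) ≤ n := by exact_mod_cast (by omega : 1 ≤ n)
  calc (n : ℝ) ^ a ≤ (n : ℝ) ^ (1 : ℝ) := Real.rpow_le_rpow_of_exponent_le hn1 ha1.le
    _ = n := Real.rpow_one _

/-! ### Thin packings give square near-tight packings (symmetrised cube) -/

/-- No square near-tight packings `⟹ ¬ ThinPackings`: the `S₃`-symmetrised cube of a thin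
family at `a = 1 − ε'/4`, `η = ε'/6` (`ε' = min ε 1`) — blocks
`(Aᵢ × Bⱼ × C_k, Bᵢ × Cⱼ × A_k, Cᵢ × Aⱼ × B_k)` in `H³`, an STPP family by
`AddSimultaneousTPP.prod/rotate` — has `L³` square blocks of side `N²M ≥ N^{2+a}` and
`|H|³ ≤ L³ N^{6+3η} ≤ L³ (N²M)^{2+ε}`.  [new; BCCGNSU 2017 Lemma 3.5 symmetrisation] -/
theorem not_thinPackings_of_not_square
    (h : ¬ ∀ ε : ℝ, 0 < ε → ∃ (H : Type) (_ : AddCommGroup H) (_ : Fintype H) (L n : ℕ)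
      (A B C : Fin L → Finset H), IsSTPP A B C ∧
      (∀ i, (A i).card = n ∧ (B i).card = n ∧ (C i).card = n) ∧ 2 ≤ n ∧
      (Fintype.card H : ℝ) ≤ L * (n : ℝ) ^ (2 + ε)) :
    ¬ ThinPackings := by
  intro hT
  apply h
  intro ε hε
  set ε' : ℝ := min ε 1 with hε'
  have hε'0 : 0 < ε' := lt_min hε one_pos
  have hε'1 : ε' ≤ 1 := min_le_right _ _
  have hε'ε : ε' ≤ ε := min_le_left _ _
  obtain ⟨H, i1, i2, L, N, M, A, B, C, hS, hc, hN, hM, hH⟩ :=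
    hT (1 - ε' / 4) (by linarith) (by linarith) (ε' / 6) (by positivity)
  classical
  have hS' := (isSTPP_iff_addSimultaneousTPP A B C).1 hS
  have hbig := hS'.prod (hS'.rotate.prod hS'.rotate.rotate)
  set e := Fintype.equivFin (Fin L × Fin L × Fin L) with he
  have hSτ := hbig.comp e.symm.injective
  have hM1 : 1 ≤ M := one_le_M hN (by linarith) hM
  have hL := one_le_L hH
  refine ⟨H × H × H, inferInstance, inferInstance, Fintype.card (Fin L × Fin L × Fin L), N * M * N,
    fun x => A (e.symm x).1 ×ˢ (B (e.symm x).2.1 ×ˢ C (e.symm x).2.2),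
    fun x => B (e.symm x).1 ×ˢ (C (e.symm x).2.1 ×ˢ A (e.symm x).2.2),
    fun x => C (e.symm x).1 ×ˢ (A (e.symm x).2.1 ×ˢ B (e.symm x).2.2), ?_, ?_, ?_, ?_⟩
  · exact (isSTPP_iff_addSimultaneousTPP _ _ _).2 hSτ
  · intro x
    simp only [card_product, (hc _).1, (hc _).2.1, (hc _).2.2]
    exact ⟨by ring, by ring, by ring⟩
  · calc 2 ≤ N := hN
      _ = N * 1 * 1 := by ring
      _ ≤ N * M * N := by gcongr; omega
  · -- `|H|³ ≤ L³ (N M N)^{2+ε}`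
    have hN1 : (1 : ℝ) < N := by exact_mod_cast (by omega : 1 < N)
    have hNpos : (0 : ℝ) < N := by linarith
    have hHpos : (0 : ℝ) ≤ Fintype.card H := Nat.cast_nonneg _
    have hvol : (N : ℝ) ^ (2 + (1 - ε' / 4)) ≤ ((N * M * N : ℕ) : ℝ) := by
      rw [Real.rpow_add hNpos, Real.rpow_two]
      push_cast
      calc (N : ℝ) ^ 2 * (N : ℝ) ^ (1 - ε' / 4) ≤ (N : ℝ) ^ 2 * (M : ℝ) := by gcongr
        _ = (N : ℝ) * M * N := by ring
    have hexp : 3 * (2 + ε' / 6) ≤ (2 + (1 - ε' / 4)) * (2 + ε) := by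
      nlinarith [mul_nonneg hε'0.le hε.le]
    have hcardH : (Fintype.card (H × H × H) : ℝ) = (Fintype.card H : ℝ) ^ 3 := by
      rw [Fintype.card_prod, Fintype.card_prod]; push_cast; ring
    have hcardL : (Fintype.card (Fin L × Fin L × Fin L) : ℝ) = (L : ℝ) ^ 3 := by
      rw [Fintype.card_prod, Fintype.card_prod, Fintype.card_fin]; push_cast; ring
    rw [hcardH, hcardL]
    calc (Fintype.card H : ℝ) ^ 3 ≤ ((L : ℝ) * (N : ℝ) ^ (2 + ε' / 6)) ^ 3 :=
          pow_le_pow_left₀ hHpos hH 3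
      _ = (L : ℝ) ^ 3 * (N : ℝ) ^ (3 * (2 + ε' / 6)) := by
          rw [mul_pow, ← Real.rpow_natCast ((N : ℝ) ^ (2 + ε' / 6)) 3, ← Real.rpow_mul hNpos.le]
          congr 1; congr 1; push_cast; ring
      _ ≤ (L : ℝ) ^ 3 * (N : ℝ) ^ ((2 + (1 - ε' / 4)) * (2 + ε)) :=
          mul_le_mul_of_nonneg_left (Real.rpow_le_rpow_of_exponent_le hN1.le hexp)
            (by positivity)
      _ = (L : ℝ) ^ 3 * ((N : ℝ) ^ (2 + (1 - ε' / 4))) ^ (2 + ε) := by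
          rw [Real.rpow_mul hNpos.le]
      _ ≤ (L : ℝ) ^ 3 * ((N * M * N : ℕ) : ℝ) ^ (2 + ε) := by
          gcongr

/-! ### Square near-tight packings and `X_C` -/

/-- `¬ X_C ⟹` no square near-tight packings: a square family of slack `ε/2` has
`Σᵢ (n³)^{(2+ε)/3} = L·n^{2+ε} > L·n^{2+ε/2} ≥ |H|`. [new, elementary] -/
theorem not_square_of_not_cThesis (h : ¬ CThesis) :
    ¬ ∀ ε : ℝ, 0 < ε → ∃ (H : Type) (_ : AddCommGroup H) (_ : Fintype H) (L n : ℕ)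
      (A B C : Fin L → Finset H), IsSTPP A B C ∧
      (∀ i, (A i).card = n ∧ (B i).card = n ∧ (C i).card = n) ∧ 2 ≤ n ∧
      (Fintype.card H : ℝ) ≤ L * (n : ℝ) ^ (2 + ε) := by
  intro hsq
  apply h
  intro ε hε
  obtain ⟨H, i1, i2, L, n, A, B, C, hS, hc, hn, hH⟩ := hsq (ε / 2) (by positivity)
  refine ⟨H, i1, i2, L, A, B, C, hS, ?_⟩
  have hL := one_le_L hH
  have hLpos : (0 : ℝ) < L := by exact_mod_cast (by omega : 0 < L)
  have hn1 : (1 : ℝ) < n := by exact_mod_cast (by omega : 1 < n)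
  have hnpos : (0 : ℝ) < n := by linarith
  have hsum : ∑ i : Fin L, (((A i).card * (B i).card * (C i).card : ℕ) : ℝ) ^ ((2 + ε) / 3) =
      L * ((n : ℝ) ^ (2 + ε)) := by
    rw [Finset.sum_congr rfl fun i _ => by rw [(hc i).1, (hc i).2.1, (hc i).2.2], sum_const,
      card_univ, Fintype.card_fin, nsmul_eq_mul]
    congr 1
    push_cast
    rw [show (n : ℝ) * n * n = (n : ℝ) ^ (3 : ℕ) by ring, ← Real.rpow_natCast,
      ← Real.rpow_mul hnpos.le]
    congr 1; push_cast; ring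
  rw [hsum]
  calc (Fintype.card H : ℝ) ≤ L * (n : ℝ) ^ (2 + ε / 2) := hH
    _ < L * (n : ℝ) ^ (2 + ε) := by
        gcongr
        exact Real.rpow_lt_rpow_of_exponent_lt hn1 (by linarith)

section

variable {H : Type*} [AddCommGroup H] {L : ℕ} {A B C : Fin L → Finset H}

/-- Two-leg packing over a sub-family: `Σ_{i∈S} |Aᵢ||Cᵢ| ≤ |H|` if `Bᵢ ≠ ∅` on `S`.
[folklore; BCCGNSU 2017 §2] -/
theorem sum_card_AC_le_of_nonempty_on [Fintype H] (hS : IsSTPP A B C) (S : Finset (Fin L))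
    (hB : ∀ i ∈ S, (B i).Nonempty) : ∑ i ∈ S, (A i).card * (C i).card ≤ Fintype.card H := by
  classical
  have hinj : Set.InjOn (fun x : (Σ _ : Fin L, H × H) => x.2.1 - x.2.2)
      ↑(S.sigma fun k => A k ×ˢ C k) := by
    rintro ⟨k, s, u'⟩ hx ⟨k₂, s₂, u₂⟩ hy he
    rw [mem_coe, mem_sigma, mem_product] at hx hy
    change s - u' = s₂ - u₂ at he
    obtain ⟨b, hb⟩ := hB k₂ hy.1
    have h0 : (s₂ - s) + (b - b) + (u' - u₂) = 0 := by
      have : (s₂ - s) + (b - b) + (u' - u₂) = (s₂ - u₂) - (s - u') := by abel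
      rw [this, he, sub_self]
    obtain ⟨-, h2, h3, -, h5⟩ := hS k₂ k₂ k s hx.2.1 s₂ hy.2.1 b hb b hb u₂ hy.2.2 u' hx.2.2 h0
    subst h2 h3 h5
    rfl
  calc ∑ k ∈ S, (A k).card * (C k).card = (S.sigma fun k => A k ×ˢ C k).card := by
        rw [card_sigma]; simp only [card_product]
    _ = ((S.sigma fun k => A k ×ˢ C k).image
          fun x : (Σ _ : Fin L, H × H) => x.2.1 - x.2.2).card :=
        (card_image_of_injOn hinj).symm
    _ ≤ Fintype.card H := card_le_univ _

end

/-- No square near-tight packings `⟹ ¬ X_C` — BCCGNSU 2017 §3.2 run forwards.  Given an STPP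
family with `F = Σᵢ mᵢ^β > |H|` (`β = (2+ε)/3`, `mᵢ = |Aᵢ||Bᵢ||Cᵢ|`): volume-one blocks are at
most `|H|` in number (two-leg packing), `F^N = Σ_τ T_τ P_τ^β` over word types `τ` (`P_τ = ∏ mᵢ^{τᵢ}`,
at most `(N+1)^{L₀}` types), so for `N` large some type with `P_τ ≥ 2` has `T_τ P_τ^β ≥ |H|^N`;
the symmetrised sub-family of that type in `(H^N)³` has `T_τ³` square blocks of side `P_τ` and
`|H|^{3N} ≤ T_τ³ P_τ^{3β} = T_τ³ P_τ^{2+ε}`.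
[new; cite: BlasiakChurchCohnGrochowNaslundSawinUmans2017, Lemma 3.5, §3.2] -/
theorem not_cThesis_of_not_square
    (h : ¬ ∀ ε : ℝ, 0 < ε → ∃ (H : Type) (_ : AddCommGroup H) (_ : Fintype H) (L n : ℕ)
      (A B C : Fin L → Finset H), IsSTPP A B C ∧
      (∀ i, (A i).card = n ∧ (B i).card = n ∧ (C i).card = n) ∧ 2 ≤ n ∧
      (Fintype.card H : ℝ) ≤ L * (n : ℝ) ^ (2 + ε)) :
    ¬ CThesis := by
  intro hC
  apply h
  intro ε hε
  obtain ⟨H, i1, i2, L₀, A, B, C, hS0, hlt⟩ := hC ε hε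
  classical
  have hS : IsSTPP A B C := hS0
  have hS' := (isSTPP_iff_addSimultaneousTPP A B C).1 hS
  set β : ℝ := (2 + ε) / 3 with hβ
  have hβpos : 0 < β := by positivity
  set m : Fin L₀ → ℕ := fun i => (A i).card * (B i).card * (C i).card with hm
  set F : ℝ := ∑ i, ((m i : ℕ) : ℝ) ^ β with hF
  have hHpos : (0 : ℝ) < Fintype.card H := by exact_mod_cast Fintype.card_pos
  have hlt' : (Fintype.card H : ℝ) < F := hlt
  -- volume-one blocks are few
  set S₁ : Finset (Fin L₀) := univ.filter fun i => m i = 1 with hS₁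
  have hL₁ : S₁.card ≤ Fintype.card H := by
    have hone : ∀ i ∈ S₁, (A i).card = 1 ∧ (B i).card = 1 ∧ (C i).card = 1 := by
      intro i hi
      have h1 : (A i).card * (B i).card * (C i).card = 1 := (mem_filter.1 hi).2
      exact ⟨Nat.eq_one_of_mul_eq_one_right (Nat.eq_one_of_mul_eq_one_right h1),
        Nat.eq_one_of_mul_eq_one_left (Nat.eq_one_of_mul_eq_one_right h1),
        Nat.eq_one_of_mul_eq_one_left h1⟩
    have h2 := sum_card_AC_le_of_nonempty_on hS S₁ fun i hi =>
      card_pos.1 (by rw [(hone i hi).2.1]; exact one_pos)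
    rw [Finset.sum_congr rfl fun i hi => by rw [(hone i hi).1, (hone i hi).2.2], sum_const,
      smul_eq_mul] at h2
    simpa only [mul_one] using h2
  -- the tensor power
  obtain ⟨N, -, hNbig⟩ : ∃ N : ℕ, 1 ≤ N ∧
      ¬ F ^ N ≤ 2 * ((N : ℝ) + 1) ^ L₀ * (Fintype.card H : ℝ) ^ N := by
    by_contra hcon
    push Not at hcon
    have := le_of_pow_le_poly_mul_pow (x := F) (c := 2) (d := L₀) hHpos fun N hN => (hcon N hN)
    linarith
  push Not at hNbig
  -- expansion of `F^N` over words, grouped by value of the type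
  have hFN : F ^ N = ∑ u : Fin N → Fin L₀, (((∏ i, m i ^ (wordType u i : ℕ) : ℕ) : ℝ)) ^ β := by
    have h1 : F ^ N = ∏ _l : Fin N, F := by rw [Finset.prod_const, card_univ, Fintype.card_fin]
    rw [h1, hF, Fintype.prod_sum (fun (_ : Fin N) (i : Fin L₀) => ((m i : ℕ) : ℝ) ^ β)]
    refine Finset.sum_congr rfl fun u _ => ?_
    rw [Real.finsetProd_rpow _ _ (fun l _ => by positivity), ← prod_eq_prod_pow_wordType m u]
    push_cast
    rfl
  set P : (Fin L₀ → Fin (N + 1)) → ℕ := fun τ => ∏ i, m i ^ (τ i : ℕ) with hP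
  have hPu : ∀ u : Fin N → Fin L₀, P (wordType u) = ∏ l, m (u l) := fun u => by
    rw [hP]; exact (prod_eq_prod_pow_wordType m u).symm
  set fib : (Fin L₀ → Fin (N + 1)) → Finset (Fin N → Fin L₀) :=
    fun τ => univ.filter fun u => wordType u = τ with hfib
  -- bad words contribute at most `L₁^N ≤ |H|^N`
  have hbad : ∑ u ∈ univ.filter (fun u : Fin N → Fin L₀ => ¬ 2 ≤ P (wordType u)),
      (((P (wordType u)) : ℕ) : ℝ) ^ β ≤ (Fintype.card H : ℝ) ^ N := by
    calc ∑ u ∈ univ.filter (fun u : Fin N → Fin L₀ => ¬ 2 ≤ P (wordType u)),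
          (((P (wordType u)) : ℕ) : ℝ) ^ β
        ≤ ∑ u ∈ univ.filter (fun u : Fin N → Fin L₀ => ¬ 2 ≤ P (wordType u)),
            (if u ∈ Fintype.piFinset (fun _ : Fin N => S₁) then (1 : ℝ) else 0) := by
          refine Finset.sum_le_sum fun u hu => ?_
          have hu2 : P (wordType u) ≤ 1 := by have := (mem_filter.1 hu).2; omega
          rcases Nat.le_one_iff_eq_zero_or_eq_one.1 hu2 with h0 | h1
          · rw [h0, Nat.cast_zero, Real.zero_rpow hβpos.ne']
            split_ifs <;> norm_num
          · have hu1 : u ∈ Fintype.piFinset (fun _ : Fin N => S₁) := by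
              rw [Fintype.mem_piFinset]
              intro l
              rw [hS₁, mem_filter]
              refine ⟨mem_univ _, ?_⟩
              have hprod : ∏ l, m (u l) = 1 := by rw [← hPu u]; exact h1
              exact Nat.dvd_one.1 (hprod ▸ Finset.dvd_prod_of_mem (fun l => m (u l)) (mem_univ l))
            rw [h1, if_pos hu1]; simp
      _ ≤ ∑ u ∈ (univ : Finset (Fin N → Fin L₀)),
            (if u ∈ Fintype.piFinset (fun _ : Fin N => S₁) then (1 : ℝ) else 0) :=
          Finset.sum_le_sum_of_subset_of_nonneg (filter_subset _ _)
            (fun u _ _ => by split_ifs <;> norm_num)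
      _ = ((Fintype.piFinset fun _ : Fin N => S₁).card : ℝ) := by
          rw [Finset.sum_ite_mem, univ_inter, sum_const, nsmul_eq_mul, mul_one]
      _ = (S₁.card : ℝ) ^ N := by rw [Fintype.card_piFinset_const]; push_cast; ring
      _ ≤ (Fintype.card H : ℝ) ^ N := pow_le_pow_left₀ (Nat.cast_nonneg _) (by exact_mod_cast hL₁) N
  -- good words, grouped by type
  set Tg : Finset (Fin L₀ → Fin (N + 1)) := univ.filter fun τ => 2 ≤ P τ with hTg
  have hgood : ∑ u ∈ univ.filter (fun u : Fin N → Fin L₀ => 2 ≤ P (wordType u)),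
      (((P (wordType u)) : ℕ) : ℝ) ^ β = ∑ τ ∈ Tg, ((fib τ).card : ℝ) * ((P τ : ℕ) : ℝ) ^ β := by
    rw [← Finset.sum_fiberwise_of_maps_to (s := univ.filter fun u => 2 ≤ P (wordType u))
      (t := Tg) (g := wordType)
      (fun u hu => by rw [hTg, mem_filter]; exact ⟨mem_univ _, (mem_filter.1 hu).2⟩)]
    refine Finset.sum_congr rfl fun τ hτ => ?_
    have hτ2 : 2 ≤ P τ := (mem_filter.1 hτ).2
    have hfil : (univ.filter fun u : Fin N → Fin L₀ => 2 ≤ P (wordType u)).filter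
        (fun u => wordType u = τ) = fib τ := by
      ext u
      simp only [hfib, mem_filter, mem_univ, true_and]
      constructor
      · exact fun h => h.2
      · intro h; exact ⟨h ▸ hτ2, h⟩
    rw [hfil, Finset.sum_congr rfl fun u hu => (show ((P (wordType u) : ℕ) : ℝ) ^ β =
      ((P τ : ℕ) : ℝ) ^ β by rw [(mem_filter.1 hu).2]), sum_const, nsmul_eq_mul]
  have hsplit : F ^ N =
      (∑ u ∈ univ.filter (fun u : Fin N → Fin L₀ => 2 ≤ P (wordType u)),
        (((P (wordType u)) : ℕ) : ℝ) ^ β) +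
      ∑ u ∈ univ.filter (fun u : Fin N → Fin L₀ => ¬ 2 ≤ P (wordType u)),
        (((P (wordType u)) : ℕ) : ℝ) ^ β := by
    rw [hFN, Finset.sum_filter_add_sum_filter_not]
  have hgood_ge : 2 * ((N : ℝ) + 1) ^ L₀ * (Fintype.card H : ℝ) ^ N - (Fintype.card H : ℝ) ^ N <
      ∑ τ ∈ Tg, ((fib τ).card : ℝ) * ((P τ : ℕ) : ℝ) ^ β := by
    rw [← hgood]; linarith
  have hX1 : (1 : ℝ) ≤ ((N : ℝ) + 1) ^ L₀ := one_le_pow₀ (by linarith [(Nat.cast_nonneg N : (0 : ℝ) ≤ N)])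
  have hhN : (0 : ℝ) < (Fintype.card H : ℝ) ^ N := pow_pos hHpos N
  have hTgcard : (Tg.card : ℝ) ≤ ((N : ℝ) + 1) ^ L₀ := by
    have h1 : Tg.card ≤ (univ : Finset (Fin L₀ → Fin (N + 1))).card := card_le_univ _
    rw [card_univ, Fintype.card_fun, Fintype.card_fin, Fintype.card_fin] at h1
    exact_mod_cast h1
  have hTgne : Tg.Nonempty := by
    by_contra h0
    rw [not_nonempty_iff_eq_empty] at h0
    rw [h0, sum_empty] at hgood_ge
    nlinarith
  -- pigeonhole over good types
  obtain ⟨τ, hτ, hτbig⟩ : ∃ τ ∈ Tg,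
      (Fintype.card H : ℝ) ^ N ≤ ((fib τ).card : ℝ) * ((P τ : ℕ) : ℝ) ^ β := by
    by_contra hcon
    push Not at hcon
    have hsum_lt : ∑ τ ∈ Tg, ((fib τ).card : ℝ) * ((P τ : ℕ) : ℝ) ^ β <
        ∑ _τ ∈ Tg, (Fintype.card H : ℝ) ^ N := Finset.sum_lt_sum_of_nonempty hTgne hcon
    rw [sum_const, nsmul_eq_mul] at hsum_lt
    nlinarith [mul_le_mul_of_nonneg_right hTgcard hhN.le]
  have hτ2 : 2 ≤ P τ := (mem_filter.1 hτ).2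
  -- the symmetrised square sub-family of type `τ` in `(H^N)³`
  set Tf : Finset (Fin N → Fin L₀) := fib τ with hTfdef
  have hTfmem : ∀ u : Tf, wordType u.1 = τ := fun u => (mem_filter.1 u.2).2
  set piA : (Fin N → Fin L₀) → Finset (Fin N → H) := fun u => Fintype.piFinset fun l => A (u l)
    with hpiA
  set piB : (Fin N → Fin L₀) → Finset (Fin N → H) := fun u => Fintype.piFinset fun l => B (u l)
    with hpiB
  set piC : (Fin N → Fin L₀) → Finset (Fin N → H) := fun u => Fintype.piFinset fun l => C (u l)
    with hpiC
  have hSpi : AddSimultaneousTPP (G := Fin N → H) piA piB piC := hS'.pi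
  have hbig := hSpi.prod (hSpi.rotate.prod hSpi.rotate.rotate)
  set e := Fintype.equivFin (Tf × Tf × Tf) with he
  set emb : Fin (Fintype.card (Tf × Tf × Tf)) →
      (Fin N → Fin L₀) × (Fin N → Fin L₀) × (Fin N → Fin L₀) :=
    fun x => ((e.symm x).1.1, (e.symm x).2.1.1, (e.symm x).2.2.1) with hemb
  have hinj : Function.Injective emb := by
    intro x y hxy
    simp only [hemb, Prod.mk.injEq] at hxy
    exact e.symm.injective
      (Prod.ext (Subtype.ext hxy.1) (Prod.ext (Subtype.ext hxy.2.1) (Subtype.ext hxy.2.2)))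
  have hSτ := hbig.comp hinj
  have hsA : ∀ u : Tf, (piA u.1).card = ∏ i, (A i).card ^ (τ i : ℕ) := by
    intro u; rw [hpiA]; simp only
    rw [Fintype.card_piFinset, prod_eq_prod_pow_wordType (fun i => (A i).card) u.1, hTfmem u]
  have hsB : ∀ u : Tf, (piB u.1).card = ∏ i, (B i).card ^ (τ i : ℕ) := by
    intro u; rw [hpiB]; simp only
    rw [Fintype.card_piFinset, prod_eq_prod_pow_wordType (fun i => (B i).card) u.1, hTfmem u]
  have hsC : ∀ u : Tf, (piC u.1).card = ∏ i, (C i).card ^ (τ i : ℕ) := by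
    intro u; rw [hpiC]; simp only
    rw [Fintype.card_piFinset, prod_eq_prod_pow_wordType (fun i => (C i).card) u.1, hTfmem u]
  set n : ℕ := (∏ i, (A i).card ^ (τ i : ℕ)) * (∏ i, (B i).card ^ (τ i : ℕ)) *
    (∏ i, (C i).card ^ (τ i : ℕ)) with hn
  have hn' : n = P τ := by
    rw [hn, hP]; simp only
    rw [← Finset.prod_mul_distrib, ← Finset.prod_mul_distrib]
    refine Finset.prod_congr rfl fun i _ => ?_
    rw [mul_pow, mul_pow]
  refine ⟨(Fin N → H) × (Fin N → H) × (Fin N → H), inferInstance, inferInstance,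
    Fintype.card (Tf × Tf × Tf), n,
    fun x => piA (emb x).1 ×ˢ (piB (emb x).2.1 ×ˢ piC (emb x).2.2),
    fun x => piB (emb x).1 ×ˢ (piC (emb x).2.1 ×ˢ piA (emb x).2.2),
    fun x => piC (emb x).1 ×ˢ (piA (emb x).2.1 ×ˢ piB (emb x).2.2), ?_, ?_, ?_, ?_⟩
  · exact (isSTPP_iff_addSimultaneousTPP _ _ _).2 hSτ
  · intro x
    refine ⟨?_, ?_, ?_⟩
    · show (piA (e.symm x).1.1 ×ˢ (piB (e.symm x).2.1.1 ×ˢ piC (e.symm x).2.2.1)).card = n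
      rw [card_product, card_product, hsA, hsB, hsC, hn, mul_assoc]
    · show (piB (e.symm x).1.1 ×ˢ (piC (e.symm x).2.1.1 ×ˢ piA (e.symm x).2.2.1)).card = n
      rw [card_product, card_product, hsA, hsB, hsC, hn]; ring
    · show (piC (e.symm x).1.1 ×ˢ (piA (e.symm x).2.1.1 ×ˢ piB (e.symm x).2.2.1)).card = n
      rw [card_product, card_product, hsA, hsB, hsC, hn]; ring
  · rw [hn']; exact hτ2
  · have hcardG : (Fintype.card ((Fin N → H) × (Fin N → H) × (Fin N → H)) : ℝ) =
        ((Fintype.card H : ℝ) ^ N) ^ 3 := by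
      rw [Fintype.card_prod, Fintype.card_prod, Fintype.card_fun, Fintype.card_fin]
      push_cast; ring
    have hcardT : (Fintype.card (Tf × Tf × Tf) : ℝ) = ((fib τ).card : ℝ) ^ 3 := by
      rw [Fintype.card_prod, Fintype.card_prod, Fintype.card_coe, hTfdef]; push_cast; ring
    have hP0 : (0 : ℝ) ≤ ((P τ : ℕ) : ℝ) := Nat.cast_nonneg _
    have hnpow : ((n : ℕ) : ℝ) ^ (2 + ε) = (((P τ : ℕ) : ℝ) ^ β) ^ 3 := by
      rw [hn', ← Real.rpow_natCast (((P τ : ℕ) : ℝ) ^ β) 3, ← Real.rpow_mul hP0]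
      congr 1; rw [hβ]; push_cast; ring
    rw [hcardG, hcardT, hnpow, ← mul_pow]
    exact pow_le_pow_left₀ hhN.le hτbig 3

/-! ### Assembly: the crux is `X_C` in costume -/

/-- **`¬ ThinPackings ↔ ¬ X_C`.**  Refuting the thin-block crux of route ThinBlockAlpha is
EXACTLY refuting the target `CThesis` of route GroupTheoreticSTPP (stmt-0593): an abelian-STPP
barrier in unbounded exponent.  (Positive reading, for planners: every `X_C` construction is a
crux witness with `M = N`; the thin shape and the `(a, η)` bookkeeping add and lose nothing at
the level of the full statement.) [new] -/
theorem not_thinPackings_iff_not_cThesis : ¬ ThinPackings ↔ ¬ CThesis :=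
  ⟨fun h => not_cThesis_of_not_square (not_square_of_not_thinPackings h),
   fun h => not_thinPackings_of_not_square (not_square_of_not_cThesis h)⟩

/-- **The disprover's target is an open item of another route**: `¬ ThinPackings` is literally
equivalent to the negative crux `CAbelianObstructionNeg` of route GroupTheoreticSTPP (stmt-0596,
"BCCGNSU Thm B without the bounded-exponent hypothesis", OPEN).  Kept in this work file only
(deliberately NOT landed: a registered edge `stmt-0596 → ¬ crux` must not be mistaken for a
negative lemma "modulo H" and put the crux on hold); the equivalence is bookkeeping between two
open statements, not evidence for either. [new] -/
theorem cAbelianObstructionNeg_iff_not_thinPackings : CAbelianObstructionNeg ↔ ¬ ThinPackings := by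
  rw [not_thinPackings_iff_not_cThesis]
  constructor
  · rintro ⟨ε, hε, h⟩ hX
    obtain ⟨H, _, _, N, A, B, C, hS, hlt⟩ := hX ε hε
    exact lt_irrefl _ (hlt.trans_le (h H N A B C hS))
  · intro h
    by_contra hneg
    apply h
    intro ε hε
    by_contra hex
    apply hneg
    refine ⟨ε, hε, fun H _ _ N A B C hS => ?_⟩
    by_contra hle
    exact hex ⟨H, ‹_›, ‹_›, N, A, B, C, hS, lt_of_not_ge hle⟩

/-- Positive reading of the costume theorem (for planners; NOT a landing of either statement):
`ThinPackings ↔ X_C`. [new] -/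
theorem thinPackings_iff_cThesis : ThinPackings ↔ CThesis := by
  have h := not_thinPackings_iff_not_cThesis
  tauto

end Costume

/-! ## §7b The "genuinely thin" repair is still `X_C` in costume (cycle 2)

The obvious repair after §7 — force the middle leg to be genuinely short, `N^a ≤ M ≤ N^{a+η}` —
changes nothing at the level of the full statement: a square near-tight family, powered up
(`AddSimultaneousTPP.pi`, same slack) and multiplied with ONE exact split block `⟨m, 1, m⟩` in
`(ℤ/m)²` (`m = ⌊ν^{(1−a)/a}⌋`, `ν` the side), is a genuinely thin family `⟨νm, ν, νm⟩` at
`(a, η)`.  So `¬ GenuinelyThin ↔ ¬ X_C` as well (`not_genuinelyThin_iff_not_cThesis`).  The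
repair that WOULD change the problem is bounding the exponent or the host (rungs 3–5, §3b S4,
§8), not the shape.  LANDING: Negative/ThinPackingsGenuinelyThin.lean (p78054, accepted). -/

section GenuinelyThin

open Literature.Combinatorics.Additive (AddSimultaneousTPP)
open Summit.MatrixMultiplication.MatrixMultiplication.Theses.GroupTheoreticSTPP (CThesis)

/-- The exact split block `⟨m, 1, m⟩` in `(ℤ/m)²`: `A = ℤ/m × 0`, `B = {0}`, `C = 0 × ℤ/m`
(a TPP triple filling its host exactly). [small model; folklore] -/
theorem split_block_two (m : ℕ) [NeZero m] :
    ∃ (A B C : Fin 1 → Finset (ZMod m × ZMod m)), IsSTPP A B C ∧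
      (∀ i, (A i).card = m ∧ (B i).card = 1 ∧ (C i).card = m) := by
  refine ⟨fun _ => univ.image fun x : ZMod m => ((x, 0) : ZMod m × ZMod m), fun _ => {(0, 0)},
    fun _ => univ.image fun y : ZMod m => ((0, y) : ZMod m × ZMod m), ?_, fun i => ?_⟩
  · intro i j k s hs s' hs' t ht t' ht' u hu u' hu' h0
    simp only [mem_image, mem_univ, true_and, mem_singleton] at hs hs' ht ht' hu hu'
    obtain ⟨x, rfl⟩ := hs; obtain ⟨x', rfl⟩ := hs'
    subst ht ht'
    obtain ⟨y, rfl⟩ := hu; obtain ⟨y', rfl⟩ := hu'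
    have h1 : x' = x := by
      have := congr_arg Prod.fst h0
      simpa [sub_eq_zero] using this
    have h2 : y' = y := by
      have := congr_arg Prod.snd h0
      simpa [sub_eq_zero] using this
    exact ⟨Subsingleton.elim _ _, Subsingleton.elim _ _, by rw [h1], rfl, by rw [h2]⟩
  · refine ⟨?_, card_singleton _, ?_⟩ <;>
      rw [card_image_of_injective _ (by intro a b h; simpa using h), card_univ, ZMod.card]

/-- **Square near-tight packings give GENUINELY thin packings** (negative form): if the
repaired crux `GenuinelyThin` (`N^a ≤ M ≤ N^{a+η}` for all `0 ≤ a < 1`, `η > 0`) fails, then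
there are no square near-tight abelian STPP packings (hence `¬ X_C`).  [new] -/
theorem not_square_of_not_genuinelyThin
    (h : ¬ ∀ a : ℝ, 0 ≤ a → a < 1 → ∀ η : ℝ, 0 < η → ∃ (H : Type) (_ : AddCommGroup H)
      (_ : Fintype H) (L N M : ℕ) (A B C : Fin L → Finset H), IsSTPP A B C ∧
      (∀ i, (A i).card = N ∧ (B i).card = M ∧ (C i).card = N) ∧ 2 ≤ N ∧ (N : ℝ) ^ a ≤ M ∧
      (M : ℝ) ≤ (N : ℝ) ^ (a + η) ∧ (Fintype.card H : ℝ) ≤ L * (N : ℝ) ^ (2 + η)) :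
    ¬ ∀ ε : ℝ, 0 < ε → ∃ (H : Type) (_ : AddCommGroup H) (_ : Fintype H) (L n : ℕ)
      (A B C : Fin L → Finset H), IsSTPP A B C ∧
      (∀ i, (A i).card = n ∧ (B i).card = n ∧ (C i).card = n) ∧ 2 ≤ n ∧
      (Fintype.card H : ℝ) ≤ L * (n : ℝ) ^ (2 + ε) := by
  intro hsq
  apply h
  intro a ha0 ha1 η hη
  rcases ha0.eq_or_lt with hzero | ha
  · -- `a = 0`: the split block `⟨2, 1, 2⟩` in `(ℤ/2)²`
    subst hzero
    obtain ⟨A, B, C, hS, hc⟩ := split_block_two 2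
    refine ⟨ZMod 2 × ZMod 2, inferInstance, inferInstance, 1, 2, 1, A, B, C, hS, hc, le_rfl,
      ?_, ?_, ?_⟩
    · simp
    · rw [zero_add]
      have : (1 : ℝ) ≤ (2 : ℝ) ^ η := Real.one_le_rpow (by norm_num) hη.le
      simpa using this
    · have h4 : (2 : ℝ) ^ (2 : ℝ) ≤ (2 : ℝ) ^ (2 + η) :=
        Real.rpow_le_rpow_of_exponent_le (by norm_num) (by linarith)
      rw [Real.rpow_two] at h4
      have hcard : (Fintype.card (ZMod 2 × ZMod 2) : ℝ) = 4 := by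
        rw [Fintype.card_prod, ZMod.card]; norm_num
      rw [hcard]; push_cast; nlinarith
  -- `0 < a < 1`: power up a square family of slack `η` and multiply with a split block
  obtain ⟨H, i1, i2, L, n, A, B, C, hS, hc, hn, hH⟩ := hsq η hη
  classical
  have hS' := (isSTPP_iff_addSimultaneousTPP A B C).1 hS
  have hn1 : (1 : ℝ) < n := by exact_mod_cast (by omega : 1 < n)
  have hnpos : (0 : ℝ) < n := by linarith
  have hL := one_le_L hH
  have h1a : 0 < 1 - a := by linarith
  -- thresholds for the side `ν = n^k`
  set T : ℝ := max 2 (max ((2 : ℝ) ^ (a / (1 - a))) ((2 : ℝ) ^ (a * (a + η) / η))) with hT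
  obtain ⟨k, hk⟩ := pow_unbounded_of_one_lt T hn1
  set ν : ℝ := (n : ℝ) ^ k with hν
  have hν2 : (2 : ℝ) < ν := lt_of_le_of_lt (le_max_left _ _) hk
  have hνpos : 0 < ν := by linarith
  have hνA : (2 : ℝ) ^ (a / (1 - a)) < ν :=
    lt_of_le_of_lt ((le_max_left _ _).trans (le_max_right _ _)) hk
  have hνB : (2 : ℝ) ^ (a * (a + η) / η) < ν :=
    lt_of_le_of_lt ((le_max_right _ _).trans (le_max_right _ _)) hk
  -- `2 ≤ ν^{(1-a)/a}` and `2^{a+η} ≤ ν^{η/a}`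
  have hexp1 : 0 < (1 - a) / a := div_pos h1a ha
  have hA1 : (2 : ℝ) ≤ ν ^ ((1 - a) / a) := by
    have h1 : ((2 : ℝ) ^ (a / (1 - a))) ^ ((1 - a) / a) ≤ ν ^ ((1 - a) / a) :=
      Real.rpow_le_rpow (by positivity) hνA.le hexp1.le
    rw [← Real.rpow_mul (by norm_num)] at h1
    have h2 : a / (1 - a) * ((1 - a) / a) = 1 := by field_simp
    rw [h2, Real.rpow_one] at h1
    exact h1
  have hA2 : (2 : ℝ) ^ (a + η) ≤ ν ^ (η / a) := by
    have h1 : ((2 : ℝ) ^ (a * (a + η) / η)) ^ (η / a) ≤ ν ^ (η / a) :=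
      Real.rpow_le_rpow (by positivity) hνB.le (by positivity)
    rw [← Real.rpow_mul (by norm_num)] at h1
    have h2 : a * (a + η) / η * (η / a) = a + η := by field_simp
    rw [h2] at h1
    exact h1
  -- the multiplier `m`
  set m : ℕ := ⌊ν ^ ((1 - a) / a)⌋₊ with hm
  have hm_le : (m : ℝ) ≤ ν ^ ((1 - a) / a) := Nat.floor_le (by positivity)
  have hm1 : 1 ≤ m := Nat.le_floor (by simpa using (by linarith [hA1] : (1 : ℝ) ≤ ν ^ ((1 - a) / a)))
  have hm_ge : ν ^ ((1 - a) / a) / 2 ≤ m := by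
    have := Nat.lt_floor_add_one (ν ^ ((1 - a) / a))
    rw [← hm] at this
    linarith
  have hmpos : (0 : ℝ) < m := by exact_mod_cast (by omega : 0 < m)
  haveI : NeZero m := ⟨by omega⟩
  -- the family: `F^k × (split block)` in `H^k × (ℤ/m)²`
  obtain ⟨A₀, B₀, C₀, hS₀, hc₀⟩ := split_block_two m
  have hS₀' := (isSTPP_iff_addSimultaneousTPP A₀ B₀ C₀).1 hS₀
  have hpow := hS'.pi (κ := Fin k)
  have hprod := hpow.prod hS₀'
  set e := Fintype.equivFin ((Fin k → Fin L) × Fin 1) with he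
  have hfin := hprod.comp e.symm.injective
  have hνnat : ((n ^ k : ℕ) : ℝ) = ν := by rw [hν]; push_cast; rfl
  have hpiA : ∀ I : Fin k → Fin L, (Fintype.piFinset fun l => A (I l)).card = n ^ k := by
    intro I
    rw [Fintype.card_piFinset, Finset.prod_congr rfl fun l _ => (hc (I l)).1, prod_const, card_univ,
      Fintype.card_fin]
  have hpiB : ∀ I : Fin k → Fin L, (Fintype.piFinset fun l => B (I l)).card = n ^ k := by
    intro I
    rw [Fintype.card_piFinset, Finset.prod_congr rfl fun l _ => (hc (I l)).2.1, prod_const,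
      card_univ, Fintype.card_fin]
  have hpiC : ∀ I : Fin k → Fin L, (Fintype.piFinset fun l => C (I l)).card = n ^ k := by
    intro I
    rw [Fintype.card_piFinset, Finset.prod_congr rfl fun l _ => (hc (I l)).2.2, prod_const,
      card_univ, Fintype.card_fin]
  refine ⟨(Fin k → H) × (ZMod m × ZMod m), inferInstance, inferInstance,
    Fintype.card ((Fin k → Fin L) × Fin 1), n ^ k * m, n ^ k,
    fun x => (Fintype.piFinset fun l => A ((e.symm x).1 l)) ×ˢ A₀ (e.symm x).2,
    fun x => (Fintype.piFinset fun l => B ((e.symm x).1 l)) ×ˢ B₀ (e.symm x).2,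
    fun x => (Fintype.piFinset fun l => C ((e.symm x).1 l)) ×ˢ C₀ (e.symm x).2,
    ?_, ?_, ?_, ?_, ?_, ?_⟩
  · exact (isSTPP_iff_addSimultaneousTPP _ _ _).2 hfin
  · intro x
    refine ⟨?_, ?_, ?_⟩ <;>
      simp only [card_product, hpiA, hpiB, hpiC, (hc₀ _).1, (hc₀ _).2.1, (hc₀ _).2.2, mul_one]
  · -- `2 ≤ n^k * m`
    have h3 : (2 : ℝ) < ((n ^ k : ℕ) : ℝ) := by rw [hνnat]; exact hν2
    have h4 : 2 < n ^ k := by exact_mod_cast h3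
    calc 2 ≤ n ^ k := h4.le
      _ = n ^ k * 1 := (mul_one _).symm
      _ ≤ n ^ k * m := Nat.mul_le_mul_left _ hm1
  · -- `(ν m)^a ≤ ν`
    push_cast
    rw [show ((n : ℝ) ^ k) = ν from rfl]
    have h1 : ν * m ≤ ν ^ (1 / a) := by
      calc ν * m ≤ ν * ν ^ ((1 - a) / a) := by gcongr
        _ = ν ^ (1 + (1 - a) / a) := by rw [Real.rpow_add hνpos, Real.rpow_one]
        _ = ν ^ (1 / a) := by congr 1; field_simp; ring
    calc (ν * m) ^ a ≤ (ν ^ (1 / a)) ^ a := Real.rpow_le_rpow (by positivity) h1 ha.le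
      _ = ν := by rw [← Real.rpow_mul hνpos.le, one_div, inv_mul_cancel₀ ha.ne', Real.rpow_one]
  · -- `ν ≤ (ν m)^{a+η}`
    push_cast
    rw [show ((n : ℝ) ^ k) = ν from rfl]
    have haη : 0 < a + η := by linarith
    have h1 : ν ^ (1 / a) / 2 ≤ ν * m := by
      calc ν ^ (1 / a) / 2 = ν * (ν ^ ((1 - a) / a) / 2) := by
            rw [show (1 : ℝ) / a = 1 + (1 - a) / a by field_simp; ring, Real.rpow_add hνpos,
              Real.rpow_one]; ring
        _ ≤ ν * m := by gcongr
    have h2 : (ν ^ (1 / a) / 2) ^ (a + η) ≤ (ν * m) ^ (a + η) :=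
      Real.rpow_le_rpow (by positivity) h1 haη.le
    refine le_trans ?_ h2
    rw [Real.div_rpow (by positivity) (by norm_num), ← Real.rpow_mul hνpos.le,
      show 1 / a * (a + η) = 1 + η / a by
        rw [div_mul_eq_mul_div, one_mul, add_div, div_self ha.ne'], Real.rpow_add hνpos,
      Real.rpow_one,
      le_div_iff₀ (by positivity)]
    calc ν * (2 : ℝ) ^ (a + η) ≤ ν * ν ^ (η / a) := by gcongr
      _ = ν * ν ^ (η / a) := rfl
  · -- host: `|H|^k m² ≤ L^k (ν m)^{2+η}`
    have hcardG : (Fintype.card ((Fin k → H) × (ZMod m × ZMod m)) : ℝ) =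
        (Fintype.card H : ℝ) ^ k * ((m : ℝ) * m) := by
      rw [Fintype.card_prod, Fintype.card_prod, Fintype.card_fun, Fintype.card_fin, ZMod.card]
      push_cast; ring
    have hcardL : (Fintype.card ((Fin k → Fin L) × Fin 1) : ℝ) = (L : ℝ) ^ k := by
      rw [Fintype.card_prod, Fintype.card_fun, Fintype.card_fin, Fintype.card_fin,
        Fintype.card_fin]
      push_cast; ring
    rw [hcardG, hcardL]
    push_cast
    rw [show ((n : ℝ) ^ k) = ν from rfl]
    have hHk : (Fintype.card H : ℝ) ^ k ≤ (L : ℝ) ^ k * ν ^ (2 + η) := by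
      calc (Fintype.card H : ℝ) ^ k ≤ ((L : ℝ) * (n : ℝ) ^ (2 + η)) ^ k :=
            pow_le_pow_left₀ (Nat.cast_nonneg _) hH k
        _ = (L : ℝ) ^ k * ν ^ (2 + η) := by
            rw [mul_pow, hν, ← Real.rpow_natCast ((n : ℝ) ^ (2 + η)) k,
              ← Real.rpow_mul hnpos.le, mul_comm (2 + η) (k : ℝ), Real.rpow_mul hnpos.le,
              Real.rpow_natCast]
    have hm2 : (m : ℝ) * m ≤ (m : ℝ) ^ (2 + η) := by
      have hm1' : (1 : ℝ) ≤ m := by exact_mod_cast hm1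
      calc (m : ℝ) * m = (m : ℝ) ^ (2 : ℝ) := by rw [Real.rpow_two]; ring
        _ ≤ (m : ℝ) ^ (2 + η) := Real.rpow_le_rpow_of_exponent_le hm1' (by linarith)
    calc (Fintype.card H : ℝ) ^ k * ((m : ℝ) * m)
        ≤ ((L : ℝ) ^ k * ν ^ (2 + η)) * (m : ℝ) ^ (2 + η) :=
          mul_le_mul hHk hm2 (by positivity) (by positivity)
      _ = (L : ℝ) ^ k * (ν * m) ^ (2 + η) := by
          rw [Real.mul_rpow hνpos.le hmpos.le]; ring

/-- **`¬ GenuinelyThin ↔ ¬ X_C`**: the genuinely-thin repair of the crux (upper bound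
`M ≤ N^{a+η}` added) is refuted iff `X_C` is. [new] -/
theorem not_genuinelyThin_iff_not_cThesis :
    (¬ ∀ a : ℝ, 0 ≤ a → a < 1 → ∀ η : ℝ, 0 < η → ∃ (H : Type) (_ : AddCommGroup H)
      (_ : Fintype H) (L N M : ℕ) (A B C : Fin L → Finset H), IsSTPP A B C ∧
      (∀ i, (A i).card = N ∧ (B i).card = M ∧ (C i).card = N) ∧ 2 ≤ N ∧ (N : ℝ) ^ a ≤ M ∧
      (M : ℝ) ≤ (N : ℝ) ^ (a + η) ∧ (Fintype.card H : ℝ) ≤ L * (N : ℝ) ^ (2 + η)) ↔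
    ¬ CThesis := by
  constructor
  · exact fun h => not_cThesis_of_not_square (not_square_of_not_genuinelyThin h)
  · intro h hG
    apply not_thinPackings_iff_not_cThesis.2 h
    intro a ha0 ha1 η hη
    obtain ⟨H, i1, i2, L, N, M, A, B, C, hS, hc, hN, hM, -, hH⟩ := hG a ha0 ha1 η hη
    exact ⟨H, i1, i2, L, N, M, A, B, C, hS, hc, hN, hM, hH⟩

end GenuinelyThin

/-! ## §8 Regimes of the crux matrix (cycle 2)

* the TRUE region `a < η` (one split block; tightness of `no_single_thin_block`);
* bounded exponent, quantitative: the strong (`L`-sensitive) Theorem B of the tree caps the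
  HOST SIZE polynomially in the block size, `|H|^{δ_ℓ} ≤ N^{(2−2a)/3+η}`, and forces
  `(2 + a)·δ_ℓ ≤ (2 − 2a)/3 + η` (how fast the exponent must grow; ideator note B7 made a
  theorem).  LANDING: Negative/ThinPackingsRegimes.lean (p78028, accepted). -/

section Regimes

/-! ## The single split block and the true region `a < η` -/

/-- **The true region.**  Every slice `(a, η)` with `0 ≤ a < η` of the crux matrix holds, by one
split block `⟨N, ⌈N^a⌉, N⟩` in `(ℤ/N)² × ℤ/⌈N^a⌉`, `N = ⌈2^{1/(η−a)}⌉` (so `N^a + 1 ≤ N^η`).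
Together with `no_single_thin_block` (`η < a` fails for one block): single blocks serve exactly
the trivial exponent.  [small model, tightness; new] -/
theorem thin_slice_of_lt {a η : ℝ} (ha : 0 ≤ a) (haη : a < η) :
    ∃ (H : Type) (_ : AddCommGroup H) (_ : Fintype H) (L N M : ℕ) (A B C : Fin L → Finset H),
      IsSTPP A B C ∧ (∀ i, (A i).card = N ∧ (B i).card = M ∧ (C i).card = N) ∧ 2 ≤ N ∧
      (N : ℝ) ^ a ≤ M ∧ (Fintype.card H : ℝ) ≤ L * (N : ℝ) ^ (2 + η) := by
  have hgap : 0 < η - a := by linarith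
  set N : ℕ := ⌈(2 : ℝ) ^ (1 / (η - a))⌉₊ with hN
  have h2pow : (1 : ℝ) < (2 : ℝ) ^ (1 / (η - a)) := Real.one_lt_rpow (by norm_num) (by positivity)
  have hNreal : (2 : ℝ) ^ (1 / (η - a)) ≤ N := Nat.le_ceil _
  have hN2 : 2 ≤ N := by
    have h1 : (1 : ℝ) < N := h2pow.trans_le hNreal
    have h2 : 1 < N := by exact_mod_cast h1
    omega
  have hNpos : (0 : ℝ) < N := by exact_mod_cast (by omega : 0 < N)
  have hN1 : (1 : ℝ) ≤ N := by exact_mod_cast (by omega : 1 ≤ N)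
  set M : ℕ := ⌈(N : ℝ) ^ a⌉₊ with hM
  have hMge : (N : ℝ) ^ a ≤ M := Nat.le_ceil _
  have hNa1 : (1 : ℝ) ≤ (N : ℝ) ^ a := Real.one_le_rpow hN1 ha
  have hM1 : 1 ≤ M := by
    have : (1 : ℝ) ≤ M := hNa1.trans hMge
    exact_mod_cast this
  haveI : NeZero N := ⟨by omega⟩
  haveI : NeZero M := ⟨by omega⟩
  obtain ⟨A, B, C, hS, hc, hcard⟩ := single_block_volume_tight N M
  refine ⟨ZMod N × ZMod N × ZMod M, inferInstance, inferInstance, 1, N, M, A, B, C, hS, hc, hN2,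
    hMge, ?_⟩
  -- `M ≤ N^η`, since `N^η = N^a · N^{η−a} ≥ 2 N^a ≥ N^a + 1 > M`
  have hMle : (M : ℝ) ≤ (N : ℝ) ^ η := by
    have hM' : (M : ℝ) < (N : ℝ) ^ a + 1 := Nat.ceil_lt_add_one (by positivity)
    have hNηa : (2 : ℝ) ≤ (N : ℝ) ^ (η - a) := by
      calc (2 : ℝ) = ((2 : ℝ) ^ (1 / (η - a))) ^ (η - a) := by
            rw [← Real.rpow_mul (by norm_num), one_div, inv_mul_cancel₀ hgap.ne', Real.rpow_one]
        _ ≤ (N : ℝ) ^ (η - a) := Real.rpow_le_rpow (by positivity) hNreal hgap.le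
    have hsplit : (N : ℝ) ^ η = (N : ℝ) ^ a * (N : ℝ) ^ (η - a) := by
      rw [← Real.rpow_add hNpos]; congr 1; ring
    rw [hsplit]
    nlinarith
  have hfin : ((N * M * N : ℕ) : ℝ) ≤ ((1 : ℕ) : ℝ) * (N : ℝ) ^ (2 + η) := by
    push_cast
    calc (N : ℝ) * M * N = (N * N) * M := by ring
      _ ≤ (N * N) * (N : ℝ) ^ η := by gcongr
      _ = 1 * (N : ℝ) ^ (2 + η) := by rw [Real.rpow_add hNpos, Real.rpow_two]; ring
  rw [hcard]
  exact hfin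

/-! ## Bounded exponent: the host-size cap (strong Theorem B) -/

/-- **Host-size cap at exponent `ℓ`.**  With the `δ = δ_ℓ > 0` of the tree's strong Theorem B
(`AddSimultaneousTPP.exists_sum_rpow_le`: `Σᵢ (|Aᵢ||Bᵢ||Cᵢ|)^{2/3} ≤ |H|^{1−δ}` at exponent `≤ ℓ`),
every thin near-tight family at `(a, η)` in a group of exponent `≤ ℓ` satisfies
`|H|^δ ≤ N^{(2−2a)/3+η}` and `(2 + a)·δ ≤ (2 − 2a)/3 + η`.  Proof:
`L (N²M)^{2/3} ≤ |H|^{1−δ}` and `|H| ≤ L N^{2+η}` give `|H|^δ N^{(2+a)2/3} ≤ N^{2+η}`; and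
`|H| ≥ N²M ≥ N^{2+a}`.  [new; cite: BlasiakChurchCohnGrochowNaslundSawinUmans2017, Thm. B, §3.2] -/
theorem host_cap_of_exponent_le (ℓ : ℕ) : ∃ δ : ℝ, 0 < δ ∧
    ∀ (H : Type) [AddCommGroup H] [Fintype H], AddMonoid.exponent H ≤ ℓ →
      ∀ (L N M : ℕ) (A B C : Fin L → Finset H) (a η : ℝ), IsSTPP A B C →
        (∀ i, (A i).card = N ∧ (B i).card = M ∧ (C i).card = N) → 2 ≤ N → 0 ≤ a →
        (N : ℝ) ^ a ≤ M → (Fintype.card H : ℝ) ≤ L * (N : ℝ) ^ (2 + η) →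
        (Fintype.card H : ℝ) ^ δ ≤ (N : ℝ) ^ ((2 - 2 * a) / 3 + η) ∧
        (2 + a) * δ ≤ (2 - 2 * a) / 3 + η := by
  obtain ⟨δ, hδ, hmain⟩ := Literature.Combinatorics.Additive.AddSimultaneousTPP.exists_sum_rpow_le ℓ
  refine ⟨δ, hδ, ?_⟩
  intro H _ _ hexp L N M A B C a η hS hc hN ha hM hH
  classical
  have hS' := (isSTPP_iff_addSimultaneousTPP A B C).1 hS
  have h := hmain H hexp (Fin L) A B C hS'
  have hsum : ∑ i : Fin L, (((A i).card * (B i).card * (C i).card : ℕ) : ℝ) ^ ((2 : ℝ) / 3) =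
      L * (((N * M * N : ℕ) : ℝ) ^ ((2 : ℝ) / 3)) := by
    rw [Finset.sum_congr rfl fun i _ => by rw [(hc i).1, (hc i).2.1, (hc i).2.2], sum_const,
      card_univ, Fintype.card_fin, nsmul_eq_mul]
  rw [hsum] at h
  have hL := one_le_L hH
  have hLpos : (0 : ℝ) < L := by exact_mod_cast (by omega : 0 < L)
  have hN1 : (1 : ℝ) < N := by exact_mod_cast (by omega : 1 < N)
  have hNpos : (0 : ℝ) < N := by linarith
  have hHpos : (0 : ℝ) < Fintype.card H := by exact_mod_cast Fintype.card_pos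
  have hvol : (N : ℝ) ^ (2 + a) ≤ ((N * M * N : ℕ) : ℝ) := by
    rw [Real.rpow_add hNpos, Real.rpow_two]
    push_cast
    calc (N : ℝ) ^ 2 * (N : ℝ) ^ a ≤ (N : ℝ) ^ 2 * (M : ℝ) := by gcongr
      _ = (N : ℝ) * M * N := by ring
  have hkey : (Fintype.card H : ℝ) * (N : ℝ) ^ ((2 + a) * ((2 : ℝ) / 3)) ≤
      (Fintype.card H : ℝ) ^ (1 - δ) * (N : ℝ) ^ (2 + η) := by
    calc (Fintype.card H : ℝ) * (N : ℝ) ^ ((2 + a) * ((2 : ℝ) / 3))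
        ≤ (L * (N : ℝ) ^ (2 + η)) * (N : ℝ) ^ ((2 + a) * ((2 : ℝ) / 3)) := by gcongr
      _ = (L * (N : ℝ) ^ ((2 + a) * ((2 : ℝ) / 3))) * (N : ℝ) ^ (2 + η) := by ring
      _ ≤ (L * ((N * M * N : ℕ) : ℝ) ^ ((2 : ℝ) / 3)) * (N : ℝ) ^ (2 + η) := by
          gcongr
          rw [Real.rpow_mul hNpos.le]
          exact Real.rpow_le_rpow (by positivity) hvol (by norm_num)
      _ ≤ (Fintype.card H : ℝ) ^ (1 - δ) * (N : ℝ) ^ (2 + η) := by gcongr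
  have hmul : (Fintype.card H : ℝ) ^ (1 - δ) * (Fintype.card H : ℝ) ^ δ = Fintype.card H := by
    rw [← Real.rpow_add hHpos]; simp
  have h1δ : (0 : ℝ) < (Fintype.card H : ℝ) ^ (1 - δ) := Real.rpow_pos_of_pos hHpos _
  have h2 : (Fintype.card H : ℝ) ^ δ * (N : ℝ) ^ ((2 + a) * ((2 : ℝ) / 3)) ≤
      (N : ℝ) ^ (2 + η) := by
    refine le_of_mul_le_mul_left ?_ h1δ
    calc (Fintype.card H : ℝ) ^ (1 - δ) *
          ((Fintype.card H : ℝ) ^ δ * (N : ℝ) ^ ((2 + a) * ((2 : ℝ) / 3)))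
        = Fintype.card H * (N : ℝ) ^ ((2 + a) * ((2 : ℝ) / 3)) := by rw [← mul_assoc, hmul]
      _ ≤ (Fintype.card H : ℝ) ^ (1 - δ) * (N : ℝ) ^ (2 + η) := hkey
  have h3 : (Fintype.card H : ℝ) ^ δ ≤ (N : ℝ) ^ ((2 - 2 * a) / 3 + η) := by
    have hNe : (0 : ℝ) < (N : ℝ) ^ ((2 + a) * ((2 : ℝ) / 3)) := Real.rpow_pos_of_pos hNpos _
    have h5 : (Fintype.card H : ℝ) ^ δ ≤ (N : ℝ) ^ (2 + η) / (N : ℝ) ^ ((2 + a) * ((2 : ℝ) / 3)) :=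
      (le_div_iff₀ hNe).2 h2
    rw [← Real.rpow_sub hNpos] at h5
    refine h5.trans (le_of_eq ?_)
    congr 1; ring
  refine ⟨h3, ?_⟩
  have hvolH : (N : ℝ) ^ (2 + a) ≤ Fintype.card H := by
    have h6 := thin_volume_bound hS hc ⟨0, hL⟩
    calc (N : ℝ) ^ (2 + a) ≤ ((N * M * N : ℕ) : ℝ) := hvol
      _ ≤ Fintype.card H := by exact_mod_cast h6
  have h4 : (N : ℝ) ^ ((2 + a) * δ) ≤ (N : ℝ) ^ ((2 - 2 * a) / 3 + η) := by
    calc (N : ℝ) ^ ((2 + a) * δ) = ((N : ℝ) ^ (2 + a)) ^ δ := Real.rpow_mul hNpos.le _ _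
      _ ≤ (Fintype.card H : ℝ) ^ δ := Real.rpow_le_rpow (by positivity) hvolH hδ.le
      _ ≤ _ := h3
  exact (Real.rpow_le_rpow_left_iff hN1).1 h4

end Regimes

/-! ## §9 The true wedge: the diagonal `η = a` is not a barrier (cycle 3)

Cycles 1–2 and every other seat (ideator notes B3, the line card's "dead sub-ansatz", drefute's
calibration (iii)) met the DIAGONAL `η = a` as the cap of each cheap design class: one split block
(`thin_slice_of_lt` / `no_single_thin_block`), coordinate or sign-coherent frames, random label
selection.  It is not the frontier of the crux matrix anywhere.  RESCALING (`thinSlice_of_design`):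
a witness of `(a₀, η₀)` powered up and multiplied with one exact split block `⟨m, 1, m⟩` witnesses
every `(a, η)` with `0 < a ≤ a₀`, `η/a > η₀/a₀` — so the true region is star-shaped from the
origin (and, by products of two designs, log-convex: the frontier `η*(a) := inf{η : ThinSlice a η}`
is CONVEX, `η*(0) = 0`, `η*(a)/a` is non-decreasing, `ThinPackings ↔ η* ≡ 0 ↔ η*(1) = 0`, the
last being `X_C` of §7; conversely `¬ ThinPackings ↔ η*(1) > 0`, and then the cube map of §7
gives only `η*(a) ≥ ((2+a)·η*(1) − 2 + 2a)/3`, i.e. pins the corner `a → 1` and nothing else).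
DESIGNS (`thinSlice_of_usp`): the tree's CKSU Theorem 33 turns a local strong USP whose rows have
composition `(p, q, p)` into an STPP family of blocks `⟨(ℓ−1)^p, (ℓ−1)^q, (ℓ−1)^p⟩` in
`Cyc_ℓ^{2p+q}`, a witness of `(q/p, η₀)` as soon as `ℓ^{2p+q} ≤ |U|·((ℓ−1)^p)^{2+η₀}`.  Three
kernel USPs: `U₂ = {123, 231}` (= CKSU Prop. 28; `ℓ = 16`: `(1, 9/11)`, exact best
`log_15(4096/450) = 0.8155`), `U₄` = the MAXIMUM skew USP of composition `(3,1,3)` (size 4;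
`ℓ = 21`: `(1/3, 2/9)`, best `0.2170`), `U₉` = the MAXIMUM skew USP of composition `(4,1,4)`
(size 9 = the cap `2p+1`, found by this seat's exhaustive search; `ℓ = 16`: `(1/4, 5/48)`, best
`0.1007`).  Hence (`thinSlice_of_wedge`) the slices `9a < 11η`, `2a < 3η ∧ a ≤ 1/3`,
`5a < 12η ∧ a ≤ 1/4` are TRUE, and the strengthening S5 "nothing below the diagonal" is FALSE
(`not_thinPackingsDiagonalBarrier`).  Exhaustive maxima of skew local strong USPs (this seat,
`scratch/skewusp.py`, `skew414.py`): `(1,1,1): 2`, `(2,1,2): 3`, `(3,1,3): 4`, `(2,2,2): 4`,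
`(4,1,4): 9` (cap `2p+1` = distinct positions of the single `2`).  NO LINEAR BARRIER: the
explicit infinite family `lrow n` (`n` rows, width `4n+1`, composition `(2n,1,2n)`; threshold
sign patterns on doubled columns, `isLocalStrongUSP_of_separators`) gives, at `ℓ = 4n+2`,
`thinSlice_small_shape`: for every `ρ > 0` all slices `η > ρ·a`, `a ≤ a₁(ρ)` hold — so
`η*(a) = o(a)` as `a → 0` (with convexity: `η*(a)/a ↓ 0`) and the strengthening S6 "`η ≥ c·a`
for some `c > 0`" is FALSE (`not_thinPackingsLinearBarrier`).  PALEY SKEW USPs (computational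
evidence, this seat's `scratch/paley.py`, exhaustive triple check): for every prime `P` with
`11 ≤ P ≤ 43` and for `F₉` the `P` rows `u^r_i = 2 (i = r), 1 (i − r a nonzero square),
3 (otherwise)` form a local strong USP of FULL size `P` = the cap, composition
`((P−1)/2, 1, (P−1)/2)` (it fails at `P = 5, 7`; the kernel `U₉` has the `F₉` parameters); by
the Jacobsthal count `#{χ(x)=1, χ(x−d)=−1} = (P − 2 − (−1) ∓ …)/4 ≥ 2` for `P ≥ 11` this should
hold for all prime powers `P ≥ 9` (not formalised: needs `Σₓ χ(x)χ(x+d) = −1`).  Their design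
points: `a₀ = 2/(P−1)`, best ratio `η₀/a₀ = 0.403 (P=9), 0.376 (11), 0.355 (13), 0.327 (17),
0.300 (23), 0.258 (41), 0.211 (101), 0.143 (1009), 0.108 (10007)` — i.e. `η*(a) ≲ a/ln(1/a)`
at the thin end.  For the DISPROVER: a refutation must prove `¬ ThinSlice a η₀(a)` with
`η₀(a) < η*(a) = o(a)` (`≲ a/ln(1/a)` if Paley is used) — it must see many blocks, not volumes,
and its rate at the thin end is sublinear.  For the LEAD: a frame design is news only
below `min(9a/11, hull{(0,0),(1/4,0.1007),(1,0.8155)})` in the kernel, below `0.41·a` in print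
(CKSU 2005 §6: `ω < 2.41` from abelian STPP designs of bounded exponent).
LANDING: Negative/ThinPackingsTrueWedge.lean (cycle 3). -/

section TrueWedge

open Literature.Combinatorics.Additive (AddSimultaneousTPP)
open Summit.MatrixMultiplication.MatrixMultiplication.Theorems (card_uspA card_uspB card_uspC)

/-- The `(a, η)` slice of the crux matrix: an abelian STPP family of blocks `⟨N, M, N⟩`,
`N ≥ 2`, `N^a ≤ M`, two-leg tight up to `N^η`.  `ThinPackings` is literally
`∀ a ∈ [0,1), ∀ η > 0, ThinSlice a η` (`thinPackings_iff_thinSlice`). -/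
def ThinSlice (a η : ℝ) : Prop :=
  ∃ (H : Type) (_ : AddCommGroup H) (_ : Fintype H) (L N M : ℕ) (A B C : Fin L → Finset H),
    IsSTPP A B C ∧ (∀ i, (A i).card = N ∧ (B i).card = M ∧ (C i).card = N) ∧ 2 ≤ N ∧
    (N : ℝ) ^ a ≤ M ∧ (Fintype.card H : ℝ) ≤ L * (N : ℝ) ^ (2 + η)

/-- The crux is the conjunction of its slices (definitional). -/
theorem thinPackings_iff_thinSlice :
    ThinPackings ↔ ∀ a : ℝ, 0 ≤ a → a < 1 → ∀ η : ℝ, 0 < η → ThinSlice a η := Iff.rfl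

/-- `⌊x⌋₊ ≥ x/2` for `x ≥ 1`. [folklore] -/
theorem half_le_floor {x : ℝ} (hx : 1 ≤ x) : x / 2 ≤ (⌊x⌋₊ : ℝ) := by
  rcases lt_or_ge x 2 with h | h
  · have h1 : (1 : ℝ) ≤ (⌊x⌋₊ : ℝ) := by exact_mod_cast Nat.le_floor (by simpa using hx)
    linarith
  · have := Nat.lt_floor_add_one x
    linarith

/-- **Rescaling a design** (power up, then multiply with one exact split block `⟨m, 1, m⟩`).
An STPP family of `L₀` blocks `⟨N₀, M₀, N₀⟩` with `N₀ ≥ 2`, `N₀^{a₀} ≤ M₀` and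
`|H₀| ≤ L₀·N₀^{2+η₀}` — a witness of the slice `(a₀, η₀)` — yields witnesses of EVERY slice
`(a, η)` with `0 < a ≤ a₀` and `η/a > η₀/a₀`: the `k`-th power (`AddSimultaneousTPP.pi`, blocks
`⟨ν, M₀^k, ν⟩`, `ν = N₀^k`, same `(a₀, η₀)`) times the split block `⟨m, 1, m⟩` in `(ℤ/m)²`,
`m = ⌊ν^{(a₀−a)/a}⌋`, has blocks `⟨νm, M₀^k, νm⟩` with `(νm)^a ≤ ν^{a₀} ≤ M₀^k` and host
`|H₀|^k m² ≤ L₀^k (νm)² ν^{η₀} ≤ L₀^k (νm)^{2+η}` as soon as `ν^{η a₀/a − η₀} ≥ 2^η`.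
In the `(a, η)` plane: the segment from the origin to a true point is true (and everything
above it).  [new, elementary] -/
theorem thinSlice_of_design {H₀ : Type} [AddCommGroup H₀] [Fintype H₀] {L₀ N₀ M₀ : ℕ}
    {A B C : Fin L₀ → Finset H₀} (hS : IsSTPP A B C)
    (hc : ∀ i, (A i).card = N₀ ∧ (B i).card = M₀ ∧ (C i).card = N₀) (hN : 2 ≤ N₀)
    {a₀ η₀ : ℝ} (hM : (N₀ : ℝ) ^ a₀ ≤ M₀)
    (hH : (Fintype.card H₀ : ℝ) ≤ L₀ * (N₀ : ℝ) ^ (2 + η₀))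
    {a η : ℝ} (ha : 0 < a) (haa : a ≤ a₀) (hη : 0 < η) (hw : η₀ * a < η * a₀) :
    ThinSlice a η := by
  classical
  have hS' := (isSTPP_iff_addSimultaneousTPP A B C).1 hS
  have hn1 : (1 : ℝ) < N₀ := by exact_mod_cast (by omega : 1 < N₀)
  have hnpos : (0 : ℝ) < N₀ := by linarith
  have hL := one_le_L hH
  -- the gain exponent
  set e : ℝ := η * a₀ / a - η₀ with he_def
  have he : 0 < e := by
    rw [he_def, sub_pos, lt_div_iff₀ ha]; linarith
  -- thresholds for the side `ν = N₀^k`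
  set T : ℝ := max 2 ((2 : ℝ) ^ (η / e)) with hT
  obtain ⟨k, hk⟩ := pow_unbounded_of_one_lt T hn1
  set ν : ℝ := (N₀ : ℝ) ^ k with hν
  have hν2 : (2 : ℝ) < ν := lt_of_le_of_lt (le_max_left _ _) hk
  have hνpos : 0 < ν := by linarith
  have hν1 : 1 ≤ ν := by linarith
  have hνe : (2 : ℝ) ^ η ≤ ν ^ e := by
    have h1 : (2 : ℝ) ^ (η / e) < ν := lt_of_le_of_lt (le_max_right _ _) hk
    have h2 : ((2 : ℝ) ^ (η / e)) ^ e ≤ ν ^ e := Real.rpow_le_rpow (by positivity) h1.le he.le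
    rw [← Real.rpow_mul (by norm_num), div_mul_cancel₀ _ he.ne'] at h2
    exact h2
  -- the multiplier `m`
  have hexp0 : 0 ≤ (a₀ - a) / a := div_nonneg (by linarith) ha.le
  set x : ℝ := ν ^ ((a₀ - a) / a) with hx
  have hx1 : 1 ≤ x := Real.one_le_rpow hν1 hexp0
  set m : ℕ := ⌊x⌋₊ with hm
  have hm_le : (m : ℝ) ≤ x := Nat.floor_le (by positivity)
  have hm_ge : x / 2 ≤ m := half_le_floor hx1
  have hm1 : 1 ≤ m := Nat.le_floor (by simpa using hx1)
  have hmpos : (0 : ℝ) < m := by exact_mod_cast (by omega : 0 < m)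
  haveI : NeZero m := ⟨by omega⟩
  -- `ν · x = ν^{a₀/a}`
  have hνx : ν * x = ν ^ (a₀ / a) := by
    have h1 : ν ^ (a₀ / a) = ν ^ (1 + (a₀ - a) / a) := by
      congr 1; field_simp; ring
    rw [h1, Real.rpow_add hνpos, Real.rpow_one]
  -- the family: `F^k × (split block)` in `H₀^k × (ℤ/m)²`
  obtain ⟨A₀, B₀, C₀, hS₀, hc₀⟩ := split_block_two m
  have hS₀' := (isSTPP_iff_addSimultaneousTPP A₀ B₀ C₀).1 hS₀
  have hpow := hS'.pi (κ := Fin k)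
  have hprod := hpow.prod hS₀'
  set eqv := Fintype.equivFin ((Fin k → Fin L₀) × Fin 1) with heqv
  have hfin := hprod.comp eqv.symm.injective
  have hνnat : ((N₀ ^ k : ℕ) : ℝ) = ν := by rw [hν]; push_cast; rfl
  have hpiA : ∀ I : Fin k → Fin L₀, (Fintype.piFinset fun l => A (I l)).card = N₀ ^ k := by
    intro I
    rw [Fintype.card_piFinset, Finset.prod_congr rfl fun l _ => (hc (I l)).1, prod_const, card_univ,
      Fintype.card_fin]
  have hpiB : ∀ I : Fin k → Fin L₀, (Fintype.piFinset fun l => B (I l)).card = M₀ ^ k := by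
    intro I
    rw [Fintype.card_piFinset, Finset.prod_congr rfl fun l _ => (hc (I l)).2.1, prod_const,
      card_univ, Fintype.card_fin]
  have hpiC : ∀ I : Fin k → Fin L₀, (Fintype.piFinset fun l => C (I l)).card = N₀ ^ k := by
    intro I
    rw [Fintype.card_piFinset, Finset.prod_congr rfl fun l _ => (hc (I l)).2.2, prod_const,
      card_univ, Fintype.card_fin]
  refine ⟨(Fin k → H₀) × (ZMod m × ZMod m), inferInstance, inferInstance,
    Fintype.card ((Fin k → Fin L₀) × Fin 1), N₀ ^ k * m, M₀ ^ k,
    fun y => (Fintype.piFinset fun l => A ((eqv.symm y).1 l)) ×ˢ A₀ (eqv.symm y).2,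
    fun y => (Fintype.piFinset fun l => B ((eqv.symm y).1 l)) ×ˢ B₀ (eqv.symm y).2,
    fun y => (Fintype.piFinset fun l => C ((eqv.symm y).1 l)) ×ˢ C₀ (eqv.symm y).2,
    ?_, ?_, ?_, ?_, ?_⟩
  · exact (isSTPP_iff_addSimultaneousTPP _ _ _).2 hfin
  · intro y
    refine ⟨?_, ?_, ?_⟩ <;>
      simp only [card_product, hpiA, hpiB, hpiC, (hc₀ _).1, (hc₀ _).2.1, (hc₀ _).2.2, mul_one]
  · -- `2 ≤ N₀^k * m`
    have h3 : (2 : ℝ) < ((N₀ ^ k : ℕ) : ℝ) := by rw [hνnat]; exact hν2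
    have h4 : 2 < N₀ ^ k := by exact_mod_cast h3
    calc 2 ≤ N₀ ^ k := h4.le
      _ = N₀ ^ k * 1 := (mul_one _).symm
      _ ≤ N₀ ^ k * m := Nat.mul_le_mul_left _ hm1
  · -- `(ν m)^a ≤ ν^{a₀} ≤ M₀^k`
    push_cast
    rw [show ((N₀ : ℝ) ^ k) = ν from rfl]
    have h1 : ν * m ≤ ν ^ (a₀ / a) := by
      calc ν * m ≤ ν * x := by gcongr
        _ = ν ^ (a₀ / a) := hνx
    have hM0 : (0 : ℝ) ≤ (N₀ : ℝ) ^ a₀ := by positivity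
    calc (ν * m) ^ a ≤ (ν ^ (a₀ / a)) ^ a := Real.rpow_le_rpow (by positivity) h1 ha.le
      _ = ν ^ a₀ := by rw [← Real.rpow_mul hνpos.le, div_mul_cancel₀ _ ha.ne']
      _ = ((N₀ : ℝ) ^ a₀) ^ k := by
          rw [hν, ← Real.rpow_natCast, ← Real.rpow_natCast, ← Real.rpow_mul hnpos.le,
            ← Real.rpow_mul hnpos.le, mul_comm]
      _ ≤ (M₀ : ℝ) ^ k := pow_le_pow_left₀ hM0 hM k
  · -- host: `|H₀|^k m² ≤ L₀^k (ν m)^{2+η}`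
    have hcardG : (Fintype.card ((Fin k → H₀) × (ZMod m × ZMod m)) : ℝ) =
        (Fintype.card H₀ : ℝ) ^ k * ((m : ℝ) * m) := by
      rw [Fintype.card_prod, Fintype.card_prod, Fintype.card_fun, Fintype.card_fin, ZMod.card]
      push_cast; ring
    have hcardL : (Fintype.card ((Fin k → Fin L₀) × Fin 1) : ℝ) = (L₀ : ℝ) ^ k := by
      rw [Fintype.card_prod, Fintype.card_fun, Fintype.card_fin, Fintype.card_fin,
        Fintype.card_fin]
      push_cast; ring
    rw [hcardG, hcardL]
    push_cast
    rw [show ((N₀ : ℝ) ^ k) = ν from rfl]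
    have hHk : (Fintype.card H₀ : ℝ) ^ k ≤ (L₀ : ℝ) ^ k * ν ^ (2 + η₀) := by
      calc (Fintype.card H₀ : ℝ) ^ k ≤ ((L₀ : ℝ) * (N₀ : ℝ) ^ (2 + η₀)) ^ k :=
            pow_le_pow_left₀ (Nat.cast_nonneg _) hH k
        _ = (L₀ : ℝ) ^ k * ν ^ (2 + η₀) := by
            rw [mul_pow, hν, ← Real.rpow_natCast ((N₀ : ℝ) ^ (2 + η₀)) k,
              ← Real.rpow_mul hnpos.le, mul_comm (2 + η₀) (k : ℝ), Real.rpow_mul hnpos.le,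
              Real.rpow_natCast]
    -- the key comparison `ν^{η₀} ≤ (ν m)^η`
    have hkey : ν ^ η₀ ≤ (ν * m) ^ η := by
      have h1 : ν ^ (a₀ / a) / 2 ≤ ν * m := by
        calc ν ^ (a₀ / a) / 2 = ν * (x / 2) := by rw [← hνx]; ring
          _ ≤ ν * m := by gcongr
      have h2 : (ν ^ (a₀ / a) / 2) ^ η ≤ (ν * m) ^ η :=
        Real.rpow_le_rpow (by positivity) h1 hη.le
      refine le_trans ?_ h2
      rw [Real.div_rpow (by positivity) (by norm_num), ← Real.rpow_mul hνpos.le,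
        le_div_iff₀ (by positivity)]
      -- `ν^{η₀} 2^η ≤ ν^{(a₀/a) η}` since `ν^e ≥ 2^η`, `e = η a₀/a − η₀`
      have h3 : a₀ / a * η = η₀ + e := by rw [he_def]; ring
      rw [h3, Real.rpow_add hνpos]
      gcongr
    calc (Fintype.card H₀ : ℝ) ^ k * ((m : ℝ) * m)
        ≤ ((L₀ : ℝ) ^ k * ν ^ (2 + η₀)) * ((m : ℝ) * m) := by gcongr
      _ = (L₀ : ℝ) ^ k * ((ν * m) ^ (2 : ℝ) * ν ^ η₀) := by
          rw [Real.rpow_add hνpos, Real.rpow_two, Real.rpow_two]; ring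
      _ ≤ (L₀ : ℝ) ^ k * ((ν * m) ^ (2 : ℝ) * (ν * m) ^ η) := by gcongr
      _ = (L₀ : ℝ) ^ k * (ν * m) ^ (2 + η) := by
          rw [Real.rpow_add (by positivity)]


/-! ## Base designs: CKSU Theorem 33 families of three small local strong USPs

All three base designs are instances of the tree's `CohnKleinbergSzegedyUmans2005_thm33_holds`
(local strong USP `U ⊆ {1,2,3}^w` ⇒ STPP family `(A_u, B_u, C_u)_{u ∈ U}` in `Cyc_ℓ^w`, blocks
`⟨(ℓ−1)^{#1}, (ℓ−1)^{#2}, (ℓ−1)^{#3}⟩`).  Rows of composition `(p, q, p)` give blocks of the crux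
shape `⟨N₀, M₀, N₀⟩ = ⟨(ℓ−1)^p, (ℓ−1)^q, (ℓ−1)^p⟩`, i.e. the slice point
`(a₀, η₀) = (q/p, (w·log ℓ − log|U|)/(p·log(ℓ−1)) − 2)`. -/

section Designs

/-- `U₂ = {123, 231}` (width 3, composition `(1,1,1)`): CKSU 2005 Prop. 28's two-block design
`(H₁∖0, H₂∖0, H₃∖0), (H₂∖0, H₃∖0, H₁∖0)` in `Cyc_ℓ³` is Theorem 33 for this USP.
[cite: CohnKleinbergSzegedyUmans2005, Prop. 28 and Thm. 33] -/
def uspRow2 : Fin 2 → Fin 3 → Fin 3 := ![![0, 1, 2], ![1, 2, 0]]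

/-- `U₄` (width 7, composition `(3,1,3)`, the MAXIMUM size in this class — exhaustive search,
refuter g41-18 / this seat's `scratch/skewusp.py`): rows `2111333, 1213133, 1123313, 1113332`. -/
def uspRow4 : Fin 4 → Fin 7 → Fin 3 :=
  ![![1, 0, 0, 0, 2, 2, 2], ![0, 1, 0, 2, 0, 2, 2], ![0, 0, 1, 2, 2, 0, 2], ![0, 0, 0, 2, 2, 2, 1]]

/-- `U₉` (width 9, composition `(4,1,4)`, size 9 = the cap `2p+1` (the single `2`s of distinct
rows sit in distinct columns), hence MAXIMUM; found by this seat's exhaustive search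
`scratch/skew414.py`): rows `211113333, 121331133, 112333311, 133211313, 133123131, 313132113,
313311231, 331131321, 331313112`. -/
def uspRow9 : Fin 9 → Fin 9 → Fin 3 :=
  ![![1, 0, 0, 0, 0, 2, 2, 2, 2], ![0, 1, 0, 2, 2, 0, 0, 2, 2], ![0, 0, 1, 2, 2, 2, 2, 0, 0],
    ![0, 2, 2, 1, 0, 0, 2, 0, 2], ![0, 2, 2, 0, 1, 2, 0, 2, 0], ![2, 0, 2, 0, 2, 1, 0, 0, 2],
    ![2, 0, 2, 2, 0, 0, 1, 2, 0], ![2, 2, 0, 0, 2, 0, 2, 1, 0], ![2, 2, 0, 2, 0, 2, 0, 0, 1]]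

/-- Decidable reformulation of the local strong USP condition (pattern membership as the
boolean "exactly two of `a = 0`, `b = 1`, `c = 2`"). -/
theorem isLocalStrongUSP_iff_bool {k L : ℕ} (row : Fin L → Fin k → Fin 3) :
    IsLocalStrongUSP row ↔ ∀ a b c : Fin L, (a ≠ b ∨ b ≠ c) → ∃ i : Fin k,
      ((row a i = 0 ∧ row b i = 1 ∧ row c i ≠ 2) ∨ (row a i = 0 ∧ row b i ≠ 1 ∧ row c i = 2) ∨
        (row a i ≠ 0 ∧ row b i = 1 ∧ row c i = 2)) := by
  unfold IsLocalStrongUSP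
  simp only [mem_localStrongUSPPatterns_iff]

/-- `U₂` is a local strong USP (kernel `decide`). -/
theorem uspRow2_isLocalStrongUSP : IsLocalStrongUSP uspRow2 := by
  rw [isLocalStrongUSP_iff_bool]; decide

/-- `U₄` is a local strong USP (kernel `decide`). -/
theorem uspRow4_isLocalStrongUSP : IsLocalStrongUSP uspRow4 := by
  rw [isLocalStrongUSP_iff_bool]; decide

/-- `U₉` is a local strong USP (kernel `decide`, `9³·9` pattern checks). -/
theorem uspRow9_isLocalStrongUSP : IsLocalStrongUSP uspRow9 := by
  rw [isLocalStrongUSP_iff_bool]; decide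

end Designs


/-! ## The wedges -/

section Wedges

/-- `c^n ≤ x^q` (`x ≥ 0`, `n ≠ 0`) gives `c ≤ x^{q/n}`. [folklore] -/
theorem le_rpow_div_of_pow_le {c x : ℝ} (hx : 0 ≤ x) {n q : ℕ} (hn : n ≠ 0)
    (h : c ^ n ≤ x ^ q) : c ≤ x ^ ((q : ℝ) / n) := by
  have hn' : (n : ℝ) ≠ 0 := Nat.cast_ne_zero.2 hn
  have h1 : (x ^ ((q : ℝ) / n)) ^ n = x ^ q := by
    rw [← Real.rpow_natCast (x ^ ((q : ℝ) / n)) n, ← Real.rpow_mul hx, div_mul_cancel₀ _ hn',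
      Real.rpow_natCast]
  exact le_of_pow_le_pow_left₀ hn (by positivity) (h.trans_eq h1.symm)

/-- **Theorem 33 designs feed the rescaling lemma.**  A local strong USP of `Lu` rows of width
`w`, every row of composition `(p, q, p)` (`p` ones, `q` twos, `p` threes), gives in `Cyc_ℓ^w`
an STPP family of `Lu` blocks `⟨(ℓ−1)^p, (ℓ−1)^q, (ℓ−1)^p⟩` (tree: CKSU Thm 33 + counting);
if `ℓ^w ≤ Lu·((ℓ−1)^p)^{2+η₀}` this is a witness of the slice `(q/p, η₀)`, hence
(`thinSlice_of_design`) of every slice `(a, η)` with `0 < a ≤ q/p`, `η·q > η₀·a·p`.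
[new, elementary; cite: CohnKleinbergSzegedyUmans2005, Thm. 33] -/
theorem thinSlice_of_usp {Lu w : ℕ} {row : Fin Lu → Fin w → Fin 3} (hU : IsLocalStrongUSP row)
    {p q : ℕ} (hp0 : p ≠ 0) (hp : ∀ u, (univ.filter fun j => row u j = 0).card = p)
    (hq : ∀ u, (univ.filter fun j => row u j = 1).card = q)
    (hr : ∀ u, (univ.filter fun j => row u j = 2).card = p)
    {ℓ : ℕ} (hℓ : 3 ≤ ℓ) {η₀ : ℝ}
    (hnum : ((ℓ : ℝ)) ^ w ≤ Lu * ((((ℓ - 1) ^ p : ℕ) : ℝ)) ^ (2 + η₀))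
    {a η : ℝ} (ha : 0 < a) (haa : a * p ≤ q) (hη : 0 < η) (hw : η₀ * a * p < η * q) :
    ThinSlice a η := by
  haveI : NeZero ℓ := ⟨by omega⟩
  have hS : IsSTPP (uspA ℓ row) (uspB ℓ row) (uspC ℓ row) :=
    CohnKleinbergSzegedyUmans2005_thm33_holds ℓ w Lu row hU
  set X : ℕ := ℓ - 1 with hX
  have hX2 : 2 ≤ X := by omega
  have hc : ∀ u, (uspA ℓ row u).card = X ^ p ∧ (uspB ℓ row u).card = X ^ q ∧
      (uspC ℓ row u).card = X ^ p := fun u => by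
    rw [card_uspA, card_uspB, card_uspC, hp, hq, hr]; exact ⟨rfl, rfl, rfl⟩
  have hN : 2 ≤ X ^ p := hX2.trans (Nat.le_self_pow hp0 _)
  have hppos : (0 : ℝ) < p := by exact_mod_cast Nat.pos_of_ne_zero hp0
  have hpne : (p : ℝ) ≠ 0 := hppos.ne'
  have hx0 : (0 : ℝ) ≤ (X : ℝ) := Nat.cast_nonneg _
  have hM : (((X ^ p : ℕ) : ℝ)) ^ ((q : ℝ) / p) ≤ ((X ^ q : ℕ) : ℝ) := by
    push_cast
    rw [← Real.rpow_natCast (X : ℝ) p, ← Real.rpow_mul hx0, mul_comm, div_mul_cancel₀ _ hpne,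
      Real.rpow_natCast]
  have hH : (Fintype.card (Fin w → ZMod ℓ) : ℝ) ≤ Lu * (((X ^ p : ℕ) : ℝ)) ^ (2 + η₀) := by
    rw [Fintype.card_fun, Fintype.card_fin, ZMod.card]
    push_cast
    have := hnum
    push_cast at this
    exact this
  have haa' : a ≤ (q : ℝ) / p := by rw [le_div_iff₀ hppos]; exact haa
  have hw' : η₀ * a < η * ((q : ℝ) / p) := by
    rw [← mul_div_assoc, lt_div_iff₀ hppos]; exact hw
  exact thinSlice_of_design hS hc hN hM hH ha haa' hη hw'

/-- **Wedge A** — the square design `U₂` in `Cyc₁₆³` (`2` blocks `⟨15,15,15⟩`, `|H| = 4096 =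
2·15²·(2048/225)`, `15^{9/11} > 2048/225`): every slice with `0 < a ≤ 1`, `η > (9/11)·a` holds.
[new] -/
theorem thinSlice_wedge_one {a η : ℝ} (ha : 0 < a) (ha1 : a ≤ 1) (hη : 0 < η)
    (h : 9 * a < 11 * η) : ThinSlice a η := by
  refine thinSlice_of_usp uspRow2_isLocalStrongUSP (p := 1) (q := 1) one_ne_zero (by decide)
    (by decide) (by decide) (ℓ := 16) (by norm_num) (η₀ := 9 / 11) ?_ ha (by push_cast; linarith)
    hη (by push_cast; linarith)
  have hc : (2048 / 225 : ℝ) ≤ (15 : ℝ) ^ (((9 : ℕ) : ℝ) / (11 : ℕ)) :=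
    le_rpow_div_of_pow_le (by norm_num) (by norm_num) (by norm_num)
  have hsplit : (15 : ℝ) ^ (31 / 11 : ℝ) = 15 ^ (2 : ℝ) * 15 ^ (((9 : ℕ) : ℝ) / (11 : ℕ)) := by
    rw [← Real.rpow_add (by norm_num)]; norm_num
  norm_num
  rw [hsplit, Real.rpow_two]
  nlinarith

/-- **Wedge B** — the skew design `U₄` in `Cyc₂₁⁷` (`4` blocks `⟨8000, 20, 8000⟩`, `a₀ = 1/3`,
`|H| = 21⁷ ≤ 4·8000²·8000^{2/9}`): every slice with `0 < a ≤ 1/3`, `η > (2/3)·a` holds. [new] -/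
theorem thinSlice_wedge_third {a η : ℝ} (ha : 0 < a) (ha1 : a ≤ 1 / 3) (hη : 0 < η)
    (h : 2 * a < 3 * η) : ThinSlice a η := by
  refine thinSlice_of_usp uspRow4_isLocalStrongUSP (p := 3) (q := 1) (by norm_num) (by decide)
    (by decide) (by decide) (ℓ := 21) (by norm_num) (η₀ := 2 / 9) ?_ ha (by push_cast; linarith)
    hη (by push_cast; linarith)
  have hc : (1801088541 / 256000000 : ℝ) ≤ (8000 : ℝ) ^ (((2 : ℕ) : ℝ) / (9 : ℕ)) :=
    le_rpow_div_of_pow_le (by norm_num) (by norm_num) (by norm_num)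
  have hsplit : (8000 : ℝ) ^ (20 / 9 : ℝ) = 8000 ^ (2 : ℝ) * 8000 ^ (((2 : ℕ) : ℝ) / (9 : ℕ)) := by
    rw [← Real.rpow_add (by norm_num)]; norm_num
  norm_num
  rw [hsplit, Real.rpow_two]
  nlinarith

/-- **Wedge C** — the maximum skew design `U₉` in `Cyc₁₆⁹` (`9` blocks `⟨50625, 15, 50625⟩`,
`a₀ = 1/4`, `|H| = 16⁹ ≤ 9·15⁸·15^{5/12}`; exact best `η₀ = 0.1007`, ratio `0.403`): every slice
with `0 < a ≤ 1/4`, `η > (5/12)·a` holds. [new] -/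
theorem thinSlice_wedge_quarter {a η : ℝ} (ha : 0 < a) (ha1 : a ≤ 1 / 4) (hη : 0 < η)
    (h : 5 * a < 12 * η) : ThinSlice a η := by
  refine thinSlice_of_usp uspRow9_isLocalStrongUSP (p := 4) (q := 1) (by norm_num) (by decide)
    (by decide) (by decide) (ℓ := 16) (by norm_num) (η₀ := 5 / 48) ?_ ha (by push_cast; linarith)
    hη (by push_cast; linarith)
  have hc : (68719476736 / 23066015625 : ℝ) ≤ (50625 : ℝ) ^ (((5 : ℕ) : ℝ) / (48 : ℕ)) :=
    le_rpow_div_of_pow_le (by norm_num) (by norm_num) (by norm_num)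
  have hsplit : (50625 : ℝ) ^ (101 / 48 : ℝ) =
      50625 ^ (2 : ℝ) * 50625 ^ (((5 : ℕ) : ℝ) / (48 : ℕ)) := by
    rw [← Real.rpow_add (by norm_num)]; norm_num
  norm_num
  rw [hsplit, Real.rpow_two]
  nlinarith

/-- **The known TRUE part of the crux matrix (kernel-checked), cycle 3.**  For `0 ≤ a < 1`,
`η > 0`: the slice `(a, η)` holds whenever `9a < 11η`, or `a ≤ 1/3 ∧ 2a < 3η`, or
`a ≤ 1/4 ∧ 5a < 12η` (and at `a = 0` for every `η`).  The diagonal `η = a` of the single split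
block (§8 `thin_slice_of_lt`, `no_single_thin_block`) is nowhere the frontier. [new] -/
theorem thinSlice_of_wedge {a η : ℝ} (ha : 0 ≤ a) (ha1 : a < 1) (hη : 0 < η)
    (h : 9 * a < 11 * η ∨ (a ≤ 1 / 3 ∧ 2 * a < 3 * η) ∨ (a ≤ 1 / 4 ∧ 5 * a < 12 * η)) :
    ThinSlice a η := by
  rcases ha.eq_or_lt with rfl | ha0
  · exact thin_slice_of_lt le_rfl hη
  rcases h with h | ⟨h1, h2⟩ | ⟨h1, h2⟩
  · exact thinSlice_wedge_one ha0 ha1.le hη h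
  · exact thinSlice_wedge_third ha0 h1 hη h2
  · exact thinSlice_wedge_quarter ha0 h1 hη h2

/-- S5 — the **diagonal barrier**: "below the diagonal `η < a` there is no thin near-tight
family at all" (what single blocks, coordinate / sign-coherent frames and random label
selections suggest: each of those design classes is capped at `η ≥ a − o(1)`). -/
def ThinPackingsDiagonalBarrier : Prop :=
  ∀ a η : ℝ, 0 < a → a < 1 → 0 < η → η < a → ¬ ThinSlice a η

/-- **The diagonal barrier is FALSE**: the slice `(1/4, 0.11)` holds (Wedge C), as does every
`(a, η)` with `η > 5a/12`, `a ≤ 1/4`.  So no proof of `¬ ThinPackings` can consist of an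
argument that is blind to the number of blocks beyond the single-block volume bound, and the
frontier a new design must beat at `a ≤ 1/4` is `≤ 5a/12`, not `η = a`. [new] -/
theorem not_thinPackingsDiagonalBarrier : ¬ ThinPackingsDiagonalBarrier := fun h =>
  h (1 / 4) (11 / 100) (by norm_num) (by norm_num) (by norm_num) (by norm_num)
    (thinSlice_wedge_quarter (by norm_num) le_rfl (by norm_num) (by norm_num))

end Wedges


/-! ## No linear barrier: `η*(a)/a → 0` as `a → 0` (cycle 3)

An explicit infinite family of skew local strong USPs with ONE `2` per row: `n` rows of width
`4n+1`, composition `(2n, 1, 2n)`.  Columns: `∞` and the `4n` columns `((j, c), b)`,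
`j ∈ Fin n`, `c ∈ Fin 2`, `b ∈ Bool`; row `r` is `2` at `∞`, `(0, 1)` resp. on the special pair
`(r, 0)` (`b = false / true`), and on every other pair `(j, c)` it is `0` at the column
`b = [r ≤ j]` and `2` at the other one (a threshold sign pattern).  Rows `r < t` are separated,
for every third row `s`, by the column `((r,1), true)` (values `0, 2` and `≠ 1`), rows `r > t`
by `((t,1), false)`; and row `s` shows its `1` at `((s,0), true)` where every other row is `0/2`.
Through CKSU Theorem 33 at `ℓ = 4n + 2` this is a witness of the slice `(1/(2n), ρ/(2n))` as
soon as `(4n+1)^ρ ≥ 15`, so (`thinSlice_of_design`) every slice `η > ρ·a`, `a ≤ 1/(2n)` holds: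
`η*(a) ≤ ρ a` for small `a`, for EVERY `ρ > 0`.  Hence no barrier of the form `η ≥ c·a`
(`not_thinPackingsLinearBarrier`); with §9's convexity, `η*(a)/a ↓ 0`. -/

section LinearBarrier

/-- Every element of `Fin 3` is `0`, `1` or `2`. [folklore] -/
theorem fin3_cases' (x : Fin 3) : x = 0 ∨ x = 1 ∨ x = 2 := by
  revert x; decide

/-- **Sufficient condition for a local strong USP** (separating columns): if for all rows
`r ≠ t` and every row `s` some column reads `(0, ·, 2)` on `(r, s, t)` with the middle entry
`≠ 1`, and every row `s` has a column where it is `1` and a given other row is not, then the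
family is a local strong USP. [new, elementary] -/
theorem isLocalStrongUSP_of_separators {k L : ℕ} (row : Fin L → Fin k → Fin 3)
    (hA : ∀ r t s : Fin L, r ≠ t → ∃ i, row r i = 0 ∧ row t i = 2 ∧ row s i ≠ 1)
    (hC : ∀ r s : Fin L, r ≠ s → ∃ i, row s i = 1 ∧ row r i ≠ 1) :
    IsLocalStrongUSP row := by
  rw [isLocalStrongUSP_iff_bool]
  intro a b c habc
  by_cases hac : a = c
  · subst hac
    have hab : a ≠ b := by tauto
    obtain ⟨i, h1, h2⟩ := hC a b hab
    refine ⟨i, ?_⟩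
    rcases fin3_cases' (row a i) with h | h | h
    · exact Or.inl ⟨h, h1, by rw [h]; decide⟩
    · exact absurd h h2
    · exact Or.inr (Or.inr ⟨by rw [h]; decide, h1, h⟩)
  · obtain ⟨i, h1, h2, h3⟩ := hA a c b hac
    exact ⟨i, Or.inr (Or.inl ⟨h1, h3, h2⟩)⟩

/-- Column type of the family: `∞` plus pairs `(j, c) ∈ Fin n × Fin 2` doubled by `Bool`. -/
abbrev LCol (n : ℕ) := Option ((Fin n × Fin 2) × Bool)

theorem card_lCol (n : ℕ) : Fintype.card (LCol n) = 4 * n + 1 := by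
  simp only [LCol, Fintype.card_option, Fintype.card_prod, Fintype.card_fin, Fintype.card_bool]
  ring

/-- The rows on the structured column type. -/
def lrowF (n : ℕ) (r : Fin n) : LCol n → Fin 3
  | none => 2
  | some (jc, b) =>
      if jc = (r, 0) then (if b then 1 else 0) else (if (b = true ↔ r ≤ jc.1) then 0 else 2)

/-- Transport of the columns to `Fin (4n+1)`. -/
noncomputable def lcolEquiv (n : ℕ) : LCol n ≃ Fin (4 * n + 1) :=
  Fintype.equivFinOfCardEq (card_lCol n)

/-- **The skew USP family** `U(n)`: `n` rows of width `4n+1`, composition `(2n, 1, 2n)`. -/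
noncomputable def lrow (n : ℕ) (r : Fin n) (i : Fin (4 * n + 1)) : Fin 3 :=
  lrowF n r ((lcolEquiv n).symm i)

theorem lrowF_special_true (n : ℕ) (s : Fin n) : lrowF n s (some ((s, 0), true)) = 1 := by
  simp [lrowF]

theorem lrowF_ne_one_of_ne {n : ℕ} {r : Fin n} {jc : Fin n × Fin 2} (h : jc ≠ (r, 0)) (b : Bool) :
    lrowF n r (some (jc, b)) ≠ 1 := by
  simp only [lrowF, h, if_false]
  split_ifs <;> decide

/-- `U(n)` is a local strong USP. [new] -/
theorem lrow_isLocalStrongUSP (n : ℕ) : IsLocalStrongUSP (lrow n) := by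
  apply isLocalStrongUSP_of_separators
  · intro r t s hrt
    rcases lt_or_gt_of_ne hrt with hlt | hgt
    · -- column `((r,1), true)`
      refine ⟨lcolEquiv n (some ((r, 1), true)), ?_, ?_, ?_⟩ <;>
        simp only [lrow, Equiv.symm_apply_apply]
      · have h : ((r, (1 : Fin 2)) : Fin n × Fin 2) ≠ (r, 0) := by simp
        simp [lrowF, h]
      · have h : ((r, (1 : Fin 2)) : Fin n × Fin 2) ≠ (t, 0) := by simp
        simp [lrowF, h, not_le.2 hlt]
      · exact lrowF_ne_one_of_ne (by simp) _
    · -- column `((t,1), false)`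
      refine ⟨lcolEquiv n (some ((t, 1), false)), ?_, ?_, ?_⟩ <;>
        simp only [lrow, Equiv.symm_apply_apply]
      · have h : ((t, (1 : Fin 2)) : Fin n × Fin 2) ≠ (r, 0) := by simp
        simp [lrowF, h, not_le.2 hgt]
      · have h : ((t, (1 : Fin 2)) : Fin n × Fin 2) ≠ (t, 0) := by simp
        simp [lrowF, h]
      · exact lrowF_ne_one_of_ne (by simp) _
  · intro r s hrs
    refine ⟨lcolEquiv n (some ((s, 0), true)), ?_, ?_⟩ <;>
      simp only [lrow, Equiv.symm_apply_apply]
    · exact lrowF_special_true n s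
    · exact lrowF_ne_one_of_ne (by intro h; exact hrs (Prod.mk.inj h).1.symm) _

/-! ### Composition counts of `U(n)`: `(2n, 1, 2n)` -/

/-- Which column of the pair `jc` carries the `0` of row `r`. -/
def zsel (n : ℕ) (r : Fin n) (jc : Fin n × Fin 2) : Bool :=
  if jc = (r, 0) then false else decide (r ≤ jc.1)

theorem lrowF_some_eq_zero_iff (n : ℕ) (r : Fin n) (jc : Fin n × Fin 2) (b : Bool) :
    lrowF n r (some (jc, b)) = 0 ↔ b = zsel n r jc := by
  by_cases h : jc = (r, 0)
  · subst h; cases b <;> simp [lrowF, zsel]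
  · cases b <;> by_cases hle : r ≤ jc.1 <;> simp [lrowF, zsel, h, hle]

theorem lrowF_some_eq_two_iff (n : ℕ) (r : Fin n) (jc : Fin n × Fin 2) (b : Bool) :
    lrowF n r (some (jc, b)) = 2 ↔ jc ≠ (r, 0) ∧ b = !zsel n r jc := by
  by_cases h : jc = (r, 0)
  · subst h; cases b <;> simp [lrowF]
  · cases b <;> by_cases hle : r ≤ jc.1 <;> simp [lrowF, zsel, h, hle]

theorem lrowF_some_eq_one_iff (n : ℕ) (r : Fin n) (jc : Fin n × Fin 2) (b : Bool) :
    lrowF n r (some (jc, b)) = 1 ↔ jc = (r, 0) ∧ b = true := by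
  by_cases h : jc = (r, 0)
  · subst h; cases b <;> simp [lrowF]
  · cases b <;> by_cases hle : r ≤ jc.1 <;> simp [lrowF, h, hle]

theorem lrowF_none (n : ℕ) (r : Fin n) : lrowF n r none = 2 := rfl

theorem card_lrowF_zero (n : ℕ) (r : Fin n) :
    (univ.filter fun x => lrowF n r x = 0).card = 2 * n := by
  have hset : (univ.filter fun x => lrowF n r x = 0) =
      univ.image fun jc : Fin n × Fin 2 => (some (jc, zsel n r jc) : LCol n) := by
    ext x
    simp only [mem_filter, mem_univ, true_and, mem_image]
    cases x with
    | none => simp [lrowF_none]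
    | some p =>
      obtain ⟨jc, b⟩ := p
      rw [lrowF_some_eq_zero_iff]
      constructor
      · rintro rfl; exact ⟨jc, rfl⟩
      · rintro ⟨jc', h⟩
        simp only [Option.some.injEq, Prod.mk.injEq] at h
        obtain ⟨rfl, rfl⟩ := h; rfl
  rw [hset, card_image_of_injective _ (by
      intro a b h; simp only [Option.some.injEq, Prod.mk.injEq] at h; exact h.1), card_univ,
    Fintype.card_prod, Fintype.card_fin, Fintype.card_fin]
  ring

theorem card_lrowF_two (n : ℕ) (r : Fin n) :
    (univ.filter fun x => lrowF n r x = 2).card = 2 * n := by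
  have hn : 1 ≤ n := Nat.succ_le_of_lt r.pos
  have hset : (univ.filter fun x => lrowF n r x = 2) =
      insert none ((univ.erase (r, 0)).image
        fun jc : Fin n × Fin 2 => (some (jc, !zsel n r jc) : LCol n)) := by
    ext x
    simp only [mem_filter, mem_univ, true_and, mem_insert, mem_image, mem_erase, ne_eq]
    cases x with
    | none => simp [lrowF_none]
    | some p =>
      obtain ⟨jc, b⟩ := p
      rw [lrowF_some_eq_two_iff]
      constructor
      · rintro ⟨hjc, rfl⟩; exact Or.inr ⟨jc, ⟨hjc, trivial⟩, rfl⟩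
      · rintro (h | ⟨jc', ⟨hjc', -⟩, h⟩)
        · exact absurd h (by simp)
        · simp only [Option.some.injEq, Prod.mk.injEq] at h
          obtain ⟨rfl, rfl⟩ := h; exact ⟨hjc', rfl⟩
  have hnot : (none : LCol n) ∉ (univ.erase (r, 0)).image
      fun jc : Fin n × Fin 2 => (some (jc, !zsel n r jc) : LCol n) := by
    simp
  rw [hset, card_insert_of_notMem hnot, card_image_of_injective _ (by
      intro a b h; simp only [Option.some.injEq, Prod.mk.injEq] at h; exact h.1),
    card_erase_of_mem (mem_univ _), card_univ, Fintype.card_prod, Fintype.card_fin,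
    Fintype.card_fin]
  omega

theorem card_lrowF_one (n : ℕ) (r : Fin n) :
    (univ.filter fun x => lrowF n r x = 1).card = 1 := by
  have hset : (univ.filter fun x => lrowF n r x = 1) = {(some ((r, 0), true) : LCol n)} := by
    ext x
    simp only [mem_filter, mem_univ, true_and, mem_singleton]
    cases x with
    | none => simp [lrowF_none]
    | some p =>
      obtain ⟨jc, b⟩ := p
      rw [lrowF_some_eq_one_iff]
      constructor
      · rintro ⟨rfl, rfl⟩; rfl
      · intro h
        simp only [Option.some.injEq, Prod.mk.injEq] at h
        exact ⟨h.1, h.2⟩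
  rw [hset, card_singleton]

/-- Counts transport along `lcolEquiv`. -/
theorem card_filter_lrow (n : ℕ) (r : Fin n) (v : Fin 3) :
    (univ.filter fun i => lrow n r i = v).card = (univ.filter fun x => lrowF n r x = v).card := by
  refine Finset.card_equiv (lcolEquiv n).symm fun i => ?_
  simp [lrow]

/-- **The design point of `U(n)`** (CKSU Thm 33 at `ℓ = 4n+2`): if `(4n+1)^ρ ≥ 15` then every
slice `(a, η)` with `0 < a ≤ 1/(2n)` and `η > ρ·a` holds. [new] -/
theorem thinSlice_of_lrow {n : ℕ} (hn : 1 ≤ n) {ρ : ℝ} (h15 : (15 : ℝ) ≤ ((4 * n + 1 : ℕ) : ℝ) ^ ρ)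
    {a η : ℝ} (ha : 0 < a) (haa : a * (2 * n) ≤ 1) (hη : 0 < η) (hw : ρ * a < η) :
    ThinSlice a η := by
  have hn0 : (n : ℝ) ≠ 0 := by exact_mod_cast (by omega : n ≠ 0)
  have h2n : (0 : ℝ) < 2 * n := by positivity
  refine thinSlice_of_usp (lrow_isLocalStrongUSP n) (p := 2 * n) (q := 1) (by omega)
    (fun u => by rw [card_filter_lrow, card_lrowF_zero])
    (fun u => by rw [card_filter_lrow, card_lrowF_one])
    (fun u => by rw [card_filter_lrow, card_lrowF_two]) (ℓ := 4 * n + 2) (by omega)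
    (η₀ := ρ / (2 * n)) ?_ ha (by push_cast; linarith) hη ?_
  swap
  · push_cast
    rw [div_mul_eq_mul_div, div_mul_cancel₀ _ h2n.ne', mul_one]
    exact hw
  -- the host count `(4n+2)^{4n+1} ≤ n · ((4n+1)^{2n})^{2 + ρ/(2n)}`
  have hsub : 4 * n + 2 - 1 = 4 * n + 1 := by omega
  rw [hsub]
  have h15' := h15
  push_cast at h15' ⊢
  set P : ℝ := 4 * (n : ℝ) + 1 with hP
  have hPpos : 0 < P := by rw [hP]; positivity
  have hP1 : (4 * (n : ℝ) + 2) = P + 1 := by rw [hP]; ring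
  -- `(P+1)^{4n+1} ≤ 3 · P^{4n+1}`
  have hexp : (1 + 1 / P) ^ (4 * n + 1) ≤ 3 := by
    have h1 : 1 + 1 / P ≤ Real.exp (1 / P) := by
      have := Real.add_one_le_exp (1 / P); linarith
    have h2 : (1 + 1 / P) ^ (4 * n + 1) ≤ Real.exp (1 / P) ^ (4 * n + 1) :=
      pow_le_pow_left₀ (by positivity) h1 _
    have h3 : Real.exp (1 / P) ^ (4 * n + 1) = Real.exp 1 := by
      rw [← Real.exp_nat_mul]; congr 1; rw [hP]; push_cast; field_simp
    have h4 : Real.exp 1 < 3 := lt_trans Real.exp_one_lt_d9 (by norm_num)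
    rw [h3] at h2; linarith
  have hL : (P + 1) ^ (4 * n + 1) ≤ 3 * P ^ (4 * n + 1) := by
    have : (P + 1) ^ (4 * n + 1) = P ^ (4 * n + 1) * (1 + 1 / P) ^ (4 * n + 1) := by
      rw [← mul_pow]; congr 1; field_simp
    rw [this]
    calc P ^ (4 * n + 1) * (1 + 1 / P) ^ (4 * n + 1) ≤ P ^ (4 * n + 1) * 3 := by gcongr
      _ = 3 * P ^ (4 * n + 1) := by ring
  -- the right-hand side is `n · P^{4n} · P^ρ`
  have hA : (P ^ (2 * n)) ^ (ρ / (2 * n)) = P ^ ρ := by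
    rw [← Real.rpow_natCast P (2 * n), ← Real.rpow_mul hPpos.le]
    congr 1; push_cast; field_simp
  have hB : (P ^ (2 * n)) ^ (2 + ρ / (2 * n)) = P ^ (4 * n) * P ^ ρ := by
    rw [Real.rpow_add (by positivity), hA, Real.rpow_two, ← pow_mul,
      show 2 * n * 2 = 4 * n by ring]
  have hn1 : (1 : ℝ) ≤ n := by exact_mod_cast hn
  have h3P : 3 * P ≤ 15 * n := by rw [hP]; linarith
  rw [hP1, hB]
  calc (P + 1) ^ (4 * n + 1) ≤ 3 * P ^ (4 * n + 1) := hL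
    _ = (3 * P) * P ^ (4 * n) := by ring
    _ ≤ (15 * n) * P ^ (4 * n) := by gcongr
    _ = n * (P ^ (4 * n) * 15) := by ring
    _ ≤ n * (P ^ (4 * n) * P ^ ρ) := by gcongr

/-- **`η*(a)/a → 0`**: for every `ρ > 0` all sufficiently thin shapes admit slack `η > ρ·a`.
[new] -/
theorem thinSlice_small_shape {ρ : ℝ} (hρ : 0 < ρ) :
    ∃ a₁ : ℝ, 0 < a₁ ∧ ∀ a η : ℝ, 0 < a → a ≤ a₁ → ρ * a < η → ThinSlice a η := by
  set n : ℕ := max 1 ⌈(15 : ℝ) ^ (1 / ρ)⌉₊ with hn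
  have hn1 : 1 ≤ n := le_max_left _ _
  have hnR : (15 : ℝ) ^ (1 / ρ) ≤ n := by
    calc (15 : ℝ) ^ (1 / ρ) ≤ ⌈(15 : ℝ) ^ (1 / ρ)⌉₊ := Nat.le_ceil _
      _ ≤ n := by exact_mod_cast le_max_right _ _
  have h15 : (15 : ℝ) ≤ ((4 * n + 1 : ℕ) : ℝ) ^ ρ := by
    have h1 : (n : ℝ) ≤ ((4 * n + 1 : ℕ) : ℝ) := by push_cast; linarith
    calc (15 : ℝ) = ((15 : ℝ) ^ (1 / ρ)) ^ ρ := by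
          rw [← Real.rpow_mul (by norm_num), one_div, inv_mul_cancel₀ hρ.ne', Real.rpow_one]
      _ ≤ (n : ℝ) ^ ρ := Real.rpow_le_rpow (by positivity) hnR hρ.le
      _ ≤ ((4 * n + 1 : ℕ) : ℝ) ^ ρ := Real.rpow_le_rpow (by positivity) h1 hρ.le
  have h2n : (0 : ℝ) < 2 * n := by positivity
  refine ⟨1 / (2 * n), by positivity, fun a η ha ha1 hw => ?_⟩
  have hη : 0 < η := lt_trans (by positivity) hw
  exact thinSlice_of_lrow hn1 h15 ha (by rwa [le_div_iff₀ h2n] at ha1) hη hw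

/-- S6 — the **linear barrier**: some `c > 0` with `η ≥ c·a` for every true slice (a
"rectangular Theorem B for all abelian groups" with linear rate). -/
def ThinPackingsLinearBarrier : Prop :=
  ∃ c : ℝ, 0 < c ∧ ∀ a η : ℝ, 0 < a → a < 1 → 0 < η → ThinSlice a η → c * a ≤ η

/-- **No linear barrier.** [new] -/
theorem not_thinPackingsLinearBarrier : ¬ ThinPackingsLinearBarrier := by
  rintro ⟨c, hc, h⟩
  obtain ⟨a₁, ha₁, hs⟩ := thinSlice_small_shape (half_pos hc)
  set a : ℝ := min a₁ (1 / 2) with ha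
  have ha0 : 0 < a := lt_min ha₁ (by norm_num)
  have haa : a ≤ a₁ := min_le_left _ _
  have ha12 : a < 1 := lt_of_le_of_lt (min_le_right _ _) (by norm_num)
  have hslice := hs a (3 * c / 4 * a) ha0 haa (by nlinarith)
  have := h a (3 * c / 4 * a) ha0 ha12 (by positivity) hslice
  nlinarith

end LinearBarrier


end TrueWedge

/-! ## §4 Targets: the lead's registered stubs (cycle 3)

Skeleton `Lines/label-weighted-stpp-debordering.lean` (lead's reshape v2): four stubs.  The three
TOOL stubs `stub_deborderingPower`, `stub_boxFreiman`, `stub_gradedFrames` are TRUE (drefute seat: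
sorry-free proofs attached as evidence) — nothing to attack.  The DESIGN stub
`stub_multiRadiusFrames` (`MultiRadiusFrameDesigns`) implies the crux (skeleton `ThinPackings_of`),
so it is `≥ X_C`-hard to prove and its refutation would need a frame-specific invariant; the cheap
arsenal gives only NECESSARY CONDITIONS, made theorems here from three of its clauses (tile
packing, box, host count): `frames_tiles_le_box` (`L·N² ≤ (4b+1)^D`) and
`frames_slack_lower_bound` (`(6b+1)^D ≤ (4b+1)^D·N^η`, `b ≥ 1`, `(7/5)^D ≤ N^η`): the slack of a
box design is EXPONENTIAL IN THE DIMENSION, so `N` must be super-exponential in `D` as `η → 0`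
(with `N ≤ (2b+1)^D`: `b ≥ ½((7/5)^{1/η} − 1)`), and by §9 the design is news only below the
wedge (`η < 5a/12` at `a ≤ 1/4`), where drefute's coordinate calibration (`η ≈ a`) is dominated
by CKSU's own 2005 designs.  No stuck stubs registered (payload `stuck_stubs = []`).
LANDING: Negative/MultiRadiusFramesNecessary.lean (cycle 3). -/

section Targets


/-- **Tiles live in the doubled box.**  Frame-stub clauses (tile packing + box) force
`L·N² ≤ (4b+1)^D`. [new, elementary] -/
theorem frames_tiles_le_box {D L b N : ℕ} {A C : Fin L → Finset (Fin D → ℤ)}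
    (hpack : ∀ i k, ∀ a ∈ A i, ∀ c ∈ C i, ∀ a' ∈ A k, ∀ c' ∈ C k,
      c - a = c' - a' → i = k ∧ a = a' ∧ c = c')
    (hboxA : ∀ i, ∀ v ∈ A i, ∀ t, |v t| ≤ (b : ℤ)) (hboxC : ∀ i, ∀ v ∈ C i, ∀ t, |v t| ≤ (b : ℤ))
    (hcA : ∀ i, (A i).card = N) (hcC : ∀ i, (C i).card = N) :
    L * N ^ 2 ≤ (4 * b + 1) ^ D := by
  classical
  set S : Finset (Σ _ : Fin L, (Fin D → ℤ) × (Fin D → ℤ)) := univ.sigma fun i => A i ×ˢ C i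
    with hS
  set Box : Finset (Fin D → ℤ) := Fintype.piFinset fun _ => Icc (-(2 * b : ℤ)) (2 * b) with hBox
  set f : (Σ _ : Fin L, (Fin D → ℤ) × (Fin D → ℤ)) → (Fin D → ℤ) := fun x => x.2.2 - x.2.1 with hf
  have hcardS : S.card = L * N ^ 2 := by
    rw [hS, card_sigma]
    simp only [card_product, hcA, hcC, sum_const, card_univ, Fintype.card_fin, smul_eq_mul]
    ring
  have hinj : Set.InjOn f ↑S := by
    rintro ⟨i, a, c⟩ hx ⟨k, a', c'⟩ hy he
    simp only [hS, coe_sigma, Set.mem_sigma_iff, coe_univ, Set.mem_univ, true_and, coe_product,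
      Set.mem_prod, mem_coe] at hx hy
    change c - a = c' - a' at he
    obtain ⟨rfl, rfl, rfl⟩ := hpack i k a hx.1 c hx.2 a' hy.1 c' hy.2 he
    rfl
  have himg : S.image f ⊆ Box := by
    intro v hv
    rw [mem_image] at hv
    obtain ⟨⟨i, a, c⟩, hx, rfl⟩ := hv
    simp only [hS, mem_sigma, mem_univ, true_and, mem_product] at hx
    rw [hBox, Fintype.mem_piFinset]
    intro t
    have ha := hboxA i a hx.1 t
    have hc := hboxC i c hx.2 t
    rw [abs_le] at ha hc
    simp only [hf, Pi.sub_apply, mem_Icc]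
    constructor <;> linarith [ha.1, ha.2, hc.1, hc.2]
  have hcardBox : Box.card = (4 * b + 1) ^ D := by
    rw [hBox, Fintype.card_piFinset, prod_const, card_univ, Fintype.card_fin, Int.card_Icc]
    congr 1
    omega
  calc L * N ^ 2 = S.card := hcardS.symm
    _ = (S.image f).card := (card_image_of_injOn hinj).symm
    _ ≤ Box.card := card_le_card himg
    _ = (4 * b + 1) ^ D := hcardBox

/-- **Slack is exponential in the dimension.**  With the host count `(6b+1)^D ≤ L·N^{2+η}` of
the stub added: `(6b+1)^D ≤ (4b+1)^D · N^η`, `b ≥ 1`, and `(7/5)^D ≤ N^η`. [new, elementary] -/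
theorem frames_slack_lower_bound {D L b N : ℕ} {A C : Fin L → Finset (Fin D → ℤ)} {η : ℝ}
    (hpack : ∀ i k, ∀ a ∈ A i, ∀ c ∈ C i, ∀ a' ∈ A k, ∀ c' ∈ C k,
      c - a = c' - a' → i = k ∧ a = a' ∧ c = c')
    (hboxA : ∀ i, ∀ v ∈ A i, ∀ t, |v t| ≤ (b : ℤ)) (hboxC : ∀ i, ∀ v ∈ C i, ∀ t, |v t| ≤ (b : ℤ))
    (hcA : ∀ i, (A i).card = N) (hcC : ∀ i, (C i).card = N) (hN : 2 ≤ N)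
    (hhost : (((6 * b + 1 : ℕ) : ℝ)) ^ D ≤ L * (N : ℝ) ^ (2 + η)) :
    (((6 * b + 1 : ℕ) : ℝ)) ^ D ≤ (((4 * b + 1 : ℕ) : ℝ)) ^ D * (N : ℝ) ^ η ∧ 1 ≤ b ∧
      ((7 : ℝ) / 5) ^ D ≤ (N : ℝ) ^ η := by
  have htiles := frames_tiles_le_box hpack hboxA hboxC hcA hcC
  have hNpos : (0 : ℝ) < N := by exact_mod_cast (by omega : 0 < N)
  have htilesR : (L : ℝ) * (N : ℝ) ^ 2 ≤ (((4 * b + 1 : ℕ) : ℝ)) ^ D := by exact_mod_cast htiles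
  have h1 : (((6 * b + 1 : ℕ) : ℝ)) ^ D ≤ (((4 * b + 1 : ℕ) : ℝ)) ^ D * (N : ℝ) ^ η := by
    calc (((6 * b + 1 : ℕ) : ℝ)) ^ D ≤ L * (N : ℝ) ^ (2 + η) := hhost
      _ = (L * (N : ℝ) ^ 2) * (N : ℝ) ^ η := by
          rw [Real.rpow_add hNpos, Real.rpow_two]; ring
      _ ≤ (((4 * b + 1 : ℕ) : ℝ)) ^ D * (N : ℝ) ^ η := by gcongr
  -- `b ≥ 1`: in the box `[0,0]^D` a leg has at most one point
  have hb : 1 ≤ b := by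
    by_contra hb0
    have hb0 : b = 0 := by omega
    subst hb0
    -- L ≥ 1 from the host inequality, then L N² ≤ 1 contradicts N ≥ 2
    have hL : 1 ≤ L := by
      by_contra hL0
      have hL0 : L = 0 := by omega
      rw [hL0, Nat.cast_zero, zero_mul] at hhost
      have : (0 : ℝ) < (((6 * 0 + 1 : ℕ) : ℝ)) ^ D := by positivity
      linarith
    have h4 : 1 * 2 ^ 2 ≤ L * N ^ 2 := Nat.mul_le_mul hL (Nat.pow_le_pow_left hN 2)
    have h5 : (4 * 0 + 1) ^ D = 1 := by simp
    omega
  refine ⟨h1, hb, ?_⟩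
  -- `(7/5)^D ≤ ((6b+1)/(4b+1))^D ≤ N^η`
  have h45pos : (0 : ℝ) < (((4 * b + 1 : ℕ) : ℝ)) ^ D := by positivity
  have hratio : (7 : ℝ) / 5 ≤ ((6 * b + 1 : ℕ) : ℝ) / ((4 * b + 1 : ℕ) : ℝ) := by
    rw [div_le_div_iff₀ (by norm_num) (by positivity)]
    push_cast
    have : (1 : ℝ) ≤ b := by exact_mod_cast hb
    nlinarith
  calc ((7 : ℝ) / 5) ^ D ≤ (((6 * b + 1 : ℕ) : ℝ) / ((4 * b + 1 : ℕ) : ℝ)) ^ D :=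
        pow_le_pow_left₀ (by norm_num) hratio D
    _ = (((6 * b + 1 : ℕ) : ℝ)) ^ D / (((4 * b + 1 : ℕ) : ℝ)) ^ D := div_pow _ _ _
    _ ≤ (N : ℝ) ^ η := by rw [div_le_iff₀ h45pos]; linarith [h1]


end Targets


/-! ## §5 Why the crux resists; reductions; attacks tried

STATUS AFTER CYCLE 3 (short): unchanged verdict — the crux is `X_C` in costume (§7), open in
print; NEW is the calibration of §9: the true region reaches far below the diagonal
(`η > 5a/12` at `a ≤ 1/4`, `η > 9a/11` everywhere, `η > ρ a` for `a ≤ a₁(ρ)` for EVERY `ρ > 0`,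
kernel; `η > 0.41a` in print), the frontier `η*` is convex with `η*(0) = 0`, `η*(a) = o(a)`, and
the crux is `η*(1) = 0`; so the only slices a disprover can hope
to kill cheaply are `η < η*(a)`-candidates produced by NEW obstructions that count blocks (none
known), and the corner `a → 1` is literally `¬ X_C`.  Cycle-3 attacks: (i) frames stub — counting
gives `(7/5)^D ≤ N^η` only (§4); the orthogonality/sphere structure yields `N²M ≤ (2b+1)^D`
(dimension count, not formalised) and nothing contradictory; (ii) skew-USP design calculus (§9) —
positive, refutes the diagonal strengthening S5 and the linear one S6; (iii) re-examined Fourier/energy formulation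
`#{x + w = z} = L·N²·M` on `X = ⊔(Aᵢ − Bᵢ)`, `W = ⊔(Bⱼ − Cⱼ)`, `Z = ⊔(Aₖ − Cₖ)` (the STPP is
EXACTLY "only the block solutions"): one large coefficient `|Ẑ(χ)| ≥ L·N^{1−η}·M − N` is forced,
which is weaker than `M_le`; no kill.

STATUS AFTER CYCLE 2.  By §7 the crux is EQUIVALENT to `X_C` (stmt-0593): "for every ε > 0 some
STPP family in some finite abelian group has `Σ (|Aᵢ||Bᵢ||Cᵢ|)^{(2+ε)/3} > |H|`", i.e. abelian
STPP packings certify `ω = 2` through CKSU Thm 5.5.  So `¬ ThinPackings` is PRECISELY the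
abelian-STPP barrier in unbounded exponent — explicitly open in print: BCCGNSU 2017
(arXiv:1605.06702) p. 4 "our results do not rule out achieving ω = 2 by using STPP
constructions over abelian groups … when the group has a large cyclic factor … the constraints
analyzed here are irrelevant"; p. 6 (two-families conjecture, CKSU Conj. 4.7, "need not have
bounded exponent").  In ledger terms: `¬ ThinPackings ↔ CAbelianObstructionNeg` (stmt-0596, the
OPEN negative crux of route GroupTheoreticSTPP; §7 `cAbelianObstructionNeg_iff_not_thinPackings`)
— the disprover's target is itself a filed open item.  Consequences for everybody:
* for PLANNERS: the rank-2 crux of ThinBlockAlpha duplicates the rank-0 target of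
  GroupTheoreticSTPP; the thin shape `⟨N, N^a, N⟩` and the `(a, η)` bookkeeping are not
  load-bearing for the crux AS STATED (they are for the bounded-exponent rungs 3–5 and for the
  dual-exponent reading, which live elsewhere).  The "genuinely thin" repair (upper bound
  `M ≤ N^{a+η}` added) is STILL equivalent to `X_C` (§7b); only bounding the exponent / host
  (rungs 3–5) changes the problem.  The §6/§8 lemmas are stated for the matrix as filed and
  remain valid for the repair.
* for PROVERS: any abelian STPP family beating `(2+ε)/3` for all ε, of ANY shapes, proves the
  crux (set `M = N` after the §7 symmetrisation); conversely nothing short of `ω = 2`-strength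
  designs will do: the TRUE region of the `(a, η)` matrix known today is `{a < η}` (§8, split
  blocks) `∪ {η ≥ ε₀}` with `ε₀ = τ₀ − 2`, `τ₀` the best exponent certified by a square
  near-tight abelian STPP family in hand: `τ₀ < 2.41` (CKSU 2005 §6, arXiv:math/0511460
  pp. 10–11: "every construction we have found … has at its core a simultaneous triple product
  property construction in an abelian group", incl. the `ω < 2.41` example after Thm. 37 (§6.2) via
  `H`-charts — all of bounded exponent, hence capped away from 2 by Thm B).
* for the DISPROVER: every refutation must be `|H|`-uniform over ALL finite abelian groups and
  survive unbounded exponent and cyclic factors, where slice rank is powerless (BCCGU 2017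
  Thm B.8: `ℤ/N` has full slice rank; Behrend-type sets).  The only conditional handle in print
  is Pratt 2024 (arXiv:2309.03878): Conj. 4.1 (`Val(ℤ_n) ≤ n^{1+ε}`) bars `ω = 2` via STPP in
  homocyclic `ℤ_q^ℓ` (Thm 4.4, tree named fact `pratt2024_thm44`, transport half proved) and in
  groups with boundedly many cyclic factors (Cor. 4.5) — not all abelian groups, and Conj. 4.1 is
  open (its planar proxies are Behrend-large: Beker arXiv:2402.19169).  For THIN families in a
  cyclic host `ℤ_n`, Pratt Prop. 3.3 (tree `sum_card_mul_le_prattVal_of_addSimultaneousTPP`)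
  gives `Val(ℤ_n) ≥ L·N²M ≥ n·N^{a−η}`: Conj. 4.1 then only forces `N^{a−η} ≤ C_ε n^{ε}`, i.e.
  kills cyclic witnesses with POLYNOMIAL hosts `n ≤ N^{O(1)}` — tiny blocks in a huge cyclic
  group (`N = n^{o(1)}`) evade even the conjecture.  (At bounded exponent the host IS
  polynomial in `N`, §8 `host_cap_of_exponent_le`; for cyclic hosts no such cap is known.)

ATTACKS TRIED (cycles 1–2; cycle 3 above) and why each stops:
* trivial counting (§1, §3a, §6): squeezes `M ≤ N(N^η − 1) + 1`, `L ≥ N^{a−η}`, cores — all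
  consistent; they constrain the SHAPE of witnesses (no translates in any leg, `≥ N^{a−η}`
  difference classes per leg, middles nearly "difference-disjoint"), never existence;
* slice rank / tricolored sum-free (Thm B, strong form): needs bounded exponent (§3b S4, §8);
  `δ_ℓ → 0` as `ℓ → ∞`, and the crux may let the exponent grow (`(2+a)δ_{exp H} ≤ (2−2a)/3+η`);
* the `X × Y → H ∖ (A − C)` sumset count bites only for fat middles `M ≳ N^{1+η}`;
* cyclic / few-cyclic-factor hosts: barred only modulo Pratt Conj. 4.1 and only for
  polynomial-size hosts (above);
* rank / border-rank reading: `⊕_L ⟨N,M,N⟩ ≤ ⟨|H|⟩` restricts, an additive border-rank excess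
  per block only forces `N` large — `N` is the prover's to choose;
* character sums / multiplicative-orbit designs, finite-field quadric frames, product ("USP
  alphabet") designs, random menus: each specific DESIGN CLASS dies (ideator notes B1–B8:
  entropy cap `a ≤ 2H(p)/(log|Γ| − H(p))` for product designs, `η = a` for random label
  selection, Katz/Weil completion for norm-class designs, Chevalley–Warning for anisotropic
  frames, rank-metric Singleton for one-chart framed subspaces) — design-class obstructions,
  not statement-level ones; the §6 theorems are the statement-level shadow of B2/B3;
* no catalogued barrier (`Literature/Barriers/MatrixMultiplication/*`) reads unbounded-exponent
  abelian STPP at any shape; `ledger negatives` for the problem: nothing on abelian STPP;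
* small models (cycle 1, seat scratch/stpp222.py): no two-block `⟨2,2,2⟩` family in `ℤ/n` for
  `14 ≤ n ≤ 23`, first at `ℤ/24` (`A₀ = {0,1}`, `B₀ = {0,2}`, `C₀ = {0,4}`, `A₁ = {0,1}`,
  `B₁ = {8,10}`, `C₁ = {16,20}`) — calibration only (`N → ∞` is forced as `η → 0`).
A KILL NEEDS: for ONE `ε > 0`, a proof that NO finite abelian group carries a square STPP
family of side `n ≥ 2` with `|H| ≤ L·n^{2+ε}` (equivalently `¬ X_C`): a density-increment /
removal / entropy argument uniform in `|H|` that survives cyclic factors.  Nothing of the kind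
is known (2026-08); the honest verdict on the crux is "open problem, equivalent to the abelian
group-theoretic `ω = 2` conjecture's STPP form". -/

section Reductions

open Summit.MatrixMultiplication.MatrixMultiplication.Theses.GroupTheoreticSTPP (CThesis)

/-- `ThinPackings ⟹ X_C` (stmt-0593): thin near-tight families beat `(2+ε)/3` for every `ε`
(take `a = 1 − ε'/4`, `η = ε'/8`, `ε' = min ε 1`; then `|H| ≤ L·N^{2+η} < L·(N²M)^{(2+ε)/3}`).
[new, elementary] -/
theorem cThesis_of_thinPackings (h : ThinPackings) : CThesis := by
  intro ε hε
  set ε' : ℝ := min ε 1 with hε'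
  have hε'0 : 0 < ε' := lt_min hε one_pos
  have hε'1 : ε' ≤ 1 := min_le_right _ _
  have hε'ε : ε' ≤ ε := min_le_left _ _
  obtain ⟨H, i1, i2, L, N, M, A, B, C, hS, hc, hN, hM, hH⟩ :=
    h (1 - ε' / 4) (by linarith) (by linarith) (ε' / 8) (by positivity)
  refine ⟨H, i1, i2, L, A, B, C, hS, ?_⟩
  have hL := one_le_L hH
  have hLpos : (0 : ℝ) < L := by exact_mod_cast (by omega : 0 < L)
  have hN1 : (1 : ℝ) < N := by exact_mod_cast (by omega : 1 < N)
  have hNpos : (0 : ℝ) < N := by linarith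
  have hsum : ∑ i : Fin L, (((A i).card * (B i).card * (C i).card : ℕ) : ℝ) ^ ((2 + ε) / 3) =
      L * (((N * M * N : ℕ) : ℝ) ^ ((2 + ε) / 3)) := by
    rw [Finset.sum_congr rfl fun i _ => by rw [(hc i).1, (hc i).2.1, (hc i).2.2], sum_const,
      card_univ, Fintype.card_fin, nsmul_eq_mul]
  rw [hsum]
  have hvol : (N : ℝ) ^ (2 + (1 - ε' / 4)) ≤ ((N * M * N : ℕ) : ℝ) := by
    rw [Real.rpow_add hNpos, Real.rpow_two]
    push_cast
    calc (N : ℝ) ^ 2 * (N : ℝ) ^ (1 - ε' / 4) ≤ (N : ℝ) ^ 2 * (M : ℝ) := by gcongr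
      _ = (N : ℝ) * M * N := by ring
  have hexp_pos : (0 : ℝ) < (2 + ε) / 3 := by positivity
  have hlt : 2 + ε' / 8 < (2 + (1 - ε' / 4)) * ((2 + ε) / 3) := by
    nlinarith [mul_nonneg hε'0.le hε'0.le]
  calc (Fintype.card H : ℝ) ≤ L * (N : ℝ) ^ (2 + ε' / 8) := hH
    _ < L * (N : ℝ) ^ ((2 + (1 - ε' / 4)) * ((2 + ε) / 3)) :=
        mul_lt_mul_of_pos_left (Real.rpow_lt_rpow_of_exponent_lt hN1 hlt) hLpos
    _ ≤ L * ((N * M * N : ℕ) : ℝ) ^ ((2 + ε) / 3) := by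
        refine mul_le_mul_of_nonneg_left ?_ hLpos.le
        rw [Real.rpow_mul hNpos.le]
        exact Real.rpow_le_rpow (by positivity) hvol hexp_pos.le

/-- Hence a refutation of `X_C` refutes the crux. [new, elementary] -/
theorem thinPackings_false_of_not_cThesis (hX : ¬ CThesis) : ¬ ThinPackings :=
  fun h => hX (cThesis_of_thinPackings h)

end Reductions

end Summit.MatrixMultiplication.MatrixMultiplication.Cruxes.ThinPackings.Disproof
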